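import Literature.Computability.Complexity.HardcoreInapproximabilityGadget
import Literature.Computability.Complexity.HardcoreInapproximabilityFirstMoment
import Literature.Computability.Complexity.HardcoreInapproximabilityTrees
import HarnessLib

/-!
# Sly's gadget: from the explicit forest to the tree recursion, and the deterministic half of Theorem 2.1

Allan Sly, *Computational transition at the uniqueness threshold*, FOCS 2010 (arXiv:1005.5584), §4.

This file connects the explicit gadget of `HardcoreInapproximabilityGadget` (whose port trees are the
vertex type `SlyTreeV m D q` and whose forest weights are the sums `slyForestZ` over independent sets of
the forest) with the recursively defined single-tree partition functions `hcTreeZ` of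
`HardcoreInapproximabilityTrees`, and then carries out the deterministic part of Sly's proof of
Theorem 2.1:

* **Glue** (`slyPeelEquiv`, `slyForestZ_succ`, `slyForestZ_eq_prod`): peeling the roots off the forest,
  `SlyTreeV m (D+1) q ≃ Fin m ⊕ SlyTreeV (m q) D q`, gives the recursion of `slyForestZ` in the depth,
  whence `κ_S(E) = Π_j Z_D(j ∈ S, A_j(E))`.
* **(GpropB) from the bad boundary mass** (`slyForestZ_eq_tot_mul`, `slyPropB_of_bad_mass`): given the
  leaves, the ports are conditionally independent Bernoulli(`X_D(A_j)`); if the configurations with some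
  root marginal off by more than `t` carry a `β`-fraction of `Z_G(Y=s)`, then (GpropB) holds with
  `δ = (1+t/p)^{2m} - 1 + β/p^{2m}` (Sly (e:thetaB)–(e:lInfinityBound)).
* **Bad mass in expectation** (`bad_mass_expect_le`): union bound over the `2m` trees and the product
  structure of `Q_U ⊗ κ` (Sly (e:ProbBadB)), with the single-tree tails as inputs (Lemma 4.2,
  `sly_lemma42`).
* **Counting / Markov** (`weighted_lowerTail_of_pointwise` = Sly (e:tGpropProofA)–(e:tGpropProofB),
  `card_filter_gt_eight_avg`, `exists_typical_realisation`): from the pointwise lower tail of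
  Theorem 3.10 (as an input) to a realisation `(σ, τ)` typical for all six events.
* **Lemma 3.3 in phase form** (`sly_lemma33_phaseForm`) and the per-realisation conclusions
  (`sly_gadgetProps_of_typical`: (GpropB) with an explicit `δ`, and `Z_G(Y=¬s) ≤ 96 c Z_G(Y=s)`).
* **Asymptotic book-keeping and the final assembly** (`slyGadgetAt_of_facts`, `slyGadgetsAt_of_inputs`,
  `slyGadgetReduction_of_inputs`): Sly's Theorem 2.1 derandomised — hence `slyGadgetReduction` — from
  exactly two inputs: the Lemma 4.2 tail (`sly_lemma42`, in `HardcoreInapproximabilityTreesConc`) and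
  the pointwise lower tail of Theorem 3.10 (small subgraph conditioning; an input, not proved here).

No new named facts; everything is proved. [cite: Sly2010, §4.1, Lemma 4.2, Lemma 4.3, Theorem 2.1 (proof)]
-/

namespace Literature.Computability.Complexity

open Finset Literature.Probability.LatticeModels

section Peel

variable {m D q : ℕ}

/-- Arithmetic of the peeling map: for `p < q^(l+1)`, `p / q^l < q`. [folklore] -/
theorem div_pow_lt {p l q : ℕ} (h : p < q ^ (l + 1)) : p / q ^ l < q := by
  rcases Nat.eq_zero_or_pos q with rfl | hq
  · simp at h
  · exact (Nat.div_lt_iff_lt_mul (pow_pos hq l)).2 (by rw [← pow_succ']; exact h)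

/-- **Peeling the roots**: a vertex of the forest of `m` trees of depth `D+1` is either a root `j`, or
the vertex `(l, j q + c, p')` of the forest of `m q` trees of depth `D` formed by the subtrees of the
children `c` of the roots (`(l+1, j, p) ↦ (l, j q + p / q^l, p % q^l)`). [folklore] -/
def slyPeel (t : SlyTreeV m (D + 1) q) : Fin m ⊕ SlyTreeV (m * q) D q :=
  if hl : (t.1.1 : ℕ) = 0 then Sum.inl t.1.2.1
  else Sum.inr ⟨(⟨(t.1.1 : ℕ) - 1, by have := t.1.1.isLt; omega⟩,
      ⟨t.1.2.1 * q + t.1.2.2 / q ^ ((t.1.1 : ℕ) - 1), by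
        have hp : t.1.2.2 < q ^ ((t.1.1 : ℕ) - 1 + 1) := by
          rw [Nat.sub_add_cancel (Nat.pos_of_ne_zero hl)]; exact t.2
        have hc := div_pow_lt hp
        have hj := t.1.2.1.isLt
        calc (t.1.2.1 : ℕ) * q + t.1.2.2 / q ^ ((t.1.1 : ℕ) - 1) < t.1.2.1 * q + q := by omega
          _ = (t.1.2.1 + 1) * q := by ring
          _ ≤ m * q := Nat.mul_le_mul_right _ hj⟩,
      t.1.2.2 % q ^ ((t.1.1 : ℕ) - 1)), by
        simp only
        have hp : t.1.2.2 < q ^ ((t.1.1 : ℕ) - 1 + 1) := by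
          rw [Nat.sub_add_cancel (Nat.pos_of_ne_zero hl)]; exact t.2
        have hq : 0 < q ^ ((t.1.1 : ℕ) - 1) := by
          rcases Nat.eq_zero_or_pos q with rfl | hq
          · simp at hp
          · exact pow_pos hq _
        exact Nat.mod_lt _ hq⟩

/-- The inverse of `slyPeel`. [folklore] -/
def slyUnpeel : Fin m ⊕ SlyTreeV (m * q) D q → SlyTreeV m (D + 1) q
  | Sum.inl j => ⟨(0, j, 0), by simp⟩
  | Sum.inr t => ⟨(⟨(t.1.1 : ℕ) + 1, by have := t.1.1.isLt; omega⟩,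
      ⟨(t.1.2.1 : ℕ) / q, by
        have h := t.1.2.1.isLt
        rcases Nat.eq_zero_or_pos q with rfl | hq
        · simp at h
        · exact (Nat.div_lt_iff_lt_mul hq).2 h⟩,
      ((t.1.2.1 : ℕ) % q) * q ^ (t.1.1 : ℕ) + t.1.2.2), by
        simp only
        have hp := t.2
        have h := t.1.2.1.isLt
        rcases Nat.eq_zero_or_pos q with rfl | hq
        · simp at h
        have hr : (t.1.2.1 : ℕ) % q < q := Nat.mod_lt _ hq
        calc (t.1.2.1 : ℕ) % q * q ^ (t.1.1 : ℕ) + t.1.2.2 < (t.1.2.1 : ℕ) % q * q ^ (t.1.1 : ℕ) + q ^ (t.1.1 : ℕ) := by omega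
          _ = ((t.1.2.1 : ℕ) % q + 1) * q ^ (t.1.1 : ℕ) := by ring
          _ ≤ q * q ^ (t.1.1 : ℕ) := Nat.mul_le_mul_right _ hr
          _ = q ^ ((t.1.1 : ℕ) + 1) := (pow_succ' q _).symm⟩

/-- `slyUnpeel ∘ slyPeel = id`. [folklore] -/
theorem slyUnpeel_slyPeel (t : SlyTreeV m (D + 1) q) : slyUnpeel (slyPeel t) = t := by
  obtain ⟨⟨l, j, p⟩, hp⟩ := t
  unfold slyPeel
  simp only
  split_ifs with hl
  · simp only [slyUnpeel]
    apply Subtype.ext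
    have hp' : p < q ^ (l : ℕ) := hp
    rw [hl, pow_zero, Nat.lt_one_iff] at hp'
    exact Prod.ext (Fin.ext hl.symm) (Prod.ext rfl hp'.symm)
  · simp only [slyUnpeel]
    apply Subtype.ext
    have hl1 : 1 ≤ (l : ℕ) := Nat.pos_of_ne_zero hl
    have hp2 : p < q ^ ((l : ℕ) - 1 + 1) := by rw [Nat.sub_add_cancel hl1]; exact hp
    have hq : 0 < q := by
      rcases Nat.eq_zero_or_pos q with rfl | hq
      · simp at hp2
      · exact hq
    have hc := div_pow_lt hp2
    refine Prod.ext (Fin.ext (by simp only; omega)) (Prod.ext (Fin.ext ?_) ?_)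
    · show ((j : ℕ) * q + p / q ^ ((l : ℕ) - 1)) / q = j
      rw [Nat.add_comm, Nat.add_mul_div_right _ _ hq, Nat.div_eq_of_lt hc, zero_add]
    · show ((j : ℕ) * q + p / q ^ ((l : ℕ) - 1)) % q * q ^ ((l : ℕ) - 1) + p % q ^ ((l : ℕ) - 1) = p
      rw [Nat.add_comm ((j : ℕ) * q), Nat.add_mul_mod_self_right, Nat.mod_eq_of_lt hc]
      exact Nat.div_add_mod' p (q ^ ((l : ℕ) - 1))

/-- `slyPeel ∘ slyUnpeel = id`. [folklore] -/
theorem slyPeel_slyUnpeel (x : Fin m ⊕ SlyTreeV (m * q) D q) : slyPeel (slyUnpeel x) = x := by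
  rcases x with j | ⟨⟨l, j', p'⟩, hp'⟩
  · simp [slyPeel, slyUnpeel]
  · have h := j'.isLt
    have hq : 0 < q := by
      rcases Nat.eq_zero_or_pos q with rfl | hq
      · simp at h
      · exact hq
    have hp'' : p' < q ^ (l : ℕ) := hp'
    unfold slyPeel
    simp only [slyUnpeel, Nat.add_one_ne_zero, ↓reduceDIte, Nat.add_sub_cancel, Sum.inr.injEq]
    apply Subtype.ext
    have hqL : 0 < q ^ (l : ℕ) := pow_pos hq _
    refine Prod.ext (Fin.ext rfl) (Prod.ext (Fin.ext ?_) ?_)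
    · show (j' : ℕ) / q * q + ((j' : ℕ) % q * q ^ (l : ℕ) + p') / q ^ (l : ℕ) = j'
      rw [Nat.add_comm ((j' : ℕ) % q * q ^ (l : ℕ)), Nat.add_mul_div_right _ _ hqL, Nat.div_eq_of_lt hp'', zero_add]
      exact Nat.div_add_mod' j' q
    · show ((j' : ℕ) % q * q ^ (l : ℕ) + p') % q ^ (l : ℕ) = p'
      rw [Nat.add_comm, Nat.add_mul_mod_self_right, Nat.mod_eq_of_lt hp'']

/-- `slyPeel` as an equivalence. [folklore] -/
def slyPeelEquiv (m D q : ℕ) : SlyTreeV m (D + 1) q ≃ Fin m ⊕ SlyTreeV (m * q) D q :=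
  ⟨slyPeel, slyUnpeel, slyUnpeel_slyPeel, slyPeel_slyUnpeel⟩

end Peel

section PeelProps

variable {m D q : ℕ}

/-- Level of the peeled vertex. [folklore] -/
theorem slyPeel_inr_level {t : SlyTreeV m (D + 1) q} {t' : SlyTreeV (m * q) D q} (h : slyPeel t = Sum.inr t') :
    (t'.1.1 : ℕ) + 1 = t.1.1 := by
  unfold slyPeel at h
  split_ifs at h with hl
  simp only [Sum.inr.injEq] at h
  subst h
  simp only
  omega

/-- A vertex peels to `inl j` iff it is the root `j`. [folklore] -/
theorem slyPeel_eq_inl_iff {t : SlyTreeV m (D + 1) q} {j : Fin m} :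
    slyPeel t = Sum.inl j ↔ t = slyRoot m (D + 1) q j := by
  constructor
  · intro h
    unfold slyPeel at h
    split_ifs at h with hl
    simp only [Sum.inl.injEq] at h
    obtain ⟨⟨l, j', p⟩, hp⟩ := t
    simp only at hl h hp
    subst h
    apply Subtype.ext
    have hp' : p < q ^ (l : ℕ) := hp
    rw [hl, pow_zero, Nat.lt_one_iff] at hp'
    exact Prod.ext (Fin.ext hl) (Prod.ext rfl hp')
  · rintro rfl
    simp [slyPeel, slyRoot]

/-- Roots peel to `inl`. [folklore] -/
theorem slyPeel_slyRoot (j : Fin m) : slyPeel (slyRoot m (D + 1) q j) = Sum.inl j :=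
  slyPeel_eq_inl_iff.2 rfl

/-- Leaves keep their number: `slyPeel (leaf u) = inr (leaf u)` (up to the cast
`m q^{D+1} = (m q) q^D`). [folklore] -/
theorem slyPeel_slyLeaf (u : Fin (m * q ^ (D + 1))) :
    slyPeel (slyLeaf m (D + 1) q u) =
      Sum.inr (slyLeaf (m * q) D q (Fin.cast (by rw [pow_succ']; ring) u)) := by
  rcases Nat.eq_zero_or_pos q with rfl | hq
  · exact absurd u.isLt (by simp)
  have hqD : 0 < q ^ D := pow_pos hq D
  unfold slyPeel
  have hl : ((slyLeaf m (D + 1) q u).1.1 : ℕ) = D + 1 := slyLeaf_level u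
  rw [dif_neg (by rw [hl]; omega)]
  simp only [Sum.inr.injEq]
  apply Subtype.ext
  simp only [slyLeaf, Fin.val_last]
  have e : ∀ n : ℕ, q ^ (D + 1) * n = (n * q) * q ^ D := fun n => by rw [pow_succ]; ring
  refine Prod.ext (Fin.ext (by simp)) (Prod.ext (Fin.ext ?_) ?_)
  · -- tree index: `j q + p / q^D = u / q^D`
    simp only [finProdFinEquiv_symm_apply, Fin.coe_divNat, Fin.coe_modNat, Fin.val_cast, Nat.add_sub_cancel]
    rw [show (u : ℕ) / q ^ D = ((u : ℕ) % q ^ (D + 1) + q ^ (D + 1) * ((u : ℕ) / q ^ (D + 1))) / q ^ D by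
      rw [Nat.mod_add_div]]
    rw [e, Nat.add_mul_div_right _ _ hqD]
    ring
  · -- position: `p % q^D = u % q^D`
    simp only [finProdFinEquiv_symm_apply, Fin.coe_modNat, Fin.val_cast, Nat.add_sub_cancel]
    conv_rhs => rw [← Nat.mod_add_div (u : ℕ) (q ^ (D + 1))]
    rw [e, Nat.add_mul_mod_self_right]

/-- The parent of a non-root vertex `(l+1, j, p)` is `(l, j, p / q)`; for a root we return the root. [folklore] -/
def slyParent (t : SlyTreeV m D q) : SlyTreeV m D q :=
  ⟨(⟨(t.1.1 : ℕ) - 1, by have := t.1.1.isLt; omega⟩, t.1.2.1, t.1.2.2 / q), by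
    have hp : t.1.2.2 < q ^ (t.1.1 : ℕ) := t.2
    show t.1.2.2 / q < q ^ ((t.1.1 : ℕ) - 1)
    rcases Nat.eq_zero_or_pos (t.1.1 : ℕ) with h0 | hpos
    · rw [h0, pow_zero] at hp
      have : t.1.2.2 = 0 := by omega
      rw [this, Nat.zero_div, h0]; simp
    · rcases Nat.eq_zero_or_pos q with hq0 | hq
      · exfalso
        subst hq0
        have h1 : (0 : ℕ) ^ (t.1.1 : ℕ) = 0 := zero_pow hpos.ne'
        omega
      · exact (Nat.div_lt_iff_lt_mul hq).2 (by rw [← pow_succ, Nat.sub_add_cancel hpos]; exact hp)⟩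

/-- `SlyIsChild q t t'` says exactly: `t'` is not a root and `t` is its parent. [folklore] -/
theorem slyIsChild_iff_parent {t t' : SlyTreeV m D q} :
    SlyIsChild q t t' ↔ 1 ≤ (t'.1.1 : ℕ) ∧ t = slyParent t' := by
  constructor
  · rintro ⟨h1, h2, h3⟩
    refine ⟨by omega, Subtype.ext ?_⟩
    unfold slyParent
    exact Prod.ext (Fin.ext (by simp only; omega)) (Prod.ext h2.symm h3.symm)
  · rintro ⟨h1, rfl⟩
    unfold slyParent SlyIsChild
    exact ⟨by simp only; omega, rfl, rfl⟩

end PeelProps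

section PeelParent

variable {m D q : ℕ}

/-- Peeling commutes with taking parents above level `1`:
`slyPeel (parent t') = inr (parent s)` when `slyPeel t' = inr s` and `s` is not a root. [folklore] -/
theorem slyPeel_slyParent {t' : SlyTreeV m (D + 1) q} {s : SlyTreeV (m * q) D q} (h : slyPeel t' = Sum.inr s)
    (hs : 1 ≤ (s.1.1 : ℕ)) : slyPeel (slyParent t') = Sum.inr (slyParent s) := by
  have hlev := slyPeel_inr_level h
  have hl2 : 2 ≤ (t'.1.1 : ℕ) := by omega
  unfold slyPeel at h
  rw [dif_neg (by omega)] at h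
  simp only [Sum.inr.injEq] at h
  rw [← h]
  have hp' : t'.1.2.2 < q ^ (t'.1.1 : ℕ) := t'.2
  have hq : 0 < q := by
    rcases Nat.eq_zero_or_pos q with hq0 | hq
    · exfalso; subst hq0
      have : (0 : ℕ) ^ (t'.1.1 : ℕ) = 0 := zero_pow (by omega)
      omega
    · exact hq
  unfold slyPeel slyParent
  rw [dif_neg (by show ¬((t'.1.1 : ℕ) - 1 = 0); omega)]
  simp only [Sum.inr.injEq]
  apply Subtype.ext
  refine Prod.ext (Fin.ext (by show (t'.1.1 : ℕ) - 1 - 1 = (t'.1.1 : ℕ) - 1 - 1; rfl)) (Prod.ext (Fin.ext ?_) ?_)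
  · -- `j q + (p / q) / q^{l-2} = j q + p / q^{l-1}`
    show (t'.1.2.1 : ℕ) * q + t'.1.2.2 / q / q ^ ((t'.1.1 : ℕ) - 1 - 1) = t'.1.2.1 * q + t'.1.2.2 / q ^ ((t'.1.1 : ℕ) - 1)
    rw [Nat.div_div_eq_div_mul, ← pow_succ', show (t'.1.1 : ℕ) - 1 - 1 + 1 = (t'.1.1 : ℕ) - 1 by omega]
  · -- `(p / q) % q^{l-2} = (p % q^{l-1}) / q`
    show t'.1.2.2 / q % q ^ ((t'.1.1 : ℕ) - 1 - 1) = t'.1.2.2 % q ^ ((t'.1.1 : ℕ) - 1) / q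
    rw [← Nat.mod_mul_right_div_self, ← pow_succ', show (t'.1.1 : ℕ) - 1 - 1 + 1 = (t'.1.1 : ℕ) - 1 by omega]

/-- A vertex of level `1` is a child of the root of its tree, and peels to a root `j'` of the small
forest with `j' / q` = its tree. [folklore] -/
theorem slyPeel_level_one {t' : SlyTreeV m (D + 1) q} (h1 : (t'.1.1 : ℕ) = 1) :
    ∃ j' : Fin (m * q), slyPeel t' = Sum.inr (slyRoot (m * q) D q j') ∧ (j' : ℕ) / q = t'.1.2.1 ∧
      slyParent t' = slyRoot m (D + 1) q t'.1.2.1 := by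
  have hp' : t'.1.2.2 < q := by
    have hp : t'.1.2.2 < q ^ (t'.1.1 : ℕ) := t'.2
    rw [h1, pow_one] at hp; exact hp
  have hq : 0 < q := by omega
  have hj := t'.1.2.1.isLt
  refine ⟨⟨t'.1.2.1 * q + t'.1.2.2, by nlinarith⟩, ?_, ?_, ?_⟩
  · unfold slyPeel
    rw [dif_neg (by omega)]
    simp only [Sum.inr.injEq]
    apply Subtype.ext
    unfold slyRoot
    refine Prod.ext (Fin.ext (by show (t'.1.1 : ℕ) - 1 = 0; omega)) (Prod.ext (Fin.ext ?_) ?_)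
    · show (t'.1.2.1 : ℕ) * q + t'.1.2.2 / q ^ ((t'.1.1 : ℕ) - 1) = t'.1.2.1 * q + t'.1.2.2
      rw [h1]; simp
    · show t'.1.2.2 % q ^ ((t'.1.1 : ℕ) - 1) = 0
      rw [h1]; simp [Nat.mod_one]
  · show ((t'.1.2.1 : ℕ) * q + t'.1.2.2) / q = t'.1.2.1
    rw [Nat.add_comm, Nat.add_mul_div_right _ _ hq, Nat.div_eq_of_lt hp', zero_add]
  · unfold slyParent slyRoot
    apply Subtype.ext
    refine Prod.ext (Fin.ext (by show (t'.1.1 : ℕ) - 1 = 0; omega)) (Prod.ext rfl ?_)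
    show t'.1.2.2 / q = 0
    exact Nat.div_eq_of_lt hp'

/-- Conversely, a vertex peeling to a root has level `1`. [folklore] -/
theorem level_one_of_slyPeel_root {t' : SlyTreeV m (D + 1) q} {j' : Fin (m * q)}
    (h : slyPeel t' = Sum.inr (slyRoot (m * q) D q j')) : (t'.1.1 : ℕ) = 1 := by
  have h1 := slyPeel_inr_level h
  have h2 : ((slyRoot (m * q) D q j').1.1 : ℕ) = 0 := rfl
  omega

end PeelParent

section Assemble

variable {m D q : ℕ}

/-- Reassembling a forest configuration from its roots `R` and its peeled part `K'`. [folklore] -/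
noncomputable def slyAssemble (R : Finset (Fin m)) (K' : Finset (SlyTreeV (m * q) D q)) : Finset (SlyTreeV m (D + 1) q) :=
  (R.disjSum K').map (slyPeelEquiv m D q).symm.toEmbedding

/-- Membership in a reassembled configuration. [folklore] -/
theorem mem_slyAssemble {R : Finset (Fin m)} {K' : Finset (SlyTreeV (m * q) D q)} {t : SlyTreeV m (D + 1) q} :
    t ∈ slyAssemble R K' ↔ slyPeel t ∈ R.disjSum K' := by
  unfold slyAssemble
  rw [Finset.mem_map_equiv]
  rfl

/-- Roots of a reassembled configuration. [folklore] -/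
theorem slyRoot_mem_slyAssemble {R : Finset (Fin m)} {K' : Finset (SlyTreeV (m * q) D q)} {j : Fin m} :
    slyRoot m (D + 1) q j ∈ slyAssemble R K' ↔ j ∈ R := by
  rw [mem_slyAssemble, slyPeel_slyRoot, Finset.inl_mem_disjSum]

/-- Non-root vertices of a reassembled configuration. [folklore] -/
theorem slyUnpeel_inr_mem_slyAssemble {R : Finset (Fin m)} {K' : Finset (SlyTreeV (m * q) D q)} {s : SlyTreeV (m * q) D q} :
    slyUnpeel (Sum.inr s) ∈ slyAssemble R K' ↔ s ∈ K' := by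
  rw [mem_slyAssemble, show slyPeel (slyUnpeel (Sum.inr s) : SlyTreeV m (D + 1) q) = Sum.inr s from slyPeel_slyUnpeel _,
    Finset.inr_mem_disjSum]

/-- Membership via the peel (non-root case). [folklore] -/
theorem mem_slyAssemble_of_peel_inr {R : Finset (Fin m)} {K' : Finset (SlyTreeV (m * q) D q)} {t : SlyTreeV m (D + 1) q}
    {s : SlyTreeV (m * q) D q} (h : slyPeel t = Sum.inr s) : t ∈ slyAssemble R K' ↔ s ∈ K' := by
  rw [mem_slyAssemble, h, Finset.inr_mem_disjSum]

/-- Membership via the peel (root case). [folklore] -/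
theorem mem_slyAssemble_of_peel_inl {R : Finset (Fin m)} {K' : Finset (SlyTreeV (m * q) D q)} {t : SlyTreeV m (D + 1) q}
    {j : Fin m} (h : slyPeel t = Sum.inl j) : t ∈ slyAssemble R K' ↔ j ∈ R := by
  rw [mem_slyAssemble, h, Finset.inl_mem_disjSum]

/-- Reassembly is a bijection `Finset (Fin m) × Finset (SlyTreeV (m q) D q) ≃ Finset (SlyTreeV m (D+1) q)`. [folklore] -/
noncomputable def slyAssembleEquiv (m D q : ℕ) :
    Finset (Fin m) × Finset (SlyTreeV (m * q) D q) ≃ Finset (SlyTreeV m (D + 1) q) :=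
  (Finset.sumEquiv.toEquiv.symm).trans (Equiv.finsetCongr (slyPeelEquiv m D q).symm)

/-- Unfolding lemma for `slyAssembleEquiv`. [folklore] -/
theorem slyAssembleEquiv_apply (R : Finset (Fin m)) (K' : Finset (SlyTreeV (m * q) D q)) :
    slyAssembleEquiv m D q (R, K') = slyAssemble R K' := rfl

/-- Summing over forest configurations of depth `D+1` = summing over (roots, peeled part). [folklore] -/
theorem sum_finset_slyTreeV_succ {M : Type*} [AddCommMonoid M] (f : Finset (SlyTreeV m (D + 1) q) → M) :
    ∑ K, f K = ∑ R : Finset (Fin m), ∑ K' : Finset (SlyTreeV (m * q) D q), f (slyAssemble R K') := by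
  rw [← (slyAssembleEquiv m D q).sum_comp, Fintype.sum_prod_type]
  rfl

/-- Leaves of the reassembled configuration. [folklore] -/
theorem slyLeaf_mem_slyAssemble {R : Finset (Fin m)} {K' : Finset (SlyTreeV (m * q) D q)} (u : Fin (m * q ^ (D + 1))) :
    slyLeaf m (D + 1) q u ∈ slyAssemble R K' ↔
      slyLeaf (m * q) D q (Fin.cast (by rw [pow_succ']; ring) u) ∈ K' :=
  mem_slyAssemble_of_peel_inr (slyPeel_slyLeaf u)

/-- The number of internal vertices of the reassembled configuration: all of `R` plus the internal
vertices of `K'`. [folklore] -/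
theorem card_internal_slyAssemble (R : Finset (Fin m)) (K' : Finset (SlyTreeV (m * q) D q)) :
    ((slyAssemble R K').filter fun t => (t.1.1 : ℕ) < D + 1).card =
      R.card + (K'.filter fun s => (s.1.1 : ℕ) < D).card := by
  classical
  unfold slyAssemble
  rw [Finset.filter_map, Finset.card_map]
  -- the filter on the disjoint sum splits
  have : (R.disjSum K').filter ((fun t : SlyTreeV m (D + 1) q => (t.1.1 : ℕ) < D + 1) ∘ (slyPeelEquiv m D q).symm.toEmbedding) =
      R.disjSum (K'.filter fun s => (s.1.1 : ℕ) < D) := by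
    ext x
    simp only [Finset.mem_filter, Finset.mem_disjSum, Function.comp]
    constructor
    · rintro ⟨h1 | h1, h2⟩
      · exact Or.inl h1
      · obtain ⟨s, hs, rfl⟩ := h1
        refine Or.inr ⟨s, ⟨hs, ?_⟩, rfl⟩
        have e : ((slyPeelEquiv m D q).symm.toEmbedding (Sum.inr s) : SlyTreeV m (D + 1) q) = slyUnpeel (Sum.inr s) := rfl
        rw [e] at h2
        simp only [slyUnpeel] at h2
        omega
    · rintro (h1 | ⟨s, hs, rfl⟩)
      · obtain ⟨j, hj, rfl⟩ := h1
        refine ⟨Or.inl ⟨j, hj, rfl⟩, ?_⟩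
        show ((slyUnpeel (Sum.inl j) : SlyTreeV m (D + 1) q).1.1 : ℕ) < D + 1
        simp [slyUnpeel]
      · refine ⟨Or.inr ⟨s, hs.1, rfl⟩, ?_⟩
        show ((slyUnpeel (Sum.inr s) : SlyTreeV m (D + 1) q).1.1 : ℕ) < D + 1
        simp only [slyUnpeel]
        omega
  rw [this, Finset.card_disjSum]

end Assemble

section IndepSplit

variable {m D q : ℕ}

/-- `slyPeel` is injective. [folklore] -/
theorem slyPeel_injective : Function.Injective (slyPeel : SlyTreeV m (D + 1) q → _) :=
  (slyPeelEquiv m D q).injective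

/-- A vertex of the big forest whose peel is `inr s` belongs to `slyAssemble R K'` iff `s ∈ K'`, and
every `s` arises this way. [folklore] -/
theorem exists_peel_inr (s : SlyTreeV (m * q) D q) : ∃ t : SlyTreeV m (D + 1) q, slyPeel t = Sum.inr s :=
  ⟨slyUnpeel (Sum.inr s), slyPeel_slyUnpeel _⟩

/-- **Independence splits under peeling**: a reassembled configuration is independent in the forest
of depth `D+1` iff its peeled part is independent in the forest of depth `D` and no occupied root of
the small forest (a child of a root of the big one) sits under an occupied root. [folklore] -/
theorem slyForestIndep_slyAssemble {R : Finset (Fin m)} {K' : Finset (SlyTreeV (m * q) D q)} :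
    SlyForestIndep q (slyAssemble R K') ↔
      (∀ j' : Fin (m * q), slyRoot (m * q) D q j' ∈ K' → Fin.divNat j' ∉ R) ∧ SlyForestIndep q K' := by
  constructor
  · intro h
    constructor
    · intro j' hj' hR
      -- the root `j'/q` and its child peeling to `root' j'`
      set t' : SlyTreeV m (D + 1) q := slyUnpeel (Sum.inr (slyRoot (m * q) D q j')) with ht'
      have hpt' : slyPeel t' = Sum.inr (slyRoot (m * q) D q j') := slyPeel_slyUnpeel _
      have h1 := level_one_of_slyPeel_root hpt'
      obtain ⟨j'', hp'', hdiv, hpar⟩ := slyPeel_level_one h1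
      rw [hpt'] at hp''
      have hjj : j'' = j' := (slyRoot_injective _ _ _ (Sum.inr.inj hp'')).symm
      subst hjj
      have hjt : Fin.divNat j'' = t'.1.2.1 := Fin.ext hdiv
      refine h _ (slyRoot_mem_slyAssemble.2 (hjt ▸ hR)) t' ((mem_slyAssemble_of_peel_inr hpt').2 hj') ?_
      rw [slyIsChild_iff_parent]
      exact ⟨by omega, hpar.symm⟩
    · intro s hs s' hs' hc
      obtain ⟨hl, hpar⟩ := slyIsChild_iff_parent.1 hc
      obtain ⟨t, ht⟩ := exists_peel_inr (m := m) s
      obtain ⟨t', ht'⟩ := exists_peel_inr (m := m) s'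
      have hpp := slyPeel_slyParent ht' hl
      rw [← hpar, ← ht] at hpp
      have htp : slyParent t' = t := slyPeel_injective hpp
      refine h t ((mem_slyAssemble_of_peel_inr ht).2 hs) t' ((mem_slyAssemble_of_peel_inr ht').2 hs') ?_
      rw [slyIsChild_iff_parent]
      have := slyPeel_inr_level ht'
      exact ⟨by omega, htp.symm⟩
  · rintro ⟨hroots, hK'⟩ t ht t' ht' hc
    obtain ⟨hl, hpar⟩ := slyIsChild_iff_parent.1 hc
    rcases Nat.lt_or_ge (t'.1.1 : ℕ) 2 with hlt | hge
    · -- `t'` has level `1`: it is a child of the root `t`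
      have h1 : (t'.1.1 : ℕ) = 1 := by omega
      obtain ⟨j', hp', hdiv, hpar'⟩ := slyPeel_level_one h1
      have hroot' : slyRoot (m * q) D q j' ∈ K' := (mem_slyAssemble_of_peel_inr hp').1 ht'
      have hjR : Fin.divNat j' ∉ R := hroots j' hroot'
      apply hjR
      have hjt : Fin.divNat j' = t'.1.2.1 := Fin.ext hdiv
      rw [hjt, ← slyRoot_mem_slyAssemble (D := D) (q := q) (K' := K'), ← hpar', ← hpar]
      exact ht
    · -- `t'` has level `≥ 2`: the relation lives in the small forest
      have hne : (t'.1.1 : ℕ) ≠ 0 := by omega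
      obtain ⟨s', hs'⟩ : ∃ s', slyPeel t' = Sum.inr s' := by
        unfold slyPeel; rw [dif_neg hne]; exact ⟨_, rfl⟩
      have hlev := slyPeel_inr_level hs'
      have hpp := slyPeel_slyParent hs' (by omega)
      rw [← hpar] at hpp
      exact hK' (slyParent s') ((mem_slyAssemble_of_peel_inr hpp).1 ht) s' ((mem_slyAssemble_of_peel_inr hs').1 ht')
        (slyIsChild_iff_parent.2 ⟨by omega, rfl⟩)

end IndepSplit

section ForestRecursion

variable {m D q : ℕ}

/-- The root set of a small-forest configuration. [folklore] -/
noncomputable def slyRootSet (K' : Finset (SlyTreeV m D q)) : Finset (Fin m) :=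
  univ.filter fun j => slyRoot m D q j ∈ K'

/-- Membership in the root set. [folklore] -/
theorem mem_slyRootSet {K' : Finset (SlyTreeV m D q)} {j : Fin m} : j ∈ slyRootSet K' ↔ slyRoot m D q j ∈ K' := by
  simp [slyRootSet]

/-- The root set is characterised by root membership. [folklore] -/
theorem slyRootSet_eq_iff (K' : Finset (SlyTreeV m D q)) (S' : Finset (Fin m)) :
    (∀ j, slyRoot m D q j ∈ K' ↔ j ∈ S') ↔ slyRootSet K' = S' := by
  constructor
  · intro h; ext j; rw [mem_slyRootSet, h]
  · rintro rfl j; rw [mem_slyRootSet]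

/-- A sum of `if c then f i else 0` with a constant condition. [folklore] -/
theorem sum_ite_const_cond {ι : Type*} (s : Finset ι) (c : Prop) [Decidable c] (f : ι → ℝ) :
    (∑ i ∈ s, if c then f i else 0) = if c then ∑ i ∈ s, f i else 0 := by
  split_ifs with h <;> simp

open scoped Classical in
/-- **Peeling the roots off `slyForestZ`** (the forest of `m` trees of depth `D+1` = its `m` roots +
the forest of `m q` subtrees of depth `D`):
`κ^{(m, D+1)}_S(E) = λ^{|S|} Σ_{S' ⊆ [mq], no j' ∈ S' under an occupied root} κ^{(mq, D)}_{S'}(E)`.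
[folklore] -/
theorem slyForestZ_succ (m D q : ℕ) (lam : ℝ) (E : Finset (Fin (m * q ^ (D + 1)))) (S : Finset (Fin m))
    (hcast : m * q ^ (D + 1) = m * q * q ^ D) :
    slyForestZ m (D + 1) q lam E S =
      lam ^ S.card * ∑ S' : Finset (Fin (m * q)),
        if ∀ j' ∈ S', Fin.divNat j' ∉ S then
          slyForestZ (m * q) D q lam (E.map (finCongr hcast).toEmbedding) S' else 0 := by
  set E' := E.map (finCongr hcast).toEmbedding with hE'
  have hmemE' : ∀ u' : Fin (m * q * q ^ D), u' ∈ E' ↔ (finCongr hcast).symm u' ∈ E := fun u' => by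
    rw [hE', Finset.mem_map_equiv]
  unfold slyForestZ
  rw [sum_finset_slyTreeV_succ]
  -- Step 1: rewrite each summand in terms of `(R, K')`
  have h1 : ∀ (R : Finset (Fin m)) (K' : Finset (SlyTreeV (m * q) D q)),
      (if (∀ u, slyLeaf m (D + 1) q u ∈ slyAssemble R K' ↔ u ∈ E) ∧ SlyForestIndep q (slyAssemble R K') ∧
          (∀ j, slyRoot m (D + 1) q j ∈ slyAssemble R K' ↔ j ∈ S) then
        lam ^ ((slyAssemble R K').filter fun t => (t.1.1 : ℕ) < D + 1).card else (0 : ℝ)) =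
      if R = S then
        (if (∀ j' : Fin (m * q), slyRoot (m * q) D q j' ∈ K' → Fin.divNat j' ∉ S) ∧
            (∀ u', slyLeaf (m * q) D q u' ∈ K' ↔ u' ∈ E') ∧ SlyForestIndep q K' then
          lam ^ S.card * lam ^ (K'.filter fun s => (s.1.1 : ℕ) < D).card else 0) else 0 := by
    intro R K'
    have hleaves : (∀ u, slyLeaf m (D + 1) q u ∈ slyAssemble R K' ↔ u ∈ E) ↔
        (∀ u', slyLeaf (m * q) D q u' ∈ K' ↔ u' ∈ E') := by
      rw [(finCongr hcast).forall_congr_left]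
      refine forall_congr' fun u' => ?_
      rw [slyLeaf_mem_slyAssemble, hmemE']
      simp [finCongr]
    have hroots : (∀ j, slyRoot m (D + 1) q j ∈ slyAssemble R K' ↔ j ∈ S) ↔ R = S := by
      simp only [slyRoot_mem_slyAssemble]
      exact ⟨fun h => Finset.ext h, fun h j => by rw [h]⟩
    rw [card_internal_slyAssemble]
    simp only [hleaves, slyForestIndep_slyAssemble, hroots]
    by_cases hRS : R = S
    · subst hRS
      simp only [if_true, and_true]
      by_cases hc : (∀ u', slyLeaf (m * q) D q u' ∈ K' ↔ u' ∈ E') ∧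
          ((∀ j' : Fin (m * q), slyRoot (m * q) D q j' ∈ K' → Fin.divNat j' ∉ R) ∧ SlyForestIndep q K')
      · rw [if_pos hc, if_pos ⟨hc.2.1, hc.1, hc.2.2⟩, pow_add]
      · rw [if_neg hc, if_neg (fun h => hc ⟨h.2.1, h.1, h.2.2⟩)]
    · simp [hRS]
  simp_rw [h1]
  -- Step 2: collapse the sum over `R`
  rw [Finset.sum_eq_single S (fun R _ hR => by simp [hR]) (by simp)]
  simp only [if_true]
  -- Step 3: pull out `λ^{|S|}` and fibre over the root set `S'` of `K'`
  have h2 : ∀ K' : Finset (SlyTreeV (m * q) D q),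
      (if (∀ j' : Fin (m * q), slyRoot (m * q) D q j' ∈ K' → Fin.divNat j' ∉ S) ∧
          (∀ u', slyLeaf (m * q) D q u' ∈ K' ↔ u' ∈ E') ∧ SlyForestIndep q K' then
        lam ^ S.card * lam ^ (K'.filter fun s => (s.1.1 : ℕ) < D).card else (0 : ℝ)) =
      lam ^ S.card * ∑ S' : Finset (Fin (m * q)), if ∀ j' ∈ S', Fin.divNat j' ∉ S then
        (if (∀ u', slyLeaf (m * q) D q u' ∈ K' ↔ u' ∈ E') ∧ SlyForestIndep q K' ∧
            (∀ j, slyRoot (m * q) D q j ∈ K' ↔ j ∈ S') then lam ^ (K'.filter fun s => (s.1.1 : ℕ) < D).card else 0)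
        else 0 := by
    intro K'
    rw [Finset.sum_eq_single (slyRootSet K')]
    · have hP : (∀ j' ∈ slyRootSet K', Fin.divNat j' ∉ S) ↔
          ∀ j' : Fin (m * q), slyRoot (m * q) D q j' ∈ K' → Fin.divNat j' ∉ S :=
        ⟨fun h j' hj' => h j' (mem_slyRootSet.2 hj'), fun h j' hj' => h j' (mem_slyRootSet.1 hj')⟩
      have hR0 : ∀ j, slyRoot (m * q) D q j ∈ K' ↔ j ∈ slyRootSet K' := fun j => mem_slyRootSet.symm
      by_cases hp : ∀ j' : Fin (m * q), slyRoot (m * q) D q j' ∈ K' → Fin.divNat j' ∉ S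
      · rw [if_pos (hP.2 hp)]
        by_cases hlf : (∀ u', slyLeaf (m * q) D q u' ∈ K' ↔ u' ∈ E') ∧ SlyForestIndep q K'
        · rw [if_pos ⟨hp, hlf⟩, if_pos ⟨hlf.1, hlf.2, hR0⟩]
        · rw [if_neg (fun h => hlf h.2), if_neg (fun h => hlf ⟨h.1, h.2.1⟩), mul_zero]
      · rw [if_neg (fun h => hp h.1), if_neg (fun h => hp (hP.1 h)), mul_zero]
    · intro S' _ hS'
      have : ¬(∀ j, slyRoot (m * q) D q j ∈ K' ↔ j ∈ S') := fun h => hS' ((slyRootSet_eq_iff K' S').1 h).symm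
      by_cases hA' : ∀ j' ∈ S', Fin.divNat j' ∉ S
      · rw [if_pos hA', if_neg (fun h => this h.2.2)]
      · rw [if_neg hA']
    · simp
  simp_rw [h2]
  rw [← Finset.mul_sum, Finset.sum_comm]
  congr 1
  refine Finset.sum_congr rfl fun S' _ => ?_
  exact sum_ite_const_cond _ _ _

end ForestRecursion

/-- `Z_{L+1}(0, A) = Π_c (Z_L(0, A_c) + Z_L(1, A_c))` (the `false` branch of the recursion, expanded). [folklore] -/
theorem hcTreeZ_succ_false' {q : ℕ} {lam : ℝ} (L : ℕ) (A : Fin (q ^ (L + 1)) → Bool) :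
    hcTreeZ q lam (L + 1) false A =
      ∏ c : Fin q, (hcTreeZ q lam L false (hcBlockConfig A c) + hcTreeZ q lam L true (hcBlockConfig A c)) := rfl

section ProductSide

variable {m D q : ℕ} {lam : ℝ}

/-- The leaf configuration of tree `j` of the forest of `m` trees of depth `D`: leaf `p` of tree `j` is
the forest leaf `finProdFinEquiv (j, p)`. [folklore] -/
def slyTreeConfig (m D q : ℕ) (E : Finset (Fin (m * q ^ D))) (j : Fin m) : Fin (q ^ D) → Bool :=
  fun p => decide (finProdFinEquiv (j, p) ∈ E)

/-- Blocks of the leaf configuration of tree `j` of the big forest are the leaf configurations of the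
trees `(j, c)` of the peeled forest. [folklore] -/
theorem hcBlockConfig_slyTreeConfig (hcast : m * q ^ (D + 1) = m * q * q ^ D) (E : Finset (Fin (m * q ^ (D + 1))))
    (j : Fin m) (c : Fin q) :
    hcBlockConfig (slyTreeConfig m (D + 1) q E j) c =
      slyTreeConfig (m * q) D q (E.map (finCongr hcast).toEmbedding) (finProdFinEquiv (j, c)) := by
  funext i
  unfold hcBlockConfig slyTreeConfig
  rw [decide_eq_decide, Finset.mem_map_equiv]
  -- both leaves have the number `i + c q^D + j q^{D+1}`
  have : (finProdFinEquiv (j, hcBlock q D c i) : Fin (m * q ^ (D + 1))) =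
      (finCongr hcast).symm (finProdFinEquiv (finProdFinEquiv (j, c), i)) := by
    apply Fin.ext
    simp [finProdFinEquiv, finCongr, pow_succ, hcBlock]
    ring
  rw [this]

/-- **The product side of the peeling recursion**:
`Π_j Z_{D+1}(j ∈ S, A_j) = λ^{|S|} Σ_{S' avoiding the children of S} Π_{j'} Z_D(j' ∈ S', A'_{j'})`. [folklore] -/
theorem prod_hcTreeZ_succ (hcast : m * q ^ (D + 1) = m * q * q ^ D) (E : Finset (Fin (m * q ^ (D + 1))))
    (S : Finset (Fin m)) :
    ∏ j : Fin m, hcTreeZ q lam (D + 1) (decide (j ∈ S)) (slyTreeConfig m (D + 1) q E j) =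
      lam ^ S.card * ∑ S' : Finset (Fin (m * q)),
        if ∀ j' ∈ S', Fin.divNat j' ∉ S then
          ∏ j' : Fin (m * q), hcTreeZ q lam D (decide (j' ∈ S'))
            (slyTreeConfig (m * q) D q (E.map (finCongr hcast).toEmbedding) j') else 0 := by
  classical
  set A' := slyTreeConfig (m * q) D q (E.map (finCongr hcast).toEmbedding) with hA'
  set Zf : Fin m × Fin q → ℝ := fun jc => hcTreeZ q lam D false (A' (finProdFinEquiv jc)) with hZf
  set Zt : Fin m × Fin q → ℝ := fun jc => hcTreeZ q lam D true (A' (finProdFinEquiv jc)) with hZt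
  -- (R1) unfold one level
  have h1 : ∀ j : Fin m, hcTreeZ q lam (D + 1) (decide (j ∈ S)) (slyTreeConfig m (D + 1) q E j) =
      if j ∈ S then lam * ∏ c, Zf (j, c) else ∏ c, (Zf (j, c) + Zt (j, c)) := by
    intro j
    by_cases hj : j ∈ S
    · rw [decide_eq_true hj, hcTreeZ_succ_true, if_pos hj]
      simp only [hZf, hA', hcBlockConfig_slyTreeConfig hcast]
    · rw [decide_eq_false hj, hcTreeZ_succ_false', if_neg hj]
      simp only [hZf, hZt, hA', hcBlockConfig_slyTreeConfig hcast]
  simp_rw [h1]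
  -- (R2) split the product over `j ∈ S` and `j ∉ S`
  rw [Finset.prod_ite, Finset.filter_mem_eq_inter, Finset.univ_inter, Finset.prod_mul_distrib,
    Finset.prod_const]
  -- (R3)+(R4): the products over pairs
  have hpairs : (∏ j ∈ S, ∏ c, Zf (j, c)) * ∏ j ∈ univ.filter (fun j => ¬j ∈ S), ∏ c, (Zf (j, c) + Zt (j, c)) =
      ∑ T : Finset (Fin m × Fin q), if (∀ jc ∈ T, jc.1 ∉ S) then ∏ jc, (if jc ∈ T then Zt jc else Zf jc) else 0 := by
    rw [← Finset.prod_product' (s := S) (t := univ) (f := fun j c => Zf (j, c)),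
      ← Finset.prod_product' (s := univ.filter (fun j => ¬j ∈ S)) (t := univ) (f := fun j c => Zf (j, c) + Zt (j, c))]
    rw [show (∏ x ∈ (univ.filter (fun j => ¬j ∈ S)) ×ˢ (univ : Finset (Fin q)), (Zf (x.1, x.2) + Zt (x.1, x.2))) =
      ∏ x ∈ (univ.filter (fun j => ¬j ∈ S)) ×ˢ (univ : Finset (Fin q)), (Zt x + Zf x) from
      Finset.prod_congr rfl fun x _ => by ring]
    rw [Finset.prod_add]
    rw [Finset.mul_sum]
    -- powerset sum as a sum over all `T` with an indicator
    have hpow : ∀ (G : Finset (Fin m × Fin q) → ℝ),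
        ∑ T ∈ ((univ.filter (fun j => ¬j ∈ S)) ×ˢ (univ : Finset (Fin q))).powerset, G T =
          ∑ T : Finset (Fin m × Fin q), if (∀ jc ∈ T, jc.1 ∉ S) then G T else 0 := by
      intro G
      rw [← Finset.sum_filter]
      congr 1
      ext T
      simp only [Finset.mem_powerset, Finset.mem_filter, Finset.mem_univ, true_and]
      constructor
      · intro h jc hjc; have := h hjc; simp at this; exact this
      · intro h jc hjc; simp; exact h jc hjc
    rw [hpow]
    refine Finset.sum_congr rfl fun T _ => ?_
    by_cases hT : ∀ jc ∈ T, jc.1 ∉ S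
    · rw [if_pos hT, if_pos hT]
      -- `Π_{S×univ} Zf · (Π_T Zt · Π_{(Sᶜ×univ)\T} Zf) = Π_all (if ∈ T then Zt else Zf)`
      rw [Finset.prod_ite, Finset.filter_mem_eq_inter, Finset.univ_inter]
      have hunion : (univ.filter fun jc : Fin m × Fin q => ¬jc ∈ T) =
          (S ×ˢ (univ : Finset (Fin q))) ∪ (((univ.filter (fun j => ¬j ∈ S)) ×ˢ (univ : Finset (Fin q))) \ T) := by
        ext jc
        simp only [Finset.mem_filter, Finset.mem_univ, true_and, Finset.mem_union, Finset.mem_product, and_true,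
          Finset.mem_sdiff]
        constructor
        · intro h
          by_cases hj : jc.1 ∈ S
          · exact Or.inl hj
          · exact Or.inr ⟨hj, h⟩
        · rintro (h | ⟨-, h⟩)
          · exact fun hT' => hT jc hT' h
          · exact h
      have hdisj : Disjoint (S ×ˢ (univ : Finset (Fin q))) (((univ.filter (fun j => ¬j ∈ S)) ×ˢ (univ : Finset (Fin q))) \ T) := by
        rw [Finset.disjoint_left]
        intro jc h1 h2
        simp only [Finset.mem_product, Finset.mem_univ, and_true] at h1
        simp only [Finset.mem_sdiff, Finset.mem_product, Finset.mem_filter, Finset.mem_univ, true_and, and_true] at h2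
        exact h2.1 h1
      rw [hunion, Finset.prod_union hdisj]
      simp only [hZf]
      ring
    · rw [if_neg hT, if_neg hT]
  rw [mul_assoc, hpairs, Finset.mul_sum, Finset.mul_sum]
  -- (R5) reindex `T ⊆ Fin m × Fin q` by `S' = T.map finProdFinEquiv ⊆ Fin (m q)`
  rw [← (Equiv.finsetCongr (finProdFinEquiv (m := m) (n := q))).symm.sum_comp]
  refine Finset.sum_congr rfl fun S' _ => ?_
  have hmem : ∀ jc : Fin m × Fin q, jc ∈ (Equiv.finsetCongr finProdFinEquiv).symm S' ↔ finProdFinEquiv jc ∈ S' := by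
    intro jc
    rw [Equiv.finsetCongr_symm, Equiv.finsetCongr_apply, Finset.mem_map_equiv]
    simp
  have hdiv : ∀ jc : Fin m × Fin q, Fin.divNat (finProdFinEquiv jc) = jc.1 := fun jc =>
    congrArg Prod.fst (finProdFinEquiv.symm_apply_apply jc)
  have hcond : (∀ jc ∈ (Equiv.finsetCongr finProdFinEquiv).symm S', jc.1 ∉ S) ↔ ∀ j' ∈ S', Fin.divNat j' ∉ S := by
    constructor
    · intro h j' hj'
      have h2 := h (finProdFinEquiv.symm j') (by rw [hmem, Equiv.apply_symm_apply]; exact hj')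
      exact h2
    · intro h jc hjc
      rw [hmem] at hjc
      have h2 := h _ hjc
      rwa [hdiv] at h2
  simp only [hcond]
  congr 1
  by_cases hS' : ∀ j' ∈ S', Fin.divNat j' ∉ S
  · rw [if_pos hS', if_pos hS', ← (finProdFinEquiv (m := m) (n := q)).prod_comp]
    refine Finset.prod_congr rfl fun jc _ => ?_
    by_cases hjc : finProdFinEquiv jc ∈ S'
    · rw [if_pos ((hmem jc).2 hjc), decide_eq_true hjc]
    · rw [if_neg (fun h => hjc ((hmem jc).1 h)), decide_eq_false hjc]
  · rw [if_neg hS', if_neg hS']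

end ProductSide

section Induction

variable {q : ℕ} {lam : ℝ}

/-- At depth `0` every vertex is a root (and a leaf). [folklore] -/
theorem slyTreeV_zero_eq_root {m : ℕ} (t : SlyTreeV m 0 q) : t = slyRoot m 0 q t.1.2.1 := by
  obtain ⟨⟨l, j, p⟩, hp⟩ := t
  have hl : (l : ℕ) = 0 := by have := l.isLt; omega
  have hp' : p < q ^ (l : ℕ) := hp
  rw [hl, pow_zero, Nat.lt_one_iff] at hp'
  apply Subtype.ext
  exact Prod.ext (Fin.ext hl) (Prod.ext rfl hp')

/-- At depth `0` the leaves are the roots. [folklore] -/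
theorem slyLeaf_zero {m : ℕ} (u : Fin (m * q ^ 0)) : slyLeaf m 0 q u = slyRoot m 0 q (Fin.divNat u) := by
  rw [slyTreeV_zero_eq_root (slyLeaf m 0 q u)]
  rfl

/-- At depth `0` there are no parent–child pairs. [folklore] -/
theorem not_slyIsChild_zero {m : ℕ} (t t' : SlyTreeV m 0 q) : ¬SlyIsChild q t t' := by
  rintro ⟨h, -, -⟩
  have := t'.1.1.isLt
  have := t.1.1.isLt
  omega

open scoped Classical in
/-- **The base case**: at depth `0` the forest weight is the indicator that the occupied leaves are
exactly the occupied roots. [folklore] -/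
theorem slyForestZ_zero (m : ℕ) (E : Finset (Fin (m * q ^ 0))) (S : Finset (Fin m)) :
    slyForestZ m 0 q lam E S = ∏ j : Fin m, hcTreeZ q lam 0 (decide (j ∈ S)) (slyTreeConfig m 0 q E j) := by
  -- the right-hand side is the indicator of `∀ j, (leaf (j,0) ∈ E ↔ j ∈ S)`
  set z0 : Fin (q ^ 0) := ⟨0, by simp⟩ with hz0
  have hR : ∀ j : Fin m, hcTreeZ q lam 0 (decide (j ∈ S)) (slyTreeConfig m 0 q E j) =
      if (finProdFinEquiv (j, z0) ∈ E ↔ j ∈ S) then 1 else 0 := by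
    intro j
    rw [hcTreeZ_zero]
    unfold slyTreeConfig
    by_cases h : (finProdFinEquiv (j, z0) ∈ E ↔ j ∈ S)
    · rw [if_pos h, if_pos (decide_eq_decide.2 h)]
    · rw [if_neg h, if_neg (fun h' => h (decide_eq_decide.1 h'))]
  simp_rw [hR]
  rw [Fintype.prod_boole]
  -- the left-hand side: only `K = S.map root` contributes, with weight `λ^0 = 1`
  unfold slyForestZ
  set K₀ : Finset (SlyTreeV m 0 q) := S.map ⟨slyRoot m 0 q, slyRoot_injective m 0 q⟩ with hK₀
  have hmemK₀ : ∀ j, slyRoot m 0 q j ∈ K₀ ↔ j ∈ S := fun j => by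
    rw [hK₀, Finset.mem_map]
    exact ⟨fun ⟨j', hj', e⟩ => slyRoot_injective _ _ _ e ▸ hj', fun h => ⟨j, h, rfl⟩⟩
  have hroots : ∀ K : Finset (SlyTreeV m 0 q), (∀ j, slyRoot m 0 q j ∈ K ↔ j ∈ S) ↔ K = K₀ := by
    intro K
    constructor
    · intro h
      ext t
      rw [slyTreeV_zero_eq_root t, h, hmemK₀]
    · rintro rfl; exact hmemK₀
  rw [Finset.sum_eq_single K₀]
  · -- the main term
    have hFI : SlyForestIndep q K₀ := fun t _ t' _ => not_slyIsChild_zero t t'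
    have hcard : (K₀.filter fun t : SlyTreeV m 0 q => (t.1.1 : ℕ) < 0).card = 0 := by simp
    simp only [hFI, hmemK₀, implies_true, and_true, hcard, pow_zero]
    -- the leaf conditions agree
    congr 1
    apply propext
    constructor
    · intro h j
      have := h (finProdFinEquiv (j, z0))
      rw [slyLeaf_zero, hmemK₀] at this
      have e : Fin.divNat (finProdFinEquiv (j, z0)) = j := congrArg Prod.fst (finProdFinEquiv.symm_apply_apply (j, z0))
      rw [e] at this
      exact this.symm
    · intro h u
      rw [slyLeaf_zero, hmemK₀]
      have hu : u = finProdFinEquiv (Fin.divNat u, z0) := by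
        have e := (finProdFinEquiv.apply_symm_apply u).symm
        rw [finProdFinEquiv_symm_apply] at e
        convert e using 3
        apply Fin.ext
        have := (Fin.modNat u).isLt
        simp only [pow_zero, Nat.lt_one_iff] at this
        rw [hz0]; simp only; omega
      conv_rhs => rw [hu]
      exact (h _).symm
  · intro K _ hK
    rw [if_neg]
    exact fun h => hK ((hroots K).1 h.2.2)
  · simp

open scoped Classical in
/-- **The glue (T7b)**: Sly's forest weight `κ_S(E)` of the gadget (`slyForestZ`, a sum over the
independent sets of the explicit forest `SlyTreeV`) is the product over the `m` trees of the
recursively defined single-tree partition functions `hcTreeZ` (root state `j ∈ S`, leaf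
configuration `p ↦ [leaf (j,p) ∈ E]`). [folklore] -/
theorem slyForestZ_eq_prod (q : ℕ) (lam : ℝ) : ∀ (D m : ℕ) (E : Finset (Fin (m * q ^ D))) (S : Finset (Fin m)),
    slyForestZ m D q lam E S = ∏ j : Fin m, hcTreeZ q lam D (decide (j ∈ S)) (slyTreeConfig m D q E j)
  | 0, m, E, S => slyForestZ_zero m E S
  | D + 1, m, E, S => by
    have hcast : m * q ^ (D + 1) = m * q * q ^ D := by rw [pow_succ']; ring
    rw [slyForestZ_succ m D q lam E S hcast, prod_hcTreeZ_succ hcast E S]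
    congr 1
    refine Finset.sum_congr rfl fun S' _ => ?_
    split_ifs with h
    · exact slyForestZ_eq_prod q lam D (m * q) _ S'
    · rfl

end Induction

section PortStructure

variable {m D q : ℕ} {lam : ℝ}

/-- The total forest weight given the leaves, `κ(E) = Σ_S κ_S(E) = Π_j Z_D(A_j)`. [folklore] -/
theorem sum_slyForestZ (E : Finset (Fin (m * q ^ D))) :
    ∑ S : Finset (Fin m), slyForestZ m D q lam E S = ∏ j : Fin m, hcTreeZtot q lam D (slyTreeConfig m D q E j) := by
  classical
  simp_rw [slyForestZ_eq_prod]
  unfold hcTreeZtot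
  rw [show (∏ j : Fin m, (hcTreeZ q lam D false (slyTreeConfig m D q E j) + hcTreeZ q lam D true (slyTreeConfig m D q E j))) =
    ∏ j : Fin m, (hcTreeZ q lam D true (slyTreeConfig m D q E j) + hcTreeZ q lam D false (slyTreeConfig m D q E j)) from
    Finset.prod_congr rfl fun j _ => add_comm _ _]
  rw [Fintype.prod_add]
  refine Finset.sum_congr rfl fun S _ => ?_
  rw [show (∏ j : Fin m, hcTreeZ q lam D (decide (j ∈ S)) (slyTreeConfig m D q E j)) =
    ∏ j : Fin m, (if j ∈ S then hcTreeZ q lam D true (slyTreeConfig m D q E j)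
      else hcTreeZ q lam D false (slyTreeConfig m D q E j)) from
    Finset.prod_congr rfl fun j _ => by by_cases hj : j ∈ S <;> simp [hj]]
  rw [Finset.prod_ite, Finset.filter_mem_eq_inter, Finset.univ_inter]
  congr 1
  refine Finset.prod_congr ?_ fun _ _ => rfl
  ext j; simp [Finset.mem_compl]

/-- **The conditional port law given the leaves is a product of Bernoullis**:
`κ_S(E) = κ(E) · Π_j (X_j if j ∈ S else 1 - X_j)`, `X_j = X_D(A_j)` the root marginal of tree `j`
given its leaves ("`σ_V` is conditionally a product measure given `σ_U = η`", Sly §4.1 / proof of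
Thm 2.1). [cite: Sly2010, §4.1 (proof of Theorem 2.1, first display)] -/
theorem slyForestZ_eq_tot_mul (hlam : 0 ≤ lam) (E : Finset (Fin (m * q ^ D))) (S : Finset (Fin m)) :
    slyForestZ m D q lam E S =
      (∏ j : Fin m, hcTreeZtot q lam D (slyTreeConfig m D q E j)) *
        ∏ j : Fin m, (if j ∈ S then hcTreeX q lam D (slyTreeConfig m D q E j)
          else 1 - hcTreeX q lam D (slyTreeConfig m D q E j)) := by
  classical
  rw [slyForestZ_eq_prod, ← Finset.prod_mul_distrib]
  refine Finset.prod_congr rfl fun j _ => ?_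
  have hT := hcTreeZtot_pos hlam D (slyTreeConfig m D q E j) (q := q)
  by_cases hj : j ∈ S
  · rw [decide_eq_true hj, if_pos hj]
    unfold hcTreeX
    field_simp
  · rw [decide_eq_false hj, if_neg hj]
    unfold hcTreeX
    rw [mul_sub, mul_one, mul_div_cancel₀ _ hT.ne']
    unfold hcTreeZtot
    ring

/-- `a^{|S|}(1-a)^{m-|S|} = Π_j (a if j ∈ S else 1-a)`. [folklore] -/
theorem pow_card_mul_pow_eq_prod_ite (a : ℝ) (S : Finset (Fin m)) :
    a ^ S.card * (1 - a) ^ (m - S.card) = ∏ j : Fin m, (if j ∈ S then a else 1 - a) := by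
  classical
  rw [Finset.prod_ite, Finset.filter_mem_eq_inter, Finset.univ_inter, Finset.prod_const, Finset.prod_const]
  congr 2
  have : (univ.filter fun j : Fin m => j ∉ S) = univ \ S := by ext j; simp
  rw [this, Finset.card_univ_sdiff, Fintype.card_fin]

/-- The port law as a product over the `2m` ports. [folklore] -/
theorem portLaw_eq_prod (a b : ℝ) (Sp Sm : Finset (Fin m)) :
    portLaw a b m (Sp, Sm) =
      (∏ j : Fin m, (if j ∈ Sp then a else 1 - a)) * ∏ j : Fin m, (if j ∈ Sm then b else 1 - b) := by
  unfold portLaw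
  rw [pow_card_mul_pow_eq_prod_ite, pow_card_mul_pow_eq_prod_ite]

/-- `2 ≤ (1+x)^k + (1-x)^k` for `0 ≤ x ≤ 1` (Bernoulli twice). [folklore] -/
theorem two_le_pow_add_pow {x : ℝ} (hx0 : 0 ≤ x) (hx1 : x ≤ 1) (k : ℕ) : 2 ≤ (1 + x) ^ k + (1 - x) ^ k := by
  have h1 := one_add_mul_le_pow (by linarith : (-2 : ℝ) ≤ x) k
  have h2 := one_add_mul_le_pow (by linarith : (-2 : ℝ) ≤ -x) k
  rw [show (1 : ℝ) + -x = 1 - x by ring] at h2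
  nlinarith

/-- **Products of factors within relative error `x`**: if `g_j ≥ 0` and
`g_j (1-x) ≤ f_j ≤ g_j (1+x)` for all `j` (`0 ≤ x ≤ 1`), then
`(1-x)^{|s|} Π g ≤ Π f ≤ (1+x)^{|s|} Π g`. [folklore] -/
theorem prod_mem_of_rel_err {ι : Type*} (s : Finset ι) {f g : ι → ℝ} {x : ℝ} (hx0 : 0 ≤ x) (hx1 : x ≤ 1)
    (hg : ∀ j ∈ s, 0 ≤ g j) (hlo : ∀ j ∈ s, g j * (1 - x) ≤ f j) (hhi : ∀ j ∈ s, f j ≤ g j * (1 + x)) :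
    (1 - x) ^ s.card * ∏ j ∈ s, g j ≤ ∏ j ∈ s, f j ∧ ∏ j ∈ s, f j ≤ (1 + x) ^ s.card * ∏ j ∈ s, g j := by
  classical
  induction s using Finset.induction_on with
  | empty => simp
  | insert a s ha ih =>
    obtain ⟨ih1, ih2⟩ := ih (fun j hj => hg j (Finset.mem_insert_of_mem hj))
      (fun j hj => hlo j (Finset.mem_insert_of_mem hj)) (fun j hj => hhi j (Finset.mem_insert_of_mem hj))
    have hga := hg a (Finset.mem_insert_self a s)
    have hfa0 : 0 ≤ f a := le_trans (mul_nonneg hga (by linarith)) (hlo a (Finset.mem_insert_self a s))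
    have hPg : 0 ≤ ∏ j ∈ s, g j := Finset.prod_nonneg fun j hj => hg j (Finset.mem_insert_of_mem hj)
    rw [Finset.prod_insert ha, Finset.prod_insert ha, Finset.card_insert_of_notMem ha, pow_succ, pow_succ]
    constructor
    · calc (1 - x) ^ s.card * (1 - x) * (g a * ∏ j ∈ s, g j) = (g a * (1 - x)) * ((1 - x) ^ s.card * ∏ j ∈ s, g j) := by ring
        _ ≤ f a * ∏ j ∈ s, f j := mul_le_mul (hlo a (Finset.mem_insert_self a s)) ih1
            (mul_nonneg (pow_nonneg (by linarith) _) hPg) hfa0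
    · calc f a * ∏ j ∈ s, f j ≤ (g a * (1 + x)) * ((1 + x) ^ s.card * ∏ j ∈ s, g j) :=
            mul_le_mul (hhi a (Finset.mem_insert_self a s)) ih2 (Finset.prod_nonneg fun j hj =>
              le_trans (mul_nonneg (hg j (Finset.mem_insert_of_mem hj)) (by linarith)) (hlo j (Finset.mem_insert_of_mem hj)))
              (mul_nonneg hga (by linarith))
        _ = (1 + x) ^ s.card * (1 + x) * (g a * ∏ j ∈ s, g j) := by ring

/-- The two-sided product estimate as an absolute bound: `|Π f - Π g| ≤ ((1+x)^{|s|} - 1) Π g`. [folklore] -/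
theorem abs_prod_sub_prod_le {ι : Type*} (s : Finset ι) {f g : ι → ℝ} {x : ℝ} (hx0 : 0 ≤ x) (hx1 : x ≤ 1)
    (hg : ∀ j ∈ s, 0 ≤ g j) (hlo : ∀ j ∈ s, g j * (1 - x) ≤ f j) (hhi : ∀ j ∈ s, f j ≤ g j * (1 + x)) :
    |∏ j ∈ s, f j - ∏ j ∈ s, g j| ≤ ((1 + x) ^ s.card - 1) * ∏ j ∈ s, g j := by
  obtain ⟨h1, h2⟩ := prod_mem_of_rel_err s hx0 hx1 hg hlo hhi
  have hPg : 0 ≤ ∏ j ∈ s, g j := Finset.prod_nonneg hg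
  have h3 := two_le_pow_add_pow hx0 hx1 s.card
  rw [abs_le]
  constructor <;> nlinarith

end PortStructure

section GpropBAlgebra

variable {n m D q : ℕ}

/-- Combining two relative product errors: `|P_A P_B - Q_A Q_B| ≤ ((1+x)^{2m} - 1) Q_A Q_B` when
`(1-x)^m Q ≤ P ≤ (1+x)^m Q` on both sides. [folklore] -/
theorem abs_mul_sub_mul_le_of_rel {PA PB QA QB x : ℝ} {m : ℕ} (hx0 : 0 ≤ x) (hx1 : x ≤ 1) (hQA : 0 ≤ QA) (hQB : 0 ≤ QB)
    (hA1 : (1 - x) ^ m * QA ≤ PA) (hA2 : PA ≤ (1 + x) ^ m * QA) (hB1 : (1 - x) ^ m * QB ≤ PB) (hB2 : PB ≤ (1 + x) ^ m * QB) :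
    |PA * PB - QA * QB| ≤ ((1 + x) ^ (2 * m) - 1) * (QA * QB) := by
  have h2 := two_le_pow_add_pow hx0 hx1 m
  have hpow : (1 + x) ^ (2 * m) = ((1 + x) ^ m) ^ 2 := by rw [← pow_mul, mul_comm]
  have hm1 : 1 ≤ (1 + x) ^ m := one_le_pow₀ (by linarith)
  have hlo : 0 ≤ (1 - x) ^ m := pow_nonneg (by linarith) _
  rw [hpow, abs_le]
  constructor
  · -- lower bound: `PA PB ≥ (1-x)^{2m} QA QB ≥ (2 - (1+x)^{2m}) QA QB`
    have hPA0 : 0 ≤ PA := le_trans (mul_nonneg hlo hQA) hA1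
    have h3 : (1 - x) ^ m * QA * ((1 - x) ^ m * QB) ≤ PA * PB := mul_le_mul hA1 hB1 (mul_nonneg hlo hQB) hPA0
    have h4 : 2 ≤ ((1 + x) ^ m) ^ 2 + ((1 - x) ^ m) ^ 2 := by nlinarith [sq_nonneg ((1 + x) ^ m - (1 - x) ^ m)]
    have hQQ := mul_nonneg hQA hQB
    have h5 : (2 - ((1 + x) ^ m) ^ 2) * (QA * QB) ≤ ((1 - x) ^ m) ^ 2 * (QA * QB) :=
      mul_le_mul_of_nonneg_right (by linarith) hQQ
    nlinarith [h3, h5]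
  · have hPB0 : 0 ≤ PB := le_trans (mul_nonneg hlo hQB) hB1
    have h3 : PA * PB ≤ (1 + x) ^ m * QA * ((1 + x) ^ m * QB) :=
      mul_le_mul hA2 hB2 hPB0 (mul_nonneg (by linarith) hQA)
    nlinarith [mul_nonneg hQA hQB]

/-- Relative product bounds for the conditional port law of one side: if every root marginal `X_j`
is within `t` of `c`, `p ≤ c ≤ 1 - p`, `t ≤ p`, then
`(1-t/p)^m Π(c-law) ≤ Π(X-law) ≤ (1+t/p)^m Π(c-law)`. [folklore] -/
theorem prod_ite_rel_bounds (X : Fin m → ℝ) {c t p : ℝ} (hp0 : 0 < p) (ht0 : 0 ≤ t) (htp : t ≤ p)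
    (hpc : p ≤ c) (hpc' : p ≤ 1 - c) (hclose : ∀ j, |X j - c| ≤ t) (T : Finset (Fin m)) :
    (1 - t / p) ^ m * (∏ j : Fin m, (if j ∈ T then c else 1 - c)) ≤ ∏ j : Fin m, (if j ∈ T then X j else 1 - X j) ∧
      (∏ j : Fin m, (if j ∈ T then X j else 1 - X j)) ≤ (1 + t / p) ^ m * ∏ j : Fin m, (if j ∈ T then c else 1 - c) := by
  have hx0 : 0 ≤ t / p := div_nonneg ht0 hp0.le
  have hx1 : t / p ≤ 1 := by rw [div_le_one hp0]; exact htp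
  have htc : t ≤ t / p * c := by
    rw [div_mul_eq_mul_div, le_div_iff₀ hp0]; nlinarith
  have htc' : t ≤ t / p * (1 - c) := by
    rw [div_mul_eq_mul_div, le_div_iff₀ hp0]; nlinarith
  have hc0 : 0 ≤ c := hp0.le.trans hpc
  have h := prod_mem_of_rel_err (univ : Finset (Fin m)) (f := fun j => if j ∈ T then X j else 1 - X j)
    (g := fun j => if j ∈ T then c else 1 - c) hx0 hx1
    (fun j _ => by by_cases hj : j ∈ T <;> simp only [hj, if_true, if_false] <;> linarith)
    (fun j _ => by
      have h1 := abs_le.1 (hclose j)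
      by_cases hj : j ∈ T
      · simp only [hj, if_true]; nlinarith
      · simp only [hj, if_false]; nlinarith)
    (fun j _ => by
      have h1 := abs_le.1 (hclose j)
      by_cases hj : j ∈ T
      · simp only [hj, if_true]; nlinarith
      · simp only [hj, if_false]; nlinarith)
  rw [Finset.card_univ, Fintype.card_fin] at h
  exact h

/-- A product of numbers in `[0,1]` is in `[0,1]`. [folklore] -/
theorem prod_ite_mem_unit (X : Fin m → ℝ) (hX : ∀ j, X j ∈ Set.Icc (0 : ℝ) 1) (T : Finset (Fin m)) :
    0 ≤ ∏ j : Fin m, (if j ∈ T then X j else 1 - X j) ∧ ∏ j : Fin m, (if j ∈ T then X j else 1 - X j) ≤ 1 := by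
  have hf : ∀ j, 0 ≤ (if j ∈ T then X j else 1 - X j) ∧ (if j ∈ T then X j else 1 - X j) ≤ 1 := fun j => by
    by_cases hj : j ∈ T
    · simp only [hj, if_true]; exact ⟨(hX j).1, (hX j).2⟩
    · simp only [hj, if_false]; constructor <;> linarith [(hX j).1, (hX j).2]
  exact ⟨Finset.prod_nonneg fun j _ => (hf j).1, Finset.prod_le_one (fun j _ => (hf j).1) fun j _ => (hf j).2⟩

/-- The constant-parameter port product lies in `[p^m, 1]` when the parameter is in `[p, 1-p]`. [folklore] -/
theorem prod_ite_const_bounds {c p : ℝ} (hp0 : 0 < p) (hpc : p ≤ c) (hpc' : p ≤ 1 - c) (T : Finset (Fin m)) :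
    p ^ m ≤ ∏ j : Fin m, (if j ∈ T then c else 1 - c) ∧ 0 ≤ ∏ j : Fin m, (if j ∈ T then c else 1 - c) ∧
      ∏ j : Fin m, (if j ∈ T then c else 1 - c) ≤ 1 := by
  have hf : ∀ j, p ≤ (if j ∈ T then c else 1 - c) ∧ (if j ∈ T then c else 1 - c) ≤ 1 := fun j => by
    by_cases hj : j ∈ T
    · simp only [hj, if_true]; constructor <;> linarith
    · simp only [hj, if_false]; constructor <;> linarith
  refine ⟨?_, Finset.prod_nonneg fun j _ => hp0.le.trans (hf j).1,
    Finset.prod_le_one (fun j _ => hp0.le.trans (hf j).1) fun j _ => (hf j).2⟩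
  calc p ^ m = ∏ _j : Fin m, p := by rw [Finset.prod_const, Finset.card_univ, Fintype.card_fin]
    _ ≤ _ := Finset.prod_le_prod (fun j _ => hp0.le) fun j _ => (hf j).1

/-- The termwise estimate behind (GpropB): for a weight `w ≥ 0`, conditional port products
`PA, PB ∈ [0,1]`, target products `QA, QB`, either the relative bound (good case) or the trivial one. [folklore] -/
theorem gpropB_term_bound {w PA PB QA QB x : ℝ} {m : ℕ} (hw : 0 ≤ w) (hx0 : 0 ≤ x)
    (hPA : 0 ≤ PA ∧ PA ≤ 1) (hPB : 0 ≤ PB ∧ PB ≤ 1) (hQA : 0 ≤ QA ∧ QA ≤ 1) (hQB : 0 ≤ QB ∧ QB ≤ 1)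
    (good : Prop) [Decidable good]
    (hgood : good → |PA * PB - QA * QB| ≤ ((1 + x) ^ (2 * m) - 1) * (QA * QB)) :
    |w * (PA * PB) - QA * QB * w| ≤ ((1 + x) ^ (2 * m) - 1) * (QA * QB) * w + (if good then 0 else w) := by
  have e : w * (PA * PB) - QA * QB * w = w * (PA * PB - QA * QB) := by ring
  rw [e, abs_mul, abs_of_nonneg hw]
  have hfirst0 : 0 ≤ ((1 + x) ^ (2 * m) - 1) * (QA * QB) * w :=
    mul_nonneg (mul_nonneg (by nlinarith [one_le_pow₀ (by linarith : (1:ℝ) ≤ 1 + x) (n := 2 * m)])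
      (mul_nonneg hQA.1 hQB.1)) hw
  by_cases hg : good
  · rw [if_pos hg, add_zero]
    calc w * |PA * PB - QA * QB| ≤ w * (((1 + x) ^ (2 * m) - 1) * (QA * QB)) := mul_le_mul_of_nonneg_left (hgood hg) hw
      _ = ((1 + x) ^ (2 * m) - 1) * (QA * QB) * w := by ring
  · rw [if_neg hg]
    have h1 : |PA * PB - QA * QB| ≤ 1 := by
      rw [abs_le]
      have h2 := mul_le_mul hPA.2 hPB.2 hPB.1 zero_le_one
      have h3 := mul_nonneg hPA.1 hPB.1
      have h4 := mul_nonneg hQA.1 hQB.1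
      have h5 := mul_le_mul hQA.2 hQB.2 hQB.1 zero_le_one
      constructor <;> nlinarith
    calc w * |PA * PB - QA * QB| ≤ w * 1 := mul_le_mul_of_nonneg_left h1 hw
      _ ≤ _ := by linarith

open scoped Classical in
/-- **(GpropB) from the mass of the bad boundary configurations** (the deterministic reweighting step
of Sly's proof of Theorem 2.1): for a realisation `(σ, τ)` of the gadget, phase `s`, port law
parameters `(a, b) = (q^{s}, q^{-s})`, and a threshold `t ≤ p := min(q⁻, 1 - q⁺)`, call a boundary
configuration `η = (E⁺, E⁻)` GOOD if every root marginal given the leaves is within `t` of its target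
(`|X_D(A_j(E⁺)) - a| ≤ t`, `|X_D(A_j(E⁻)) - b| ≤ t` for all trees `j`). If the bad configurations carry
at most a `β`-fraction of `Z_G(Y = s)` (for both `s`), then
`max_{σ_V} |P_G(σ_V ∣ Y = s)/Q_V^{s}(σ_V) - 1| ≤ (1 + t/p)^{2m} - 1 + β/p^{2m}` — Sly's
"`|P_G(σ_V = η' ∣ σ_U = η)/Q_V^+(η') - 1| ≤ n^{-3θ}` for `η ∉ 𝓑`" plus "`P_G(σ_U ∈ 𝓑 ∣ Y = +) ≤ exp(-n^{2θ})`"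
combined as in (e:lInfinityBound). [cite: Sly2010, §4.1 (proof of Theorem 2.1, eqs. (e:thetaB)–(e:lInfinityBound))] -/
theorem slyPropB_of_bad_mass (σ : Fin q → Equiv.Perm (Fin (n + m * q ^ D))) (τ : Equiv.Perm (Fin n))
    {lam qp qm t β : ℝ} (hlam : 0 ≤ lam) (hqm : 0 < qm) (hlt : qm < qp) (hqp : qp < 1) (ht0 : 0 ≤ t)
    (htp : t ≤ min qm (1 - qp)) (hβ : 0 ≤ β)
    (hbad : ∀ s : Bool,
      (∑ Ep : Finset (Fin (m * q ^ D)), ∑ Em : Finset (Fin (m * q ^ D)),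
        if (∀ j, |hcTreeX q lam D (slyTreeConfig m D q Ep j) - (if s then qp else qm)| ≤ t) ∧
            (∀ j, |hcTreeX q lam D (slyTreeConfig m D q Em j) - (if s then qm else qp)| ≤ t) then (0 : ℝ)
        else slyCoreZ σ τ lam s Ep Em *
          ((∏ j : Fin m, hcTreeZtot q lam D (slyTreeConfig m D q Ep j)) *
            ∏ j : Fin m, hcTreeZtot q lam D (slyTreeConfig m D q Em j))) ≤
      β * hardcoreZOn (slyGadgetFin n m D q σ τ) lam (fun I => slyPhase (slyWPlus n m D q) (slyWMinus n m D q) I = s)) :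
    SlyPropB (slyGadgetFin n m D q σ τ) lam (slyWPlus n m D q) (slyWMinus n m D q) (slyPortPlus n m D q) (slyPortMinus n m D q)
      qp qm ((1 + t / min qm (1 - qp)) ^ (2 * m) - 1 + β / (min qm (1 - qp)) ^ (2 * m)) := by
  intro s S
  obtain ⟨Sp, Sm⟩ := S
  -- parameters
  have hp0 : 0 < min qm (1 - qp) := lt_min hqm (by linarith)
  have hx0 : 0 ≤ t / min qm (1 - qp) := div_nonneg ht0 hp0.le
  have hx1 : t / min qm (1 - qp) ≤ 1 := by rw [div_le_one hp0]; exact htp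
  have ha1 : min qm (1 - qp) ≤ (if s then qp else qm) := by
    cases s
    · exact min_le_left _ _
    · exact (min_le_left _ _).trans hlt.le
  have ha2 : min qm (1 - qp) ≤ 1 - (if s then qp else qm) := by
    cases s
    · exact (min_le_right _ _).trans (by simp only [Bool.false_eq_true, ↓reduceIte]; linarith)
    · simp only [↓reduceIte]; exact min_le_right _ _
  have hb1 : min qm (1 - qp) ≤ (if s then qm else qp) := by
    cases s
    · exact (min_le_left _ _).trans (by simp only [Bool.false_eq_true, ↓reduceIte]; exact hlt.le)
    · simp only [↓reduceIte]; exact min_le_left _ _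
  have hb2 : min qm (1 - qp) ≤ 1 - (if s then qm else qp) := by
    cases s
    · simp only [Bool.false_eq_true, ↓reduceIte]; exact min_le_right _ _
    · exact (min_le_right _ _).trans (by simp only [↓reduceIte]; linarith)
  -- abbreviations
  let κ : Finset (Fin (m * q ^ D)) → ℝ := fun E => ∏ j : Fin m, hcTreeZtot q lam D (slyTreeConfig m D q E j)
  let X : Finset (Fin (m * q ^ D)) → Fin m → ℝ := fun E j => hcTreeX q lam D (slyTreeConfig m D q E j)
  let PA : Finset (Fin (m * q ^ D)) → ℝ := fun E => ∏ j : Fin m, (if j ∈ Sp then X E j else 1 - X E j)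
  let PB : Finset (Fin (m * q ^ D)) → ℝ := fun E => ∏ j : Fin m, (if j ∈ Sm then X E j else 1 - X E j)
  let QA : ℝ := ∏ j : Fin m, (if j ∈ Sp then (if s then qp else qm) else 1 - (if s then qp else qm))
  let QB : ℝ := ∏ j : Fin m, (if j ∈ Sm then (if s then qm else qp) else 1 - (if s then qm else qp))
  let C : Finset (Fin (m * q ^ D)) → Finset (Fin (m * q ^ D)) → ℝ := fun Ep Em => slyCoreZ σ τ lam s Ep Em
  let Good : Finset (Fin (m * q ^ D)) → Finset (Fin (m * q ^ D)) → Prop := fun Ep Em =>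
    (∀ j, |X Ep j - (if s then qp else qm)| ≤ t) ∧ (∀ j, |X Em j - (if s then qm else qp)| ≤ t)
  have hκ0 : ∀ E, 0 < κ E := fun E => Finset.prod_pos fun j _ => hcTreeZtot_pos hlam D _
  have hC0 : ∀ Ep Em, 0 ≤ C Ep Em := fun Ep Em => slyCoreZ_nonneg σ τ hlam s Ep Em
  have hX01 : ∀ E j, X E j ∈ Set.Icc (0 : ℝ) 1 := fun E j => hcTreeX_mem_Icc hlam D _
  have hQ : portLaw (if s then qp else qm) (if s then qm else qp) m (Sp, Sm) = QA * QB := portLaw_eq_prod _ _ Sp Sm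
  obtain ⟨hQAp, hQA0, hQA1⟩ := prod_ite_const_bounds hp0 ha1 ha2 Sp
  obtain ⟨hQBp, hQB0, hQB1⟩ := prod_ite_const_bounds hp0 hb1 hb2 Sm
  have hPA01 : ∀ E, 0 ≤ PA E ∧ PA E ≤ 1 := fun E => prod_ite_mem_unit (X E) (hX01 E) Sp
  have hPB01 : ∀ E, 0 ≤ PB E ∧ PB E ≤ 1 := fun E => prod_ite_mem_unit (X E) (hX01 E) Sm
  -- the two partition functions as sums over `(E⁺, E⁻)`
  have hjoint : hardcoreZOn (slyGadgetFin n m D q σ τ) lam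
      (fun I => slyPhase (slyWPlus n m D q) (slyWMinus n m D q) I = s ∧
        portPattern (slyPortPlus n m D q) (slyPortMinus n m D q) I = (Sp, Sm)) =
      ∑ Ep, ∑ Em, C Ep Em * (κ Ep * κ Em) * (PA Ep * PB Em) := by
    rw [hardcoreZOn_slyGadgetFin_phase_pattern]
    refine Finset.sum_congr rfl fun Ep _ => Finset.sum_congr rfl fun Em _ => ?_
    rw [slyForestZ_eq_tot_mul hlam Ep Sp, slyForestZ_eq_tot_mul hlam Em Sm]
    ring
  have hmarg : hardcoreZOn (slyGadgetFin n m D q σ τ) lam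
      (fun I => slyPhase (slyWPlus n m D q) (slyWMinus n m D q) I = s) = ∑ Ep, ∑ Em, C Ep Em * (κ Ep * κ Em) := by
    rw [hardcoreZOn_slyGadgetFin_phase]
    refine Finset.sum_congr rfl fun Ep _ => Finset.sum_congr rfl fun Em _ => ?_
    rw [sum_slyForestZ, sum_slyForestZ]
  have hZs0 : 0 ≤ ∑ Ep : Finset (Fin (m * q ^ D)), ∑ Em : Finset (Fin (m * q ^ D)), C Ep Em * (κ Ep * κ Em) :=
    Finset.sum_nonneg fun Ep _ => Finset.sum_nonneg fun Em _ => mul_nonneg (hC0 Ep Em) (mul_nonneg (hκ0 Ep).le (hκ0 Em).le)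
  have hbad' : (∑ Ep, ∑ Em, if Good Ep Em then (0 : ℝ) else C Ep Em * (κ Ep * κ Em)) ≤
      β * ∑ Ep : Finset (Fin (m * q ^ D)), ∑ Em : Finset (Fin (m * q ^ D)), C Ep Em * (κ Ep * κ Em) := by
    have h := hbad s
    rw [hmarg] at h
    exact h
  rw [hjoint, hmarg, hQ]
  -- termwise bound
  have hterm : ∀ Ep Em, |C Ep Em * (κ Ep * κ Em) * (PA Ep * PB Em) - QA * QB * (C Ep Em * (κ Ep * κ Em))| ≤
      ((1 + t / min qm (1 - qp)) ^ (2 * m) - 1) * (QA * QB) * (C Ep Em * (κ Ep * κ Em)) +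
        (if Good Ep Em then 0 else C Ep Em * (κ Ep * κ Em)) := by
    intro Ep Em
    refine gpropB_term_bound (mul_nonneg (hC0 Ep Em) (mul_nonneg (hκ0 Ep).le (hκ0 Em).le)) hx0
      (hPA01 Ep) (hPB01 Em) ⟨hQA0, hQA1⟩ ⟨hQB0, hQB1⟩ (Good Ep Em) fun hg => ?_
    obtain ⟨hA1, hA2⟩ := prod_ite_rel_bounds (X Ep) hp0 ht0 htp ha1 ha2 hg.1 Sp
    obtain ⟨hB1, hB2⟩ := prod_ite_rel_bounds (X Em) hp0 ht0 htp hb1 hb2 hg.2 Sm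
    exact abs_mul_sub_mul_le_of_rel hx0 hx1 hQA0 hQB0 hA1 hA2 hB1 hB2
  -- sum up
  have hdiff : (∑ Ep, ∑ Em, C Ep Em * (κ Ep * κ Em) * (PA Ep * PB Em)) -
      QA * QB * ∑ Ep : Finset (Fin (m * q ^ D)), ∑ Em : Finset (Fin (m * q ^ D)), C Ep Em * (κ Ep * κ Em) =
      ∑ Ep, ∑ Em, (C Ep Em * (κ Ep * κ Em) * (PA Ep * PB Em) - QA * QB * (C Ep Em * (κ Ep * κ Em))) := by
    rw [Finset.mul_sum]
    simp_rw [Finset.mul_sum, ← Finset.sum_sub_distrib]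
  rw [hdiff]
  have hsum1 : |∑ Ep, ∑ Em, (C Ep Em * (κ Ep * κ Em) * (PA Ep * PB Em) - QA * QB * (C Ep Em * (κ Ep * κ Em)))| ≤
      ∑ Ep, ∑ Em, (((1 + t / min qm (1 - qp)) ^ (2 * m) - 1) * (QA * QB) * (C Ep Em * (κ Ep * κ Em)) +
        (if Good Ep Em then 0 else C Ep Em * (κ Ep * κ Em))) := by
    refine (Finset.abs_sum_le_sum_abs _ _).trans (Finset.sum_le_sum fun Ep _ => ?_)
    exact (Finset.abs_sum_le_sum_abs _ _).trans (Finset.sum_le_sum fun Em _ => hterm Ep Em)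
  have hsum2 : (∑ Ep, ∑ Em, (((1 + t / min qm (1 - qp)) ^ (2 * m) - 1) * (QA * QB) * (C Ep Em * (κ Ep * κ Em)) +
        (if Good Ep Em then 0 else C Ep Em * (κ Ep * κ Em)))) =
      ((1 + t / min qm (1 - qp)) ^ (2 * m) - 1) * (QA * QB) * (∑ Ep, ∑ Em, C Ep Em * (κ Ep * κ Em)) +
        ∑ Ep, ∑ Em, (if Good Ep Em then 0 else C Ep Em * (κ Ep * κ Em)) := by
    rw [Finset.mul_sum]
    simp_rw [Finset.mul_sum, ← Finset.sum_add_distrib]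
  have hQp : (min qm (1 - qp)) ^ (2 * m) ≤ QA * QB := by
    rw [two_mul, pow_add]; exact mul_le_mul hQAp hQBp (pow_nonneg hp0.le _) hQA0
  have hp2 : 0 < (min qm (1 - qp)) ^ (2 * m) := pow_pos hp0 _
  have h1 : β * (∑ Ep, ∑ Em, C Ep Em * (κ Ep * κ Em)) ≤
      β / (min qm (1 - qp)) ^ (2 * m) * (QA * QB * ∑ Ep, ∑ Em, C Ep Em * (κ Ep * κ Em)) := by
    rw [div_mul_eq_mul_div, le_div_iff₀ hp2]
    calc β * (∑ Ep, ∑ Em, C Ep Em * (κ Ep * κ Em)) * (min qm (1 - qp)) ^ (2 * m)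
        = β * ((min qm (1 - qp)) ^ (2 * m) * ∑ Ep, ∑ Em, C Ep Em * (κ Ep * κ Em)) := by ring
      _ ≤ β * (QA * QB * ∑ Ep, ∑ Em, C Ep Em * (κ Ep * κ Em)) :=
          mul_le_mul_of_nonneg_left (mul_le_mul_of_nonneg_right hQp hZs0) hβ
  have hmid : ((1 + t / min qm (1 - qp)) ^ (2 * m) - 1) * (QA * QB) * (∑ Ep, ∑ Em, C Ep Em * (κ Ep * κ Em)) +
        ∑ Ep, ∑ Em, (if Good Ep Em then 0 else C Ep Em * (κ Ep * κ Em)) ≤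
      ((1 + t / min qm (1 - qp)) ^ (2 * m) - 1 + β / (min qm (1 - qp)) ^ (2 * m)) *
          (QA * QB * ∑ Ep, ∑ Em, C Ep Em * (κ Ep * κ Em)) := by
    have e : ((1 + t / min qm (1 - qp)) ^ (2 * m) - 1 + β / (min qm (1 - qp)) ^ (2 * m)) *
          (QA * QB * ∑ Ep, ∑ Em, C Ep Em * (κ Ep * κ Em)) =
        ((1 + t / min qm (1 - qp)) ^ (2 * m) - 1) * (QA * QB) * (∑ Ep, ∑ Em, C Ep Em * (κ Ep * κ Em)) +
          β / (min qm (1 - qp)) ^ (2 * m) * (QA * QB * ∑ Ep, ∑ Em, C Ep Em * (κ Ep * κ Em)) := by ring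
    rw [e]
    linarith [hbad', h1]
  exact hsum1.trans (hsum2.le.trans hmid)

end GpropBAlgebra

section BadMassExpect

variable {m D q : ℕ} {lam : ℝ}

/-- Leaf sets of the forest ↔ tuples of leaf configurations of the trees. [folklore] -/
noncomputable def slyTreeConfigEquiv (m D q : ℕ) : Finset (Fin (m * q ^ D)) ≃ (Fin m → Fin (q ^ D) → Bool) where
  toFun E := slyTreeConfig m D q E
  invFun F := univ.filter fun u => F (finProdFinEquiv.symm u).1 (finProdFinEquiv.symm u).2 = true
  left_inv E := by
    ext u
    simp only [Finset.mem_filter, Finset.mem_univ, true_and, slyTreeConfig, decide_eq_true_eq]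
    rw [show ((finProdFinEquiv.symm u).1, (finProdFinEquiv.symm u).2) = finProdFinEquiv.symm u from rfl,
      Equiv.apply_symm_apply]
  right_inv F := by
    funext j p
    simp only [slyTreeConfig, Finset.mem_filter, Finset.mem_univ, true_and, Equiv.symm_apply_apply]
    cases F j p <;> simp

/-- Unfolding lemma for `slyTreeConfigEquiv`. [folklore] -/
theorem slyTreeConfigEquiv_apply (E : Finset (Fin (m * q ^ D))) : slyTreeConfigEquiv m D q E = slyTreeConfig m D q E := rfl

/-- `|E| = Σ_j |A_j(E)|`. [folklore] -/
theorem card_eq_sum_hcLeafCount (E : Finset (Fin (m * q ^ D))) :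
    E.card = ∑ j : Fin m, hcLeafCount (slyTreeConfig m D q E j) := by
  classical
  simp_rw [hcLeafCount_eq_sum]
  rw [← Fintype.sum_prod_type', ← Finset.card_filter]
  rw [← Finset.card_map (finProdFinEquiv (m := m) (n := q ^ D)).toEmbedding]
  congr 1
  ext u
  simp only [Finset.mem_map_equiv, Finset.mem_filter, Finset.mem_univ, true_and, slyTreeConfig, decide_eq_true_eq]
  rw [show ((finProdFinEquiv.symm u).1, (finProdFinEquiv.symm u).2) = finProdFinEquiv.symm u from rfl,
    Equiv.apply_symm_apply]

/-- Sums over the leaf sets of the forest of products over the trees factorise. [folklore] -/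
theorem sum_finset_prod_trees (f : Fin m → (Fin (q ^ D) → Bool) → ℝ) :
    ∑ E : Finset (Fin (m * q ^ D)), ∏ j : Fin m, f j (slyTreeConfig m D q E j) =
      ∏ j : Fin m, ∑ A : Fin (q ^ D) → Bool, f j A := by
  rw [← (slyTreeConfigEquiv m D q).symm.sum_comp]
  simp only [Equiv.apply_symm_apply, ← slyTreeConfigEquiv_apply]
  rw [Finset.prod_univ_sum]
  simp only [Fintype.piFinset_univ]

/-- The product measure weight of a leaf set in fugacity form:
`a^{|E|} (1-a)^{m' - |E|} = (1-a)^{m'} Π_j w^{|A_j(E)|}`, `w = a/(1-a)`. [folklore] -/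
theorem pow_card_eq_prod_fugacity {a : ℝ} (ha1 : a < 1) (E : Finset (Fin (m * q ^ D))) :
    a ^ E.card * (1 - a) ^ (m * q ^ D - E.card) =
      (1 - a) ^ (m * q ^ D) * ∏ j : Fin m, (a / (1 - a)) ^ hcLeafCount (slyTreeConfig m D q E j) := by
  rw [Finset.prod_pow_eq_pow_sum, ← card_eq_sum_hcLeafCount, div_pow]
  have hle : E.card ≤ m * q ^ D := by
    calc E.card ≤ (univ : Finset (Fin (m * q ^ D))).card := Finset.card_le_univ E
      _ = m * q ^ D := by rw [Finset.card_univ, Fintype.card_fin]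
  have h1a : (1 - a) ≠ 0 := by linarith
  rw [mul_div_assoc', eq_div_iff (pow_ne_zero _ h1a), mul_assoc, ← pow_add, Nat.sub_add_cancel hle, mul_comm]

/-- **The bad boundary configurations have small `P*`-mass** (union bound over the `2m` trees,
Sly's (e:ProbBadB): "`P*(σ_U ∈ 𝓑) ≤ |V| exp(-exp(2ζ₂⌊(ψ/2) log_{d-1} n⌋))`"): if under the fugacity-`a/(1-a)`
boundary field a single tree's root marginal misses `a` by more than `t` with `ν`-probability at most
`τa` (and likewise for `b`, `τb`), then the `Q_U`-weighted forest mass of the configurations with SOME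
bad tree is at most `m (τa + τb)` times the total. [cite: Sly2010, §4.1 (eq. (e:ProbBadB), Lemma 4.3)] -/
theorem bad_mass_expect_le (hlam : 0 ≤ lam) {a b t τa τb : ℝ} (ha0 : 0 < a) (ha1 : a < 1) (hb0 : 0 < b) (hb1 : b < 1)
    (htail_a : (∑ A : Fin (q ^ D) → Bool, if t < |hcTreeX q lam D A - a| then
        (a / (1 - a)) ^ hcLeafCount A * hcTreeZtot q lam D A else 0) ≤
      τa * ∑ A : Fin (q ^ D) → Bool, (a / (1 - a)) ^ hcLeafCount A * hcTreeZtot q lam D A)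
    (htail_b : (∑ A : Fin (q ^ D) → Bool, if t < |hcTreeX q lam D A - b| then
        (b / (1 - b)) ^ hcLeafCount A * hcTreeZtot q lam D A else 0) ≤
      τb * ∑ A : Fin (q ^ D) → Bool, (b / (1 - b)) ^ hcLeafCount A * hcTreeZtot q lam D A) :
    (∑ Ep : Finset (Fin (m * q ^ D)), ∑ Em : Finset (Fin (m * q ^ D)),
      if (∀ j, |hcTreeX q lam D (slyTreeConfig m D q Ep j) - a| ≤ t) ∧
          (∀ j, |hcTreeX q lam D (slyTreeConfig m D q Em j) - b| ≤ t) then (0 : ℝ)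
      else (a ^ Ep.card * (1 - a) ^ (m * q ^ D - Ep.card)) * (b ^ Em.card * (1 - b) ^ (m * q ^ D - Em.card)) *
        ((∏ j : Fin m, hcTreeZtot q lam D (slyTreeConfig m D q Ep j)) *
          ∏ j : Fin m, hcTreeZtot q lam D (slyTreeConfig m D q Em j))) ≤
    m * (τa + τb) * ∑ Ep : Finset (Fin (m * q ^ D)), ∑ Em : Finset (Fin (m * q ^ D)),
      (a ^ Ep.card * (1 - a) ^ (m * q ^ D - Ep.card)) * (b ^ Em.card * (1 - b) ^ (m * q ^ D - Em.card)) *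
        ((∏ j : Fin m, hcTreeZtot q lam D (slyTreeConfig m D q Ep j)) *
          ∏ j : Fin m, hcTreeZtot q lam D (slyTreeConfig m D q Em j)) := by
  classical
  -- per-side weights and single-tree sums
  set wa := a / (1 - a) with hwa
  set wb := b / (1 - b) with hwb
  have hwa0 : 0 ≤ wa := div_nonneg ha0.le (by linarith)
  have hwb0 : 0 ≤ wb := div_nonneg hb0.le (by linarith)
  set Ga := ∑ A : Fin (q ^ D) → Bool, wa ^ hcLeafCount A * hcTreeZtot q lam D A with hGa
  set Gb := ∑ A : Fin (q ^ D) → Bool, wb ^ hcLeafCount A * hcTreeZtot q lam D A with hGb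
  set Ba := ∑ A : Fin (q ^ D) → Bool, (if t < |hcTreeX q lam D A - a| then wa ^ hcLeafCount A * hcTreeZtot q lam D A else 0) with hBa
  set Bb := ∑ A : Fin (q ^ D) → Bool, (if t < |hcTreeX q lam D A - b| then wb ^ hcLeafCount A * hcTreeZtot q lam D A else 0) with hBb
  have hterm0 : ∀ (w : ℝ) (A : Fin (q ^ D) → Bool), 0 ≤ w → 0 ≤ w ^ hcLeafCount A * hcTreeZtot q lam D A :=
    fun w A hw => mul_nonneg (pow_nonneg hw _) (hcTreeZtot_pos hlam D A).le
  have hGa0 : 0 ≤ Ga := Finset.sum_nonneg fun A _ => hterm0 wa A hwa0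
  have hGb0 : 0 ≤ Gb := Finset.sum_nonneg fun A _ => hterm0 wb A hwb0
  have hBa0 : 0 ≤ Ba := Finset.sum_nonneg fun A _ => by split_ifs <;> [exact hterm0 wa A hwa0; exact le_rfl]
  have hBb0 : 0 ≤ Bb := Finset.sum_nonneg fun A _ => by split_ifs <;> [exact hterm0 wb A hwb0; exact le_rfl]
  have hBaG : Ba ≤ Ga := Finset.sum_le_sum fun A _ => by split_ifs <;> [exact le_rfl; exact hterm0 wa A hwa0]
  have hBbG : Bb ≤ Gb := Finset.sum_le_sum fun A _ => by split_ifs <;> [exact le_rfl; exact hterm0 wb A hwb0]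
  -- the side weights as products over trees
  set Wa : Finset (Fin (m * q ^ D)) → ℝ := fun E => a ^ E.card * (1 - a) ^ (m * q ^ D - E.card) *
    ∏ j : Fin m, hcTreeZtot q lam D (slyTreeConfig m D q E j) with hWa
  set Wb : Finset (Fin (m * q ^ D)) → ℝ := fun E => b ^ E.card * (1 - b) ^ (m * q ^ D - E.card) *
    ∏ j : Fin m, hcTreeZtot q lam D (slyTreeConfig m D q E j) with hWb
  have hWa_eq : ∀ E, Wa E = (1 - a) ^ (m * q ^ D) * ∏ j : Fin m, (wa ^ hcLeafCount (slyTreeConfig m D q E j) *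
      hcTreeZtot q lam D (slyTreeConfig m D q E j)) := fun E => by
    simp only [hWa]; rw [pow_card_eq_prod_fugacity ha1, Finset.prod_mul_distrib, hwa]; ring
  have hWb_eq : ∀ E, Wb E = (1 - b) ^ (m * q ^ D) * ∏ j : Fin m, (wb ^ hcLeafCount (slyTreeConfig m D q E j) *
      hcTreeZtot q lam D (slyTreeConfig m D q E j)) := fun E => by
    simp only [hWb]; rw [pow_card_eq_prod_fugacity hb1, Finset.prod_mul_distrib, hwb]; ring
  have hWa0 : ∀ E, 0 ≤ Wa E := fun E => by
    rw [hWa_eq]; exact mul_nonneg (pow_nonneg (by linarith) _) (Finset.prod_nonneg fun j _ => hterm0 wa _ hwa0)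
  have hWb0 : ∀ E, 0 ≤ Wb E := fun E => by
    rw [hWb_eq]; exact mul_nonneg (pow_nonneg (by linarith) _) (Finset.prod_nonneg fun j _ => hterm0 wb _ hwb0)
  -- total side masses
  have hTa : ∑ E : Finset (Fin (m * q ^ D)), Wa E = (1 - a) ^ (m * q ^ D) * Ga ^ m := by
    simp_rw [hWa_eq]
    rw [← Finset.mul_sum, sum_finset_prod_trees (fun _ A => wa ^ hcLeafCount A * hcTreeZtot q lam D A),
      Finset.prod_const, Finset.card_univ, Fintype.card_fin]
  have hTb : ∑ E : Finset (Fin (m * q ^ D)), Wb E = (1 - b) ^ (m * q ^ D) * Gb ^ m := by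
    simp_rw [hWb_eq]
    rw [← Finset.mul_sum, sum_finset_prod_trees (fun _ A => wb ^ hcLeafCount A * hcTreeZtot q lam D A),
      Finset.prod_const, Finset.card_univ, Fintype.card_fin]
  -- mass of "tree `j₀` bad" on one side: `≤ τ · total`
  have hside : ∀ (w c τ G B : ℝ) (hw : 0 ≤ w) (hc1 : c < 1)
      (hGdef : G = ∑ A : Fin (q ^ D) → Bool, w ^ hcLeafCount A * hcTreeZtot q lam D A)
      (hBdef : B = ∑ A : Fin (q ^ D) → Bool, (if t < |hcTreeX q lam D A - c| then w ^ hcLeafCount A * hcTreeZtot q lam D A else 0))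
      (hBτ : B ≤ τ * G) (j₀ : Fin m),
      (∑ E : Finset (Fin (m * q ^ D)), if t < |hcTreeX q lam D (slyTreeConfig m D q E j₀) - c| then
        (1 - c) ^ (m * q ^ D) * ∏ j : Fin m, (w ^ hcLeafCount (slyTreeConfig m D q E j) * hcTreeZtot q lam D (slyTreeConfig m D q E j))
        else 0) ≤ τ * ((1 - c) ^ (m * q ^ D) * G ^ m) := by
    intro w c τ G B hw hc1 hGdef hBdef hBτ j₀
    -- write the indicator-restricted product as a product with the `j₀` factor modified
    have hrew : ∀ E : Finset (Fin (m * q ^ D)),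
        (if t < |hcTreeX q lam D (slyTreeConfig m D q E j₀) - c| then
          (1 - c) ^ (m * q ^ D) * ∏ j : Fin m, (w ^ hcLeafCount (slyTreeConfig m D q E j) * hcTreeZtot q lam D (slyTreeConfig m D q E j))
          else 0) =
        (1 - c) ^ (m * q ^ D) * ∏ j : Fin m, (if j = j₀ then
          (if t < |hcTreeX q lam D (slyTreeConfig m D q E j) - c| then w ^ hcLeafCount (slyTreeConfig m D q E j) * hcTreeZtot q lam D (slyTreeConfig m D q E j) else 0)
          else w ^ hcLeafCount (slyTreeConfig m D q E j) * hcTreeZtot q lam D (slyTreeConfig m D q E j)) := by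
      intro E
      rw [Finset.prod_ite (s := univ) (p := fun j => j = j₀), Finset.filter_eq', if_pos (Finset.mem_univ _),
        Finset.prod_singleton, Finset.filter_ne']
      split_ifs with h
      · rw [Finset.mul_prod_erase (univ : Finset (Fin m))
          (fun j => w ^ hcLeafCount (slyTreeConfig m D q E j) * hcTreeZtot q lam D (slyTreeConfig m D q E j)) (Finset.mem_univ j₀)]
      · simp
    simp_rw [hrew]
    rw [← Finset.mul_sum, sum_finset_prod_trees (fun j A => if j = j₀ then
        (if t < |hcTreeX q lam D A - c| then w ^ hcLeafCount A * hcTreeZtot q lam D A else 0)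
        else w ^ hcLeafCount A * hcTreeZtot q lam D A)]
    have hsplit : (∏ j : Fin m, ∑ A : Fin (q ^ D) → Bool, (if j = j₀ then
        (if t < |hcTreeX q lam D A - c| then w ^ hcLeafCount A * hcTreeZtot q lam D A else 0)
        else w ^ hcLeafCount A * hcTreeZtot q lam D A)) = B * G ^ (m - 1) := by
      rw [show (∏ j : Fin m, ∑ A : Fin (q ^ D) → Bool, (if j = j₀ then
        (if t < |hcTreeX q lam D A - c| then w ^ hcLeafCount A * hcTreeZtot q lam D A else 0)
        else w ^ hcLeafCount A * hcTreeZtot q lam D A)) = ∏ j : Fin m, (if j = j₀ then B else G) from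
        Finset.prod_congr rfl fun j _ => by
          by_cases hj : j = j₀
          · simp only [hj, if_true]; exact hBdef.symm
          · simp only [hj, if_false]; exact hGdef.symm]
      rw [Finset.prod_ite (s := univ) (p := fun j => j = j₀), Finset.filter_eq', if_pos (Finset.mem_univ _),
        Finset.prod_singleton, Finset.prod_const, Finset.filter_ne', Finset.card_erase_of_mem (Finset.mem_univ _),
        Finset.card_univ, Fintype.card_fin]
    rw [hsplit]
    have hG0 : 0 ≤ G := by rw [hGdef]; exact Finset.sum_nonneg fun A _ => hterm0 w A hw
    have hm : m = m - 1 + 1 := by have := j₀.isLt; omega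
    calc (1 - c) ^ (m * q ^ D) * (B * G ^ (m - 1)) ≤ (1 - c) ^ (m * q ^ D) * (τ * G * G ^ (m - 1)) :=
          mul_le_mul_of_nonneg_left (mul_le_mul_of_nonneg_right hBτ (pow_nonneg hG0 _)) (pow_nonneg (by linarith) _)
      _ = τ * ((1 - c) ^ (m * q ^ D) * G ^ m) := by
          rw [show G ^ m = G ^ (m - 1) * G by rw [← pow_succ, ← hm]]
          ring
  -- union bound on the indicator
  have hind : ∀ Ep Em : Finset (Fin (m * q ^ D)),
      (if (∀ j, |hcTreeX q lam D (slyTreeConfig m D q Ep j) - a| ≤ t) ∧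
          (∀ j, |hcTreeX q lam D (slyTreeConfig m D q Em j) - b| ≤ t) then (0 : ℝ) else Wa Ep * Wb Em) ≤
        (∑ j₀ : Fin m, (if t < |hcTreeX q lam D (slyTreeConfig m D q Ep j₀) - a| then Wa Ep else 0)) * Wb Em +
        Wa Ep * ∑ j₀ : Fin m, (if t < |hcTreeX q lam D (slyTreeConfig m D q Em j₀) - b| then Wb Em else 0) := by
    intro Ep Em
    have hS1 : 0 ≤ (∑ j₀ : Fin m, (if t < |hcTreeX q lam D (slyTreeConfig m D q Ep j₀) - a| then Wa Ep else 0)) :=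
      Finset.sum_nonneg fun j _ => by split_ifs <;> [exact hWa0 Ep; exact le_rfl]
    have hS2 : 0 ≤ ∑ j₀ : Fin m, (if t < |hcTreeX q lam D (slyTreeConfig m D q Em j₀) - b| then Wb Em else 0) :=
      Finset.sum_nonneg fun j _ => by split_ifs <;> [exact hWb0 Em; exact le_rfl]
    split_ifs with hgood
    · exact add_nonneg (mul_nonneg hS1 (hWb0 Em)) (mul_nonneg (hWa0 Ep) hS2)
    · rw [not_and_or, not_forall, not_forall] at hgood
      rcases hgood with ⟨j₀, hj₀⟩ | ⟨j₀, hj₀⟩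
      · have h1 : Wa Ep ≤ ∑ j : Fin m, (if t < |hcTreeX q lam D (slyTreeConfig m D q Ep j) - a| then Wa Ep else 0) := by
          refine le_trans (le_of_eq ?_) (Finset.single_le_sum (f := fun j => if t < |hcTreeX q lam D (slyTreeConfig m D q Ep j) - a| then Wa Ep else 0)
            (fun j _ => by split_ifs <;> [exact hWa0 Ep; exact le_rfl]) (Finset.mem_univ j₀))
          rw [if_pos (not_le.1 hj₀)]
        nlinarith [hWb0 Em, hWa0 Ep]
      · have h1 : Wb Em ≤ ∑ j : Fin m, (if t < |hcTreeX q lam D (slyTreeConfig m D q Em j) - b| then Wb Em else 0) := by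
          refine le_trans (le_of_eq ?_) (Finset.single_le_sum (f := fun j => if t < |hcTreeX q lam D (slyTreeConfig m D q Em j) - b| then Wb Em else 0)
            (fun j _ => by split_ifs <;> [exact hWb0 Em; exact le_rfl]) (Finset.mem_univ j₀))
          rw [if_pos (not_le.1 hj₀)]
        nlinarith [hWb0 Em, hWa0 Ep]
  -- sum the union bound
  have hsumA : ∀ j₀ : Fin m, (∑ Ep : Finset (Fin (m * q ^ D)), if t < |hcTreeX q lam D (slyTreeConfig m D q Ep j₀) - a| then Wa Ep else 0) ≤
      τa * ((1 - a) ^ (m * q ^ D) * Ga ^ m) := by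
    intro j₀
    have h := hside wa a τa Ga Ba hwa0 ha1 hGa hBa htail_a j₀
    refine le_trans (le_of_eq (Finset.sum_congr rfl fun E _ => ?_)) h
    split_ifs <;> [exact hWa_eq E; rfl]
  have hsumB : ∀ j₀ : Fin m, (∑ Em : Finset (Fin (m * q ^ D)), if t < |hcTreeX q lam D (slyTreeConfig m D q Em j₀) - b| then Wb Em else 0) ≤
      τb * ((1 - b) ^ (m * q ^ D) * Gb ^ m) := by
    intro j₀
    have h := hside wb b τb Gb Bb hwb0 hb1 hGb hBb htail_b j₀
    refine le_trans (le_of_eq (Finset.sum_congr rfl fun E _ => ?_)) h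
    split_ifs <;> [exact hWb_eq E; rfl]
  -- totals
  have htot : (∑ Ep : Finset (Fin (m * q ^ D)), ∑ Em : Finset (Fin (m * q ^ D)), Wa Ep * Wb Em) =
      ((1 - a) ^ (m * q ^ D) * Ga ^ m) * ((1 - b) ^ (m * q ^ D) * Gb ^ m) := by
    rw [← hTa, ← hTb, Finset.sum_mul_sum]
  -- LHS rewritten with `Wa, Wb`
  have hL : (∑ Ep : Finset (Fin (m * q ^ D)), ∑ Em : Finset (Fin (m * q ^ D)),
      if (∀ j, |hcTreeX q lam D (slyTreeConfig m D q Ep j) - a| ≤ t) ∧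
          (∀ j, |hcTreeX q lam D (slyTreeConfig m D q Em j) - b| ≤ t) then (0 : ℝ)
      else (a ^ Ep.card * (1 - a) ^ (m * q ^ D - Ep.card)) * (b ^ Em.card * (1 - b) ^ (m * q ^ D - Em.card)) *
        ((∏ j : Fin m, hcTreeZtot q lam D (slyTreeConfig m D q Ep j)) *
          ∏ j : Fin m, hcTreeZtot q lam D (slyTreeConfig m D q Em j))) =
      ∑ Ep, ∑ Em, (if (∀ j, |hcTreeX q lam D (slyTreeConfig m D q Ep j) - a| ≤ t) ∧
          (∀ j, |hcTreeX q lam D (slyTreeConfig m D q Em j) - b| ≤ t) then (0 : ℝ) else Wa Ep * Wb Em) := by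
    refine Finset.sum_congr rfl fun Ep _ => Finset.sum_congr rfl fun Em _ => ?_
    split_ifs <;> [rfl; (simp only [hWa, hWb]; ring)]
  have hR : (∑ Ep : Finset (Fin (m * q ^ D)), ∑ Em : Finset (Fin (m * q ^ D)),
      (a ^ Ep.card * (1 - a) ^ (m * q ^ D - Ep.card)) * (b ^ Em.card * (1 - b) ^ (m * q ^ D - Em.card)) *
        ((∏ j : Fin m, hcTreeZtot q lam D (slyTreeConfig m D q Ep j)) *
          ∏ j : Fin m, hcTreeZtot q lam D (slyTreeConfig m D q Em j))) = ∑ Ep, ∑ Em, Wa Ep * Wb Em := by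
    refine Finset.sum_congr rfl fun Ep _ => Finset.sum_congr rfl fun Em _ => ?_
    simp only [hWa, hWb]; ring
  rw [hL, hR, htot]
  calc (∑ Ep, ∑ Em, (if (∀ j, |hcTreeX q lam D (slyTreeConfig m D q Ep j) - a| ≤ t) ∧
          (∀ j, |hcTreeX q lam D (slyTreeConfig m D q Em j) - b| ≤ t) then (0 : ℝ) else Wa Ep * Wb Em))
      ≤ ∑ Ep, ∑ Em, ((∑ j₀ : Fin m, (if t < |hcTreeX q lam D (slyTreeConfig m D q Ep j₀) - a| then Wa Ep else 0)) * Wb Em +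
          Wa Ep * ∑ j₀ : Fin m, (if t < |hcTreeX q lam D (slyTreeConfig m D q Em j₀) - b| then Wb Em else 0)) :=
        Finset.sum_le_sum fun Ep _ => Finset.sum_le_sum fun Em _ => hind Ep Em
    _ = (∑ j₀ : Fin m, ∑ Ep, (if t < |hcTreeX q lam D (slyTreeConfig m D q Ep j₀) - a| then Wa Ep else 0)) * (∑ Em, Wb Em) +
        (∑ Ep, Wa Ep) * ∑ j₀ : Fin m, ∑ Em, (if t < |hcTreeX q lam D (slyTreeConfig m D q Em j₀) - b| then Wb Em else 0) := by
        have e1 : (∑ Ep : Finset (Fin (m * q ^ D)), ∑ Em : Finset (Fin (m * q ^ D)),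
            ((∑ j₀ : Fin m, (if t < |hcTreeX q lam D (slyTreeConfig m D q Ep j₀) - a| then Wa Ep else 0)) * Wb Em +
              Wa Ep * ∑ j₀ : Fin m, (if t < |hcTreeX q lam D (slyTreeConfig m D q Em j₀) - b| then Wb Em else 0))) =
            (∑ Ep : Finset (Fin (m * q ^ D)), ∑ Em : Finset (Fin (m * q ^ D)),
              (∑ j₀ : Fin m, (if t < |hcTreeX q lam D (slyTreeConfig m D q Ep j₀) - a| then Wa Ep else 0)) * Wb Em) +
            ∑ Ep : Finset (Fin (m * q ^ D)), ∑ Em : Finset (Fin (m * q ^ D)),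
              Wa Ep * ∑ j₀ : Fin m, (if t < |hcTreeX q lam D (slyTreeConfig m D q Em j₀) - b| then Wb Em else 0) := by
          rw [← Finset.sum_add_distrib]
          exact Finset.sum_congr rfl fun Ep _ => Finset.sum_add_distrib
        rw [e1, ← Finset.sum_mul_sum, ← Finset.sum_mul_sum,
          Finset.sum_comm (f := fun Ep j₀ => if t < |hcTreeX q lam D (slyTreeConfig m D q Ep j₀) - a| then Wa Ep else 0),
          Finset.sum_comm (f := fun Em j₀ => if t < |hcTreeX q lam D (slyTreeConfig m D q Em j₀) - b| then Wb Em else 0)]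
    _ ≤ (∑ _j₀ : Fin m, τa * ((1 - a) ^ (m * q ^ D) * Ga ^ m)) * ((1 - b) ^ (m * q ^ D) * Gb ^ m) +
        ((1 - a) ^ (m * q ^ D) * Ga ^ m) * ∑ _j₀ : Fin m, τb * ((1 - b) ^ (m * q ^ D) * Gb ^ m) := by
        rw [hTa, hTb]
        have hA0 : 0 ≤ (1 - a) ^ (m * q ^ D) * Ga ^ m := mul_nonneg (pow_nonneg (by linarith) _) (pow_nonneg hGa0 _)
        have hB0 : 0 ≤ (1 - b) ^ (m * q ^ D) * Gb ^ m := mul_nonneg (pow_nonneg (by linarith) _) (pow_nonneg hGb0 _)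
        exact add_le_add (mul_le_mul_of_nonneg_right (Finset.sum_le_sum fun j₀ _ => hsumA j₀) hB0)
          (mul_le_mul_of_nonneg_left (Finset.sum_le_sum fun j₀ _ => hsumB j₀) hA0)
    _ = m * (τa + τb) * ((1 - a) ^ (m * q ^ D) * Ga ^ m * ((1 - b) ^ (m * q ^ D) * Gb ^ m)) := by
        rw [Finset.sum_const, Finset.sum_const, Finset.card_univ, Fintype.card_fin, nsmul_eq_mul, nsmul_eq_mul]
        ring

end BadMassExpect

section Counting

variable {Ω : Type*} [Fintype Ω]

/-- **Markov's inequality, counting form**: `#{ω : T ≤ f ω} · T ≤ Σ_ω f ω` for `f ≥ 0`. [folklore] -/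
theorem card_filter_mul_le_sum (f : Ω → ℝ) (hf : ∀ ω, 0 ≤ f ω) (T : ℝ) [DecidablePred fun ω => T ≤ f ω] :
    ((univ.filter fun ω => T ≤ f ω).card : ℝ) * T ≤ ∑ ω, f ω := by
  classical
  calc ((univ.filter fun ω => T ≤ f ω).card : ℝ) * T = ∑ _ω ∈ univ.filter (fun ω => T ≤ f ω), T := by
        rw [Finset.sum_const, nsmul_eq_mul]
    _ ≤ ∑ ω ∈ univ.filter (fun ω => T ≤ f ω), f ω := Finset.sum_le_sum fun ω hω => (Finset.mem_filter.1 hω).2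
    _ ≤ ∑ ω, f ω := Finset.sum_le_sum_of_subset_of_nonneg (Finset.filter_subset _ _) fun ω _ _ => hf ω

/-- **From pointwise to weighted lower tails** (the averaging step (e:tGpropProofA)–(e:tGpropProofB) of
Sly's proof of Theorem 2.1, counting form): if for every configuration `η` at most a `1/16` fraction
of the realisations `ω` have `Z_ω(η) < avg_ω Z(η) / c`, then for any nonnegative weights `wt`, at most
a `1/8` fraction of the realisations have `Σ_η Z_ω(η) wt(η) < (Σ_η avg Z(η) wt(η)) / (2c)`.
[cite: Sly2010, §4.1 (proof of Theorem 2.1, eqs. (e:tGpropProofA)–(e:tGpropProofB))] -/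
theorem weighted_lowerTail_of_pointwise {ι : Type*} [Fintype ι] (Z : Ω → ι → ℝ) (hZ : ∀ ω η, 0 ≤ Z ω η)
    (wt : ι → ℝ) (hwt : ∀ η, 0 ≤ wt η) {c : ℝ} (hc : 0 < c)
    (hpt : ∀ η, 16 * ((univ.filter fun ω => (Fintype.card Ω : ℝ) * Z ω η < (∑ ω', Z ω' η) / c).card : ℝ) ≤ Fintype.card Ω) :
    8 * ((univ.filter fun ω => (Fintype.card Ω : ℝ) * ∑ η, Z ω η * wt η < (∑ η, (∑ ω', Z ω' η) * wt η) / (2 * c)).card : ℝ) ≤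
      Fintype.card Ω := by
  classical
  set N : ℝ := (Fintype.card Ω : ℝ) with hN
  set A : ι → ℝ := fun η => ∑ ω', Z ω' η with hA
  set W : ℝ := ∑ η, A η * wt η with hW
  have hA0 : ∀ η, 0 ≤ A η := fun η => Finset.sum_nonneg fun ω _ => hZ ω η
  have hW0 : 0 ≤ W := Finset.sum_nonneg fun η _ => mul_nonneg (hA0 η) (hwt η)
  have hN0 : 0 ≤ N := by rw [hN]; exact_mod_cast Nat.zero_le _
  -- the avg-mass of the low configurations at `ω`
  set S : Ω → ℝ := fun ω => ∑ η, (if N * Z ω η < A η / c then A η * wt η else 0) with hS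
  have hS0 : ∀ ω, 0 ≤ S ω := fun ω => Finset.sum_nonneg fun η _ => by
    split_ifs <;> [exact mul_nonneg (hA0 η) (hwt η); exact le_rfl]
  -- its total is small
  have hStot : ∑ ω, S ω ≤ N * W / 16 := by
    rw [Finset.sum_comm]
    have : ∀ η, (∑ ω, (if N * Z ω η < A η / c then A η * wt η else 0)) =
        ((univ.filter fun ω => N * Z ω η < A η / c).card : ℝ) * (A η * wt η) := fun η => by
      rw [← Finset.sum_filter, Finset.sum_const, nsmul_eq_mul]
    simp_rw [this]
    calc ∑ η, ((univ.filter fun ω => N * Z ω η < A η / c).card : ℝ) * (A η * wt η)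
        ≤ ∑ η, N / 16 * (A η * wt η) := Finset.sum_le_sum fun η _ =>
          mul_le_mul_of_nonneg_right (by have := hpt η; linarith) (mul_nonneg (hA0 η) (hwt η))
      _ = N * W / 16 := by rw [← Finset.mul_sum, hW]; ring
  -- inclusion of the bad event in `{S ≥ W/2}`
  have hincl : (univ.filter fun ω => N * ∑ η, Z ω η * wt η < W / (2 * c)) ⊆ univ.filter fun ω => W / 2 ≤ S ω := by
    intro ω hω
    rw [Finset.mem_filter] at hω ⊢
    refine ⟨Finset.mem_univ _, ?_⟩
    by_contra hlt
    have hlt := not_le.1 hlt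
    -- on the complement, the non-low configurations carry at least `W - S ω > W/2`
    have h1 : N * ∑ η, Z ω η * wt η ≥ (W - S ω) / c := by
      have h2 : ∀ η, (if N * Z ω η < A η / c then A η * wt η else 0) + c * (N * (Z ω η * wt η)) ≥ A η * wt η := by
        intro η
        split_ifs with h
        · have := mul_nonneg hc.le (mul_nonneg hN0 (mul_nonneg (hZ ω η) (hwt η)))
          linarith
        · have h' := mul_le_mul_of_nonneg_right ((div_le_iff₀ hc).1 (not_lt.1 h)) (hwt η)
          linarith [h']
      have h3 : S ω + c * (N * ∑ η, Z ω η * wt η) ≥ W := by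
        rw [Finset.mul_sum, Finset.mul_sum, hS, ← Finset.sum_add_distrib]
        exact Finset.sum_le_sum fun η _ => h2 η
      rw [ge_iff_le, div_le_iff₀ hc]
      linarith
    rw [ge_iff_le, div_le_iff₀ hc] at h1
    rw [lt_div_iff₀ (by linarith)] at hω
    nlinarith [hω.2]
  have hcard := Finset.card_le_card hincl
  have hmarkov := card_filter_mul_le_sum S hS0 (W / 2)
  by_cases hWpos : W = 0
  · -- degenerate: nothing is bad
    have : (univ.filter fun ω => N * ∑ η, Z ω η * wt η < W / (2 * c)) = ∅ := by
      rw [Finset.filter_eq_empty_iff]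
      intro ω _ h
      rw [hWpos, zero_div] at h
      exact absurd h (not_lt.2 (mul_nonneg hN0 (Finset.sum_nonneg fun η _ => mul_nonneg (hZ ω η) (hwt η))))
    rw [this]; simp [hN0]
  · have hWp : 0 < W := lt_of_le_of_ne hW0 (Ne.symm hWpos)
    have h1 : ((univ.filter fun ω => W / 2 ≤ S ω).card : ℝ) * (W / 2) ≤ N * W / 16 := hmarkov.trans hStot
    have h2 : ((univ.filter fun ω => W / 2 ≤ S ω).card : ℝ) ≤ N / 8 := by
      by_contra h
      have h := not_le.1 h
      nlinarith
    calc 8 * ((univ.filter fun ω => N * ∑ η, Z ω η * wt η < W / (2 * c)).card : ℝ)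
        ≤ 8 * ((univ.filter fun ω => W / 2 ≤ S ω).card : ℝ) := by
          exact mul_le_mul_of_nonneg_left (by exact_mod_cast hcard) (by norm_num)
      _ ≤ N := by linarith

/-- **Existence of a good realisation**: if the bad sets have total size `< |Ω|`, some `ω` is in none
of them. [folklore] -/
theorem exists_not_mem_of_card_lt {k : ℕ} (B : Fin k → Finset Ω) (h : ∑ i, (B i).card < Fintype.card Ω) :
    ∃ ω : Ω, ∀ i, ω ∉ B i := by
  classical
  have hU : (Finset.univ.biUnion B).card < Fintype.card Ω := lt_of_le_of_lt Finset.card_biUnion_le h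
  have hne : (univ \ Finset.univ.biUnion B).Nonempty := by
    rw [← Finset.card_pos, Finset.card_univ_sdiff]
    omega
  obtain ⟨ω, hω⟩ := hne
  rw [Finset.mem_sdiff, Finset.mem_biUnion] at hω
  exact ⟨ω, fun i hi => hω.2 ⟨i, Finset.mem_univ _, hi⟩⟩

end Counting

section Averages

variable {n m D q : ℕ} {lam : ℝ}

/-- The phase-`s` first-moment function `E Z^{s}_{G̃}(η)` of Lemma 3.3 (`slyZplus` / `slyZminus`). [folklore] -/
noncomputable def slyZphase (n m' k : ℕ) (lam : ℝ) (s : Bool) (ep em : ℕ) : ℝ :=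
  if s then slyZplus n m' k lam ep em else slyZminus n m' k lam ep em

/-- `slyZminus ≥ 0` for `λ ≥ 0`. [folklore] -/
theorem slyZminus_nonneg' (n m' k : ℕ) {lam : ℝ} (hlam : 0 ≤ lam) (ep em : ℕ) :
    0 ≤ slyZminus n m' k lam ep em := by
  rw [slyZminus_def]
  exact sum_nonneg fun _ _ => sum_nonneg fun _ _ => slyF_nonneg n m' k hlam _ _ _ _

/-- `slyZphase ≥ 0` for `λ ≥ 0`. [folklore] -/
theorem slyZphase_nonneg (n m' k : ℕ) {lam : ℝ} (hlam : 0 ≤ lam) (s : Bool) (ep em : ℕ) :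
    0 ≤ slyZphase n m' k lam s ep em := by
  unfold slyZphase; split_ifs
  · exact slyZplus_nonneg n m' k hlam ep em
  · exact slyZminus_nonneg' n m' k hlam ep em

/-- The number of realisations `(σ, τ)` of the gadget. [folklore] -/
theorem card_realisations (n m' k : ℕ) :
    (Fintype.card ((Fin k → Equiv.Perm (Fin (n + m'))) × Equiv.Perm (Fin n)) : ℝ) =
      ((n + m').factorial : ℝ) ^ k * (n.factorial : ℝ) := by
  rw [Fintype.card_prod, Fintype.card_fun, Fintype.card_perm, Fintype.card_perm, Fintype.card_fin, Fintype.card_fin,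
    Fintype.card_fin]
  push_cast; ring

/-- The number of realisations is positive. [folklore] -/
theorem card_realisations_pos (n m' k : ℕ) : (0 : ℝ) < ((n + m').factorial : ℝ) ^ k * (n.factorial : ℝ) := by
  have h1 : (0 : ℝ) < (n + m').factorial := by exact_mod_cast Nat.factorial_pos _
  have h2 : (0 : ℝ) < n.factorial := by exact_mod_cast Nat.factorial_pos _
  positivity

/-- **Averaging the core over the realisations** (`slyCoreZ_average_*` as a sum identity):
`Σ_{(σ,τ)} Z^{s}_{G̃(σ,τ)}(η) = N · E Z^{s}(η)`. [cite: Sly2010, Lemma 3.3 (first moment)] -/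
theorem sum_realisations_slyCoreZ (lam : ℝ) (s : Bool) {m' k : ℕ} (Ep Em : Finset (Fin m')) :
    ∑ ω : (Fin k → Equiv.Perm (Fin (n + m'))) × Equiv.Perm (Fin n), slyCoreZ ω.1 ω.2 lam s Ep Em =
      (((n + m').factorial : ℝ) ^ k * (n.factorial : ℝ)) * slyZphase n m' k lam s Ep.card Em.card := by
  have hN := card_realisations_pos n m' k
  rw [Fintype.sum_prod_type]
  unfold slyZphase
  cases s
  · simp only [Bool.false_eq_true, if_false]
    rw [← slyCoreZ_average_false lam Ep Em, mul_div_cancel₀ _ hN.ne']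
  · simp only [if_true]
    rw [← slyCoreZ_average_true lam Ep Em, mul_div_cancel₀ _ hN.ne']

/-- Averaging a weighted, restricted sum of core partition functions over the realisations. [folklore] -/
theorem sum_realisations_coreSum (lam : ℝ) (s : Bool) {m' k : ℕ} (P : Finset (Fin m') → Finset (Fin m') → Prop)
    [∀ Ep Em, Decidable (P Ep Em)] (wt : Finset (Fin m') → Finset (Fin m') → ℝ) :
    ∑ ω : (Fin k → Equiv.Perm (Fin (n + m'))) × Equiv.Perm (Fin n),
        ∑ Ep : Finset (Fin m'), ∑ Em : Finset (Fin m'), (if P Ep Em then slyCoreZ ω.1 ω.2 lam s Ep Em * wt Ep Em else 0) =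
      (((n + m').factorial : ℝ) ^ k * (n.factorial : ℝ)) *
        ∑ Ep : Finset (Fin m'), ∑ Em : Finset (Fin m'), (if P Ep Em then slyZphase n m' k lam s Ep.card Em.card * wt Ep Em else 0) := by
  rw [Finset.sum_comm, Finset.mul_sum]
  refine Finset.sum_congr rfl fun Ep _ => ?_
  rw [Finset.sum_comm, Finset.mul_sum]
  refine Finset.sum_congr rfl fun Em _ => ?_
  by_cases hP : P Ep Em
  · simp only [if_pos hP]
    rw [← Finset.sum_mul, sum_realisations_slyCoreZ]; ring
  · simp only [if_neg hP, Finset.sum_const_zero, mul_zero]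

end Averages

section FirstMomentConsequences

/-- The product-measure weight `Q_U^{(a,b)}(η)` as a function of `(|η⁺|, |η⁻|)`:
`a^{e⁺}(1-a)^{m'-e⁺} b^{e⁻}(1-b)^{m'-e⁻}`. [folklore] -/
noncomputable def slyQw (m' : ℕ) (a b : ℝ) (ep em : ℕ) : ℝ :=
  a ^ ep * (1 - a) ^ (m' - ep) * (b ^ em * (1 - b) ^ (m' - em))

/-- `Q_U`-weights are nonnegative. [folklore] -/
theorem slyQw_nonneg (m' : ℕ) {a b : ℝ} (ha0 : 0 ≤ a) (ha1 : a ≤ 1) (hb0 : 0 ≤ b) (hb1 : b ≤ 1) (ep em : ℕ) :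
    0 ≤ slyQw m' a b ep em := by
  unfold slyQw
  exact mul_nonneg (mul_nonneg (pow_nonneg ha0 _) (pow_nonneg (by linarith) _))
    (mul_nonneg (pow_nonneg hb0 _) (pow_nonneg (by linarith) _))

/-- The total first moment `E Z^{s}_{G̃} = Σ_η E Z^{s}_{G̃}(η)` (with multiplicities). [folklore] -/
noncomputable def slyTot (n m' k : ℕ) (lam : ℝ) (s : Bool) : ℝ :=
  ∑ e1 ∈ range (m' + 1), ∑ e2 ∈ range (m' + 1), (m'.choose e1 : ℝ) * (m'.choose e2) * slyZphase n m' k lam s e1 e2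

/-- The phase parameters `(a_s, b_s) = (q⁺, q⁻)` for `s = +` and `(q⁻, q⁺)` for `s = -`. [folklore] -/
noncomputable def slyPa (qp qm : ℝ) (s : Bool) : ℝ := if s then qp else qm
/-- See `slyPa`. [folklore] -/
noncomputable def slyPb (qp qm : ℝ) (s : Bool) : ℝ := if s then qm else qp

/-- **Lemma 3.3 in phase form** (adapter): for `m' ≤ n^γ` and `n` large,
`|E Z^{+}_{G̃} - E Z^{-}_{G̃}| ≤ ε E Z^{-}_{G̃}` and
`|E Z^{s}(η) - Q_U^{s}(η) E Z^{s}| ≤ ε Q_U^{s}(η) E Z^{s}` for all `η` and both `s`.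
[cite: Sly2010, Lemma 3.3] -/
theorem sly_lemma33_phaseForm {d : ℕ} (hd : 3 ≤ d) {lam pp pm : ℝ} (hlam : hardCoreThreshold d < lam)
    (hpm : 0 < pm) (hlt : pm < pp) (hsum : pp + pm < 1)
    (hEα : lam * (1 - pp - pm) ^ d = pp * (1 - pp) ^ (d - 1))
    (hEβ : lam * (1 - pp - pm) ^ d = pm * (1 - pm) ^ (d - 1)) :
    ∃ γ : ℝ, 0 < γ ∧ ∀ ε : ℝ, 0 < ε → ∃ n₀ : ℕ, ∀ n : ℕ, n₀ ≤ n → ∀ m' : ℕ, (m' : ℝ) ≤ (n : ℝ) ^ γ →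
      |slyTot n m' (d - 1) lam true - slyTot n m' (d - 1) lam false| ≤ ε * slyTot n m' (d - 1) lam false ∧
      ∀ s : Bool, ∀ ep em : ℕ, ep ≤ m' → em ≤ m' →
        |slyZphase n m' (d - 1) lam s ep em -
            slyQw m' (slyPa (pp / (1 - pm)) (pm / (1 - pp)) s) (slyPb (pp / (1 - pm)) (pm / (1 - pp)) s) ep em *
              slyTot n m' (d - 1) lam s| ≤
          ε * (slyQw m' (slyPa (pp / (1 - pm)) (pm / (1 - pp)) s) (slyPb (pp / (1 - pm)) (pm / (1 - pp)) s) ep em *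
            slyTot n m' (d - 1) lam s) := by
  obtain ⟨γ, hγ, h⟩ := sly_lemma33_phases hd hlam hpm hlt hsum hEα hEβ
  refine ⟨γ, hγ, fun ε hε => ?_⟩
  obtain ⟨n₀, hn₀⟩ := h ε hε
  refine ⟨n₀, fun n hn m' hm' => ?_⟩
  obtain ⟨h1, h2⟩ := hn₀ n hn m' hm'
  refine ⟨?_, fun s ep em hep hem => ?_⟩
  · simpa [slyTot, slyZphase] using h1
  · obtain ⟨hp, hm⟩ := h2 ep em hep hem
    cases s
    · simpa [slyTot, slyZphase, slyQw, slyPa, slyPb] using hm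
    · simpa [slyTot, slyZphase, slyQw, slyPa, slyPb] using hp

variable {m' : ℕ}

/-- Upper comparison of a weighted restricted sum of `E Z^{s}(η)` with the `Q_U^{s}`-weighted one. [folklore] -/
theorem sum_slyZphase_le {n k : ℕ} {lam ε T : ℝ} {a b : ℝ} (s : Bool)
    (h33 : ∀ ep em : ℕ, ep ≤ m' → em ≤ m' → |slyZphase n m' k lam s ep em - slyQw m' a b ep em * T| ≤ ε * (slyQw m' a b ep em * T))
    (P : Finset (Fin m') → Finset (Fin m') → Prop) [∀ Ep Em, Decidable (P Ep Em)]
    (wt : Finset (Fin m') → Finset (Fin m') → ℝ) (hwt : ∀ Ep Em, 0 ≤ wt Ep Em) :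
    (∑ Ep : Finset (Fin m'), ∑ Em : Finset (Fin m'), (if P Ep Em then slyZphase n m' k lam s Ep.card Em.card * wt Ep Em else 0)) ≤
      (1 + ε) * T * ∑ Ep : Finset (Fin m'), ∑ Em : Finset (Fin m'), (if P Ep Em then slyQw m' a b Ep.card Em.card * wt Ep Em else 0) := by
  rw [Finset.mul_sum]
  refine Finset.sum_le_sum fun Ep _ => ?_
  rw [Finset.mul_sum]
  refine Finset.sum_le_sum fun Em _ => ?_
  have hEp : Ep.card ≤ m' := by simpa using Finset.card_le_univ Ep
  have hEm : Em.card ≤ m' := by simpa using Finset.card_le_univ Em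
  have h := (abs_le.1 (h33 Ep.card Em.card hEp hEm)).2
  split_ifs
  · calc slyZphase n m' k lam s Ep.card Em.card * wt Ep Em ≤ ((1 + ε) * (slyQw m' a b Ep.card Em.card * T)) * wt Ep Em :=
          mul_le_mul_of_nonneg_right (by linarith) (hwt Ep Em)
      _ = (1 + ε) * T * (slyQw m' a b Ep.card Em.card * wt Ep Em) := by ring
  · simp

/-- Lower comparison of the full weighted sum. [folklore] -/
theorem le_sum_slyZphase {n k : ℕ} {lam ε T : ℝ} {a b : ℝ} (s : Bool)
    (h33 : ∀ ep em : ℕ, ep ≤ m' → em ≤ m' → |slyZphase n m' k lam s ep em - slyQw m' a b ep em * T| ≤ ε * (slyQw m' a b ep em * T))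
    (wt : Finset (Fin m') → Finset (Fin m') → ℝ) (hwt : ∀ Ep Em, 0 ≤ wt Ep Em) :
    (1 - ε) * T * ∑ Ep : Finset (Fin m'), ∑ Em : Finset (Fin m'), slyQw m' a b Ep.card Em.card * wt Ep Em ≤
      ∑ Ep : Finset (Fin m'), ∑ Em : Finset (Fin m'), slyZphase n m' k lam s Ep.card Em.card * wt Ep Em := by
  rw [Finset.mul_sum]
  refine Finset.sum_le_sum fun Ep _ => ?_
  rw [Finset.mul_sum]
  refine Finset.sum_le_sum fun Em _ => ?_
  have hEp : Ep.card ≤ m' := by simpa using Finset.card_le_univ Ep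
  have hEm : Em.card ≤ m' := by simpa using Finset.card_le_univ Em
  have h := (abs_le.1 (h33 Ep.card Em.card hEp hEm)).1
  calc (1 - ε) * T * (slyQw m' a b Ep.card Em.card * wt Ep Em) = ((1 - ε) * (slyQw m' a b Ep.card Em.card * T)) * wt Ep Em := by ring
    _ ≤ slyZphase n m' k lam s Ep.card Em.card * wt Ep Em := mul_le_mul_of_nonneg_right (by linarith) (hwt Ep Em)

/-- **Symmetry of the `Q_U`-weighted forest mass**: `Σ_η Q^{(a,b)}(η) κ(η⁺)κ(η⁻) = Σ_η Q^{(b,a)}(η) κ(η⁺)κ(η⁻)`. [folklore] -/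
theorem sum_slyQw_swap (a b : ℝ) (κ : Finset (Fin m') → ℝ) :
    (∑ Ep : Finset (Fin m'), ∑ Em : Finset (Fin m'), slyQw m' a b Ep.card Em.card * (κ Ep * κ Em)) =
      ∑ Ep : Finset (Fin m'), ∑ Em : Finset (Fin m'), slyQw m' b a Ep.card Em.card * (κ Ep * κ Em) := by
  have h : ∀ a b : ℝ, (∑ Ep : Finset (Fin m'), ∑ Em : Finset (Fin m'), slyQw m' a b Ep.card Em.card * (κ Ep * κ Em)) =
      (∑ E : Finset (Fin m'), a ^ E.card * (1 - a) ^ (m' - E.card) * κ E) *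
        ∑ E : Finset (Fin m'), b ^ E.card * (1 - b) ^ (m' - E.card) * κ E := by
    intro a b
    rw [Finset.sum_mul_sum]
    refine Finset.sum_congr rfl fun Ep _ => Finset.sum_congr rfl fun Em _ => ?_
    unfold slyQw; ring
  rw [h, h, mul_comm]

end FirstMomentConsequences

section GoodRealisation

variable {n m D q : ℕ} {lam : ℝ}

/-- `κ(E) = Π_j Z_D(A_j(E))`, the total forest weight given the leaf set `E`. [folklore] -/
noncomputable def slyKap (m D q : ℕ) (lam : ℝ) (E : Finset (Fin (m * q ^ D))) : ℝ :=
  ∏ j : Fin m, hcTreeZtot q lam D (slyTreeConfig m D q E j)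

/-- `κ(E) > 0`. [folklore] -/
theorem slyKap_pos (hlam : 0 ≤ lam) (E : Finset (Fin (m * q ^ D))) : 0 < slyKap m D q lam E :=
  Finset.prod_pos fun _ _ => hcTreeZtot_pos hlam D _

/-- The good boundary configurations for phase parameters `(a, b)` and threshold `t`. [folklore] -/
abbrev SlyGoodCfg (m D q : ℕ) (lam a b t : ℝ) (Ep Em : Finset (Fin (m * q ^ D))) : Prop :=
  (∀ j, |hcTreeX q lam D (slyTreeConfig m D q Ep j) - a| ≤ t) ∧ (∀ j, |hcTreeX q lam D (slyTreeConfig m D q Em j) - b| ≤ t)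

/-- **The deterministic core of Sly's proof of Theorem 2.1, per phase.** Fix a realisation `ω = (σ,τ)`
and a phase `s` with parameters `(a, b)`; write `Z_ω = Σ_η Z_ω(η) κκ`, `Bad_ω = Σ_{η bad} Z_ω(η) κκ`,
`avg = Σ_η EZ(η) κκ`, `avgBad = Σ_{η bad} EZ(η) κκ`. If `EZ(η) ∈ (1 ± ε) Q^{(a,b)}(η) T` (Lemma 3.3),
the bad `Q`-mass is at most `ρ` times the total (Lemma 4.2 via `bad_mass_expect_le`), and `ω` is
typical (`Z_ω ≥ avg/(2c)`, `Bad_ω ≤ 8 avgBad`), then `Bad_ω ≤ 16 c ρ (1+ε)/(1-ε) · Z_ω`.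
[cite: Sly2010, §4.1 (proof of Theorem 2.1, eqs. (e:expectedBSmall)–(e:thetaB))] -/
theorem badMass_le_of_typical {ι : Type*} [Fintype ι] (Zω EZ Qw wt : ι → ℝ) (bad : ι → Prop) [DecidablePred bad]
    {ε T ρ c : ℝ} (hε0 : 0 ≤ ε) (hε1 : ε < 1) (hT : 0 ≤ T) (hρ0 : 0 ≤ ρ) (hc : 0 < c)
    (hwt : ∀ η, 0 ≤ wt η) (hQw : ∀ η, 0 ≤ Qw η)
    (h33 : ∀ η, |EZ η - Qw η * T| ≤ ε * (Qw η * T))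
    (hD1 : (∑ η, if bad η then Qw η * wt η else 0) ≤ ρ * ∑ η, Qw η * wt η)
    (hlow : (∑ η, EZ η * wt η) / (2 * c) ≤ ∑ η, Zω η * wt η)
    (hbad : (∑ η, if bad η then Zω η * wt η else 0) ≤ 8 * ∑ η, (if bad η then EZ η * wt η else 0)) :
    (∑ η, if bad η then Zω η * wt η else 0) ≤ 16 * c * ρ * ((1 + ε) / (1 - ε)) * ∑ η, Zω η * wt η := by
  -- `avgBad ≤ (1+ε) T Σ_bad Qw wt`
  have h1 : (∑ η, (if bad η then EZ η * wt η else 0)) ≤ (1 + ε) * T * ∑ η, (if bad η then Qw η * wt η else 0) := by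
    rw [Finset.mul_sum]
    refine Finset.sum_le_sum fun η _ => ?_
    split_ifs
    · have h := (abs_le.1 (h33 η)).2
      calc EZ η * wt η ≤ ((1 + ε) * (Qw η * T)) * wt η := mul_le_mul_of_nonneg_right (by linarith) (hwt η)
        _ = (1 + ε) * T * (Qw η * wt η) := by ring
    · simp
  -- `(1-ε) T Σ Qw wt ≤ avg ≤ 2c Z_ω`
  have h2 : (1 - ε) * T * ∑ η, Qw η * wt η ≤ ∑ η, EZ η * wt η := by
    rw [Finset.mul_sum]
    refine Finset.sum_le_sum fun η _ => ?_
    have h := (abs_le.1 (h33 η)).1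
    calc (1 - ε) * T * (Qw η * wt η) = ((1 - ε) * (Qw η * T)) * wt η := by ring
      _ ≤ EZ η * wt η := mul_le_mul_of_nonneg_right (by linarith) (hwt η)
  have h3 : ∑ η, EZ η * wt η ≤ 2 * c * ∑ η, Zω η * wt η := by
    rw [div_le_iff₀ (by linarith)] at hlow; linarith
  have hQsum0 : 0 ≤ ∑ η, Qw η * wt η := Finset.sum_nonneg fun η _ => mul_nonneg (hQw η) (hwt η)
  have h1e : 0 < 1 - ε := by linarith
  -- chain
  have h4 : T * ∑ η, Qw η * wt η ≤ 2 * c / (1 - ε) * ∑ η, Zω η * wt η := by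
    rw [div_mul_eq_mul_div, le_div_iff₀ h1e]
    nlinarith [h2, h3]
  have hρ : (∑ η, if bad η then Qw η * wt η else 0) ≤ ρ * ∑ η, Qw η * wt η := hD1
  calc (∑ η, if bad η then Zω η * wt η else 0) ≤ 8 * ∑ η, (if bad η then EZ η * wt η else 0) := hbad
    _ ≤ 8 * ((1 + ε) * T * ∑ η, (if bad η then Qw η * wt η else 0)) := by linarith [h1]
    _ ≤ 8 * ((1 + ε) * T * (ρ * ∑ η, Qw η * wt η)) := by
        have : 0 ≤ (1 + ε) * T := mul_nonneg (by linarith) hT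
        nlinarith [hρ, this]
    _ = 8 * (1 + ε) * ρ * (T * ∑ η, Qw η * wt η) := by ring
    _ ≤ 8 * (1 + ε) * ρ * (2 * c / (1 - ε) * ∑ η, Zω η * wt η) :=
        mul_le_mul_of_nonneg_left h4 (mul_nonneg (mul_nonneg (by linarith) (by linarith)) hρ0)
    _ = 16 * c * ρ * ((1 + ε) / (1 - ε)) * ∑ η, Zω η * wt η := by
        field_simp
        ring

end GoodRealisation

section GoodRealisation2

/-- **The other phase is not much heavier** (towards (GpropA)): with the notation of
`badMass_le_of_typical`, if moreover the other phase `s'` has `EZ'(η) ≤ (1+ε) Q'(η) T'`, `T' ≤ 2T`,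
`Σ Q' wt = Σ Q wt` (symmetry of the product measure) and `ω` is typical for it (`Z'_ω ≤ 8 avg'`), then
`Z'_ω ≤ 32 c (1+ε)/(1-ε) · Z_ω`. [cite: Sly2010, §4.1 (proof of Theorem 2.1, (GpropA) via Lemma 3.3 and Theorem 3.10)] -/
theorem otherPhase_le_of_typical {ι : Type*} [Fintype ι] (Zω EZ Qw Zω' EZ' Qw' wt : ι → ℝ)
    {ε T T' c : ℝ} (hε0 : 0 ≤ ε) (hε1 : ε < 1) (hc : 0 < c)
    (hwt : ∀ η, 0 ≤ wt η) (hQw : ∀ η, 0 ≤ Qw η)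
    (h33 : ∀ η, |EZ η - Qw η * T| ≤ ε * (Qw η * T))
    (h33' : ∀ η, |EZ' η - Qw' η * T'| ≤ ε * (Qw' η * T'))
    (hTT : T' ≤ 2 * T) (hsym : ∑ η, Qw' η * wt η = ∑ η, Qw η * wt η)
    (hlow : (∑ η, EZ η * wt η) / (2 * c) ≤ ∑ η, Zω η * wt η)
    (hhigh : ∑ η, Zω' η * wt η ≤ 8 * ∑ η, EZ' η * wt η) :
    ∑ η, Zω' η * wt η ≤ 32 * c * ((1 + ε) / (1 - ε)) * ∑ η, Zω η * wt η := by
  have h1 : ∑ η, EZ' η * wt η ≤ (1 + ε) * T' * ∑ η, Qw' η * wt η := by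
    rw [Finset.mul_sum]
    refine Finset.sum_le_sum fun η _ => ?_
    have h := (abs_le.1 (h33' η)).2
    calc EZ' η * wt η ≤ ((1 + ε) * (Qw' η * T')) * wt η := mul_le_mul_of_nonneg_right (by linarith) (hwt η)
      _ = (1 + ε) * T' * (Qw' η * wt η) := by ring
  have h2 : (1 - ε) * T * ∑ η, Qw η * wt η ≤ ∑ η, EZ η * wt η := by
    rw [Finset.mul_sum]
    refine Finset.sum_le_sum fun η _ => ?_
    have h := (abs_le.1 (h33 η)).1
    calc (1 - ε) * T * (Qw η * wt η) = ((1 - ε) * (Qw η * T)) * wt η := by ring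
      _ ≤ EZ η * wt η := mul_le_mul_of_nonneg_right (by linarith) (hwt η)
  have h3 : ∑ η, EZ η * wt η ≤ 2 * c * ∑ η, Zω η * wt η := by
    rw [div_le_iff₀ (by linarith)] at hlow; linarith
  have hQsum0 : 0 ≤ ∑ η, Qw η * wt η := Finset.sum_nonneg fun η _ => mul_nonneg (hQw η) (hwt η)
  have h1e : 0 < 1 - ε := by linarith
  have h4 : T * ∑ η, Qw η * wt η ≤ 2 * c / (1 - ε) * ∑ η, Zω η * wt η := by
    rw [div_mul_eq_mul_div, le_div_iff₀ h1e]
    nlinarith [h2, h3]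
  rw [hsym] at h1
  calc ∑ η, Zω' η * wt η ≤ 8 * ∑ η, EZ' η * wt η := hhigh
    _ ≤ 8 * ((1 + ε) * T' * ∑ η, Qw η * wt η) := by linarith [h1]
    _ ≤ 8 * ((1 + ε) * (2 * T) * ∑ η, Qw η * wt η) := by
        have : 0 ≤ (1 + ε) * ∑ η, Qw η * wt η := mul_nonneg (by linarith) hQsum0
        nlinarith [hTT, this]
    _ = 16 * (1 + ε) * (T * ∑ η, Qw η * wt η) := by ring
    _ ≤ 16 * (1 + ε) * (2 * c / (1 - ε) * ∑ η, Zω η * wt η) :=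
        mul_le_mul_of_nonneg_left h4 (mul_nonneg (by norm_num) (by linarith))
    _ = 32 * c * ((1 + ε) / (1 - ε)) * ∑ η, Zω η * wt η := by
        field_simp
        ring

end GoodRealisation2

section GadgetProps

variable {n m D q : ℕ}

/-- `Z_G(Y = s)` of the gadget as the weighted core sum `Σ_η Z^{s}_{G̃(σ,τ)}(η) κ(η⁺) κ(η⁻)`. [folklore] -/
theorem hardcoreZOn_phase_eq_coreSum (σ : Fin q → Equiv.Perm (Fin (n + m * q ^ D))) (τ : Equiv.Perm (Fin n))
    (lam : ℝ) (s : Bool) :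
    hardcoreZOn (slyGadgetFin n m D q σ τ) lam (fun I => slyPhase (slyWPlus n m D q) (slyWMinus n m D q) I = s) =
      ∑ Ep : Finset (Fin (m * q ^ D)), ∑ Em : Finset (Fin (m * q ^ D)),
        slyCoreZ σ τ lam s Ep Em * (slyKap m D q lam Ep * slyKap m D q lam Em) := by
  rw [hardcoreZOn_slyGadgetFin_phase]
  refine Finset.sum_congr rfl fun Ep _ => Finset.sum_congr rfl fun Em _ => ?_
  rw [sum_slyForestZ, sum_slyForestZ]; rfl

open scoped Classical in
/-- `Z_G = Z_G(Y = +) + Z_G(Y = -)`. [folklore] -/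
theorem independencePolynomial_eq_phases (σ : Fin q → Equiv.Perm (Fin (n + m * q ^ D))) (τ : Equiv.Perm (Fin n)) (lam : ℝ) :
    independencePolynomial (slyGadgetFin n m D q σ τ) lam =
      hardcoreZOn (slyGadgetFin n m D q σ τ) lam (fun I => slyPhase (slyWPlus n m D q) (slyWMinus n m D q) I = true) +
        hardcoreZOn (slyGadgetFin n m D q σ τ) lam (fun I => slyPhase (slyWPlus n m D q) (slyWMinus n m D q) I = false) := by
  rw [← hardcoreZOn_add_not _ lam (fun I => slyPhase (slyWPlus n m D q) (slyWMinus n m D q) I = true)]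
  congr 1
  congr 1
  funext I
  exact Bool.not_eq_true _

open scoped Classical in
/-- **The gadget properties at a typical realisation** (Sly's proof of Theorem 2.1, deterministic
part). Fix `ω = (σ, τ)`, parameters `0 < q⁻ < q⁺ < 1`, a threshold `t ≤ p = min(q⁻, 1-q⁺)`,
`ε < 1`, first-moment totals `T(s)` with Lemma 3.3's conclusions (`EZ^{s}(η) ∈ (1±ε) Q^{s}(η) T(s)`,
`T(¬s) ≤ 2 T(s)`), a bad-`Q`-mass fraction `ρ` (Lemma 4.2 via `bad_mass_expect_le`), and suppose
`ω` is typical for the six events (lower tail `Z^{s}_ω ≥ avg^{s}/(2c)`, Markov `Z^{s}_ω ≤ 8 avg^{s}`,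
`Bad^{s}_ω ≤ 8 avgBad^{s}`). Then the gadget `G(ω)` satisfies `(GpropB)` with
`δ = (1 + t/p)^{2m} - 1 + 16 c ρ (1+ε)/(1-ε) / p^{2m}` and `Z_G(Y = ¬s) ≤ 32 c (1+ε)/(1-ε) Z_G(Y = s)`.
[cite: Sly2010, §4.1 (proof of Theorem 2.1)] -/
theorem sly_gadgetProps_of_typical (σ : Fin q → Equiv.Perm (Fin (n + m * q ^ D))) (τ : Equiv.Perm (Fin n))
    {lam qp qm t ε ρ c : ℝ} (hlam : 0 ≤ lam) (hqm : 0 < qm) (hlt : qm < qp) (hqp : qp < 1) (ht0 : 0 ≤ t)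
    (htp : t ≤ min qm (1 - qp)) (hε0 : 0 ≤ ε) (hε1 : ε < 1) (hρ0 : 0 ≤ ρ) (hc : 0 < c)
    (T : Bool → ℝ) (hT : ∀ s, 0 ≤ T s) (hTT : ∀ s, T (!s) ≤ 2 * T s)
    (h33 : ∀ (s : Bool) (ep em : ℕ), ep ≤ m * q ^ D → em ≤ m * q ^ D →
      |slyZphase n (m * q ^ D) q lam s ep em - slyQw (m * q ^ D) (slyPa qp qm s) (slyPb qp qm s) ep em * T s| ≤
        ε * (slyQw (m * q ^ D) (slyPa qp qm s) (slyPb qp qm s) ep em * T s))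
    (hD1 : ∀ s : Bool, (∑ Ep : Finset (Fin (m * q ^ D)), ∑ Em : Finset (Fin (m * q ^ D)),
        if SlyGoodCfg m D q lam (slyPa qp qm s) (slyPb qp qm s) t Ep Em then (0 : ℝ)
        else slyQw (m * q ^ D) (slyPa qp qm s) (slyPb qp qm s) Ep.card Em.card * (slyKap m D q lam Ep * slyKap m D q lam Em)) ≤
      ρ * ∑ Ep : Finset (Fin (m * q ^ D)), ∑ Em : Finset (Fin (m * q ^ D)),
        slyQw (m * q ^ D) (slyPa qp qm s) (slyPb qp qm s) Ep.card Em.card * (slyKap m D q lam Ep * slyKap m D q lam Em))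
    (hlow : ∀ s : Bool, (∑ Ep : Finset (Fin (m * q ^ D)), ∑ Em : Finset (Fin (m * q ^ D)),
        slyZphase n (m * q ^ D) q lam s Ep.card Em.card * (slyKap m D q lam Ep * slyKap m D q lam Em)) / (2 * c) ≤
      ∑ Ep : Finset (Fin (m * q ^ D)), ∑ Em : Finset (Fin (m * q ^ D)),
        slyCoreZ σ τ lam s Ep Em * (slyKap m D q lam Ep * slyKap m D q lam Em))
    (hhigh : ∀ s : Bool, (∑ Ep : Finset (Fin (m * q ^ D)), ∑ Em : Finset (Fin (m * q ^ D)),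
        slyCoreZ σ τ lam s Ep Em * (slyKap m D q lam Ep * slyKap m D q lam Em)) ≤
      8 * ∑ Ep : Finset (Fin (m * q ^ D)), ∑ Em : Finset (Fin (m * q ^ D)),
        slyZphase n (m * q ^ D) q lam s Ep.card Em.card * (slyKap m D q lam Ep * slyKap m D q lam Em))
    (hbad : ∀ s : Bool, (∑ Ep : Finset (Fin (m * q ^ D)), ∑ Em : Finset (Fin (m * q ^ D)),
        if SlyGoodCfg m D q lam (slyPa qp qm s) (slyPb qp qm s) t Ep Em then (0 : ℝ)
        else slyCoreZ σ τ lam s Ep Em * (slyKap m D q lam Ep * slyKap m D q lam Em)) ≤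
      8 * ∑ Ep : Finset (Fin (m * q ^ D)), ∑ Em : Finset (Fin (m * q ^ D)),
        if SlyGoodCfg m D q lam (slyPa qp qm s) (slyPb qp qm s) t Ep Em then (0 : ℝ)
        else slyZphase n (m * q ^ D) q lam s Ep.card Em.card * (slyKap m D q lam Ep * slyKap m D q lam Em)) :
    SlyPropB (slyGadgetFin n m D q σ τ) lam (slyWPlus n m D q) (slyWMinus n m D q) (slyPortPlus n m D q) (slyPortMinus n m D q)
        qp qm ((1 + t / min qm (1 - qp)) ^ (2 * m) - 1 + (16 * c * ρ * ((1 + ε) / (1 - ε))) / (min qm (1 - qp)) ^ (2 * m)) ∧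
      ∀ s : Bool, hardcoreZOn (slyGadgetFin n m D q σ τ) lam (fun I => slyPhase (slyWPlus n m D q) (slyWMinus n m D q) I = !s) ≤
        32 * c * ((1 + ε) / (1 - ε)) *
          hardcoreZOn (slyGadgetFin n m D q σ τ) lam (fun I => slyPhase (slyWPlus n m D q) (slyWMinus n m D q) I = s) := by
  -- abbreviations over `ι = Finset × Finset`
  have hκ0 : ∀ E, 0 < slyKap m D q lam E := fun E => slyKap_pos hlam E
  have hwt : ∀ η : Finset (Fin (m * q ^ D)) × Finset (Fin (m * q ^ D)), 0 ≤ slyKap m D q lam η.1 * slyKap m D q lam η.2 :=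
    fun η => mul_nonneg (hκ0 η.1).le (hκ0 η.2).le
  have hPa : ∀ s, 0 ≤ slyPa qp qm s ∧ slyPa qp qm s ≤ 1 := fun s => by
    unfold slyPa; split_ifs <;> constructor <;> linarith
  have hPb : ∀ s, 0 ≤ slyPb qp qm s ∧ slyPb qp qm s ≤ 1 := fun s => by
    unfold slyPb; split_ifs <;> constructor <;> linarith
  have hQw0 : ∀ s (η : Finset (Fin (m * q ^ D)) × Finset (Fin (m * q ^ D))),
      0 ≤ slyQw (m * q ^ D) (slyPa qp qm s) (slyPb qp qm s) η.1.card η.2.card := fun s η =>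
    slyQw_nonneg _ (hPa s).1 (hPa s).2 (hPb s).1 (hPb s).2 _ _
  have hcardle : ∀ E : Finset (Fin (m * q ^ D)), E.card ≤ m * q ^ D := fun E => by simpa using Finset.card_le_univ E
  -- (1) bad mass per phase
  have hB : ∀ s : Bool, (∑ Ep : Finset (Fin (m * q ^ D)), ∑ Em : Finset (Fin (m * q ^ D)),
        if SlyGoodCfg m D q lam (slyPa qp qm s) (slyPb qp qm s) t Ep Em then (0 : ℝ)
        else slyCoreZ σ τ lam s Ep Em * (slyKap m D q lam Ep * slyKap m D q lam Em)) ≤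
      16 * c * ρ * ((1 + ε) / (1 - ε)) * ∑ Ep : Finset (Fin (m * q ^ D)), ∑ Em : Finset (Fin (m * q ^ D)),
        slyCoreZ σ τ lam s Ep Em * (slyKap m D q lam Ep * slyKap m D q lam Em) := by
    intro s
    have h := badMass_le_of_typical (ι := Finset (Fin (m * q ^ D)) × Finset (Fin (m * q ^ D)))
      (fun η => slyCoreZ σ τ lam s η.1 η.2) (fun η => slyZphase n (m * q ^ D) q lam s η.1.card η.2.card)
      (fun η => slyQw (m * q ^ D) (slyPa qp qm s) (slyPb qp qm s) η.1.card η.2.card)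
      (fun η => slyKap m D q lam η.1 * slyKap m D q lam η.2)
      (fun η => ¬SlyGoodCfg m D q lam (slyPa qp qm s) (slyPb qp qm s) t η.1 η.2)
      hε0 hε1 (hT s) hρ0 hc hwt (hQw0 s) (fun η => h33 s _ _ (hcardle η.1) (hcardle η.2))
      (by simpa only [Fintype.sum_prod_type, ite_not] using hD1 s)
      (by simpa only [Fintype.sum_prod_type] using hlow s)
      (by simpa only [Fintype.sum_prod_type, ite_not] using hbad s)
    simpa only [Fintype.sum_prod_type, ite_not] using h
  -- (2) the other phase
  have hA : ∀ s : Bool, (∑ Ep : Finset (Fin (m * q ^ D)), ∑ Em : Finset (Fin (m * q ^ D)),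
        slyCoreZ σ τ lam (!s) Ep Em * (slyKap m D q lam Ep * slyKap m D q lam Em)) ≤
      32 * c * ((1 + ε) / (1 - ε)) * ∑ Ep : Finset (Fin (m * q ^ D)), ∑ Em : Finset (Fin (m * q ^ D)),
        slyCoreZ σ τ lam s Ep Em * (slyKap m D q lam Ep * slyKap m D q lam Em) := by
    intro s
    have hsym : (∑ η : Finset (Fin (m * q ^ D)) × Finset (Fin (m * q ^ D)),
        slyQw (m * q ^ D) (slyPa qp qm (!s)) (slyPb qp qm (!s)) η.1.card η.2.card * (slyKap m D q lam η.1 * slyKap m D q lam η.2)) =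
        ∑ η : Finset (Fin (m * q ^ D)) × Finset (Fin (m * q ^ D)),
          slyQw (m * q ^ D) (slyPa qp qm s) (slyPb qp qm s) η.1.card η.2.card * (slyKap m D q lam η.1 * slyKap m D q lam η.2) := by
      have ha : slyPa qp qm (!s) = slyPb qp qm s := by cases s <;> rfl
      have hb : slyPb qp qm (!s) = slyPa qp qm s := by cases s <;> rfl
      simp only [Fintype.sum_prod_type, ha, hb]
      exact sum_slyQw_swap _ _ (slyKap m D q lam)
    have h := otherPhase_le_of_typical (ι := Finset (Fin (m * q ^ D)) × Finset (Fin (m * q ^ D)))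
      (fun η => slyCoreZ σ τ lam s η.1 η.2) (fun η => slyZphase n (m * q ^ D) q lam s η.1.card η.2.card)
      (fun η => slyQw (m * q ^ D) (slyPa qp qm s) (slyPb qp qm s) η.1.card η.2.card)
      (fun η => slyCoreZ σ τ lam (!s) η.1 η.2) (fun η => slyZphase n (m * q ^ D) q lam (!s) η.1.card η.2.card)
      (fun η => slyQw (m * q ^ D) (slyPa qp qm (!s)) (slyPb qp qm (!s)) η.1.card η.2.card)
      (fun η => slyKap m D q lam η.1 * slyKap m D q lam η.2)
      hε0 hε1 hc hwt (hQw0 s) (fun η => h33 s _ _ (hcardle η.1) (hcardle η.2))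
      (fun η => h33 (!s) _ _ (hcardle η.1) (hcardle η.2)) (hTT s) hsym
      (by simpa only [Fintype.sum_prod_type] using hlow s)
      (by simpa only [Fintype.sum_prod_type] using hhigh (!s))
    simpa only [Fintype.sum_prod_type] using h
  refine ⟨?_, fun s => ?_⟩
  · refine slyPropB_of_bad_mass σ τ hlam hqm hlt hqp ht0 htp (β := 16 * c * ρ * ((1 + ε) / (1 - ε))) ?_ fun s => ?_
    · exact mul_nonneg (mul_nonneg (mul_nonneg (by norm_num) hc.le) hρ0) (div_nonneg (by linarith) (by linarith))
    · rw [hardcoreZOn_phase_eq_coreSum]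
      have h := hB s
      simp only [slyPa, slyPb] at h
      exact h
  · rw [hardcoreZOn_phase_eq_coreSum, hardcoreZOn_phase_eq_coreSum]
    exact hA s

end GadgetProps

section Typical

variable {Ω : Type*} [Fintype Ω]

open scoped Classical in
/-- Markov, fraction form: at most `1/8` of the realisations exceed `8 ×` the average. [folklore] -/
theorem card_filter_gt_eight_avg (f : Ω → ℝ) (hf : ∀ ω, 0 ≤ f ω) :
    8 * ((univ.filter fun ω => 8 * ((∑ ω', f ω') / Fintype.card Ω) < f ω).card : ℝ) ≤ Fintype.card Ω := by
  have hA0 : 0 ≤ ∑ ω', f ω' := Finset.sum_nonneg fun ω _ => hf ω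
  have hN0 : (0 : ℝ) ≤ Fintype.card Ω := by exact_mod_cast Nat.zero_le _
  rcases eq_or_lt_of_le hA0 with hA00 | hApos
  · -- `Σ f = 0`: all `f ω = 0`, the set is empty
    have hf0 : ∀ ω, f ω = 0 := fun ω => (Finset.sum_eq_zero_iff_of_nonneg (fun ω _ => hf ω)).1 hA00.symm ω (Finset.mem_univ _)
    have : (univ.filter fun ω => 8 * ((∑ ω', f ω') / Fintype.card Ω) < f ω) = ∅ := by
      rw [Finset.filter_eq_empty_iff]; intro ω _ h; rw [hf0 ω, ← hA00] at h; simp at h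
    rw [this]; simp [hN0]
  · rcases eq_or_lt_of_le hN0 with hN00 | hNpos
    · have : (univ : Finset Ω) = ∅ := by
        rw [← Finset.card_eq_zero]; exact_mod_cast hN00.symm
      simp [this]
    have hsub : (univ.filter fun ω => 8 * ((∑ ω', f ω') / Fintype.card Ω) < f ω) ⊆
        univ.filter fun ω => 8 * (∑ ω', f ω') / Fintype.card Ω ≤ f ω := by
      intro ω hω; rw [Finset.mem_filter] at hω ⊢; exact ⟨hω.1, by rw [mul_div_assoc]; exact hω.2.le⟩
    have h1 := card_filter_mul_le_sum f hf (8 * (∑ ω', f ω') / Fintype.card Ω)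
    have h2 : ((univ.filter fun ω => 8 * ((∑ ω', f ω') / Fintype.card Ω) < f ω).card : ℝ) ≤
        (univ.filter fun ω => 8 * (∑ ω', f ω') / Fintype.card Ω ≤ f ω).card := by
      exact_mod_cast Finset.card_le_card hsub
    rw [← mul_div_assoc, div_le_iff₀ hNpos] at h1
    have h4 : 8 * ((univ.filter fun ω => 8 * (∑ ω', f ω') / Fintype.card Ω ≤ f ω).card : ℝ) ≤ Fintype.card Ω := by
      by_contra h
      have h := not_le.1 h
      nlinarith [mul_lt_mul_of_pos_right h hApos]
    linarith

end Typical

section TypicalGadget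

variable {n m D q : ℕ}

open scoped Classical in
/-- **Existence of a typical realisation** (the union bound of Sly's proof of Theorem 2.1, counting
form): if for every `η` and both phases at most a `1/16` fraction of the realisations `ω = (σ,τ)` have
`Z^{s}_ω(η) < E Z^{s}(η)/c` (Theorem 3.10), then some `ω` satisfies, for both phases, the lower tail
`Z^{s}_ω ≥ avg^{s}/(2c)` and the Markov bounds `Z^{s}_ω ≤ 8 avg^{s}`, `Bad^{s}_ω ≤ 8 avgBad^{s}`
(six events of failure fraction `≤ 1/8` each). [cite: Sly2010, §4.1 (proof of Theorem 2.1); Theorem 3.10] -/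
theorem exists_typical_realisation (lam : ℝ) (hlam : 0 ≤ lam) {c : ℝ} (hc : 0 < c)
    (bad : Bool → Finset (Fin (m * q ^ D)) → Finset (Fin (m * q ^ D)) → Prop)
    (hpt : ∀ (s : Bool) (Ep Em : Finset (Fin (m * q ^ D))),
      16 * ((univ.filter fun ω : (Fin q → Equiv.Perm (Fin (n + m * q ^ D))) × Equiv.Perm (Fin n) =>
        (Fintype.card ((Fin q → Equiv.Perm (Fin (n + m * q ^ D))) × Equiv.Perm (Fin n)) : ℝ) * slyCoreZ ω.1 ω.2 lam s Ep Em <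
          (∑ ω' : (Fin q → Equiv.Perm (Fin (n + m * q ^ D))) × Equiv.Perm (Fin n), slyCoreZ ω'.1 ω'.2 lam s Ep Em) / c).card : ℝ) ≤
        Fintype.card ((Fin q → Equiv.Perm (Fin (n + m * q ^ D))) × Equiv.Perm (Fin n))) :
    ∃ ω : (Fin q → Equiv.Perm (Fin (n + m * q ^ D))) × Equiv.Perm (Fin n), ∀ s : Bool,
      (∑ Ep : Finset (Fin (m * q ^ D)), ∑ Em : Finset (Fin (m * q ^ D)),
          slyZphase n (m * q ^ D) q lam s Ep.card Em.card * (slyKap m D q lam Ep * slyKap m D q lam Em)) / (2 * c) ≤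
        ∑ Ep : Finset (Fin (m * q ^ D)), ∑ Em : Finset (Fin (m * q ^ D)),
          slyCoreZ ω.1 ω.2 lam s Ep Em * (slyKap m D q lam Ep * slyKap m D q lam Em) ∧
      (∑ Ep : Finset (Fin (m * q ^ D)), ∑ Em : Finset (Fin (m * q ^ D)),
          slyCoreZ ω.1 ω.2 lam s Ep Em * (slyKap m D q lam Ep * slyKap m D q lam Em)) ≤
        8 * ∑ Ep : Finset (Fin (m * q ^ D)), ∑ Em : Finset (Fin (m * q ^ D)),
          slyZphase n (m * q ^ D) q lam s Ep.card Em.card * (slyKap m D q lam Ep * slyKap m D q lam Em) ∧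
      (∑ Ep : Finset (Fin (m * q ^ D)), ∑ Em : Finset (Fin (m * q ^ D)),
          if bad s Ep Em then slyCoreZ ω.1 ω.2 lam s Ep Em * (slyKap m D q lam Ep * slyKap m D q lam Em) else 0) ≤
        8 * ∑ Ep : Finset (Fin (m * q ^ D)), ∑ Em : Finset (Fin (m * q ^ D)),
          if bad s Ep Em then slyZphase n (m * q ^ D) q lam s Ep.card Em.card * (slyKap m D q lam Ep * slyKap m D q lam Em) else 0 := by
  set Ωt := (Fin q → Equiv.Perm (Fin (n + m * q ^ D))) × Equiv.Perm (Fin n)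
  set N : ℝ := (Fintype.card Ωt : ℝ) with hN
  have hNeq : N = (((n + m * q ^ D).factorial : ℝ) ^ q * (n.factorial : ℝ)) := by rw [hN]; exact card_realisations n (m * q ^ D) q
  have hNpos : 0 < N := by rw [hNeq]; exact card_realisations_pos n _ q
  have hκ0 : ∀ E, 0 < slyKap m D q lam E := fun E => slyKap_pos hlam E
  -- the three families of functionals
  let Zr : Bool → Ωt → ℝ := fun s ω => ∑ Ep : Finset (Fin (m * q ^ D)), ∑ Em : Finset (Fin (m * q ^ D)),
    slyCoreZ ω.1 ω.2 lam s Ep Em * (slyKap m D q lam Ep * slyKap m D q lam Em)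
  let Br : Bool → Ωt → ℝ := fun s ω => ∑ Ep : Finset (Fin (m * q ^ D)), ∑ Em : Finset (Fin (m * q ^ D)),
    if bad s Ep Em then slyCoreZ ω.1 ω.2 lam s Ep Em * (slyKap m D q lam Ep * slyKap m D q lam Em) else 0
  let avgZ : Bool → ℝ := fun s => ∑ Ep : Finset (Fin (m * q ^ D)), ∑ Em : Finset (Fin (m * q ^ D)),
    slyZphase n (m * q ^ D) q lam s Ep.card Em.card * (slyKap m D q lam Ep * slyKap m D q lam Em)
  let avgB : Bool → ℝ := fun s => ∑ Ep : Finset (Fin (m * q ^ D)), ∑ Em : Finset (Fin (m * q ^ D)),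
    if bad s Ep Em then slyZphase n (m * q ^ D) q lam s Ep.card Em.card * (slyKap m D q lam Ep * slyKap m D q lam Em) else 0
  have hZr0 : ∀ s ω, 0 ≤ Zr s ω := fun s ω => Finset.sum_nonneg fun Ep _ => Finset.sum_nonneg fun Em _ =>
    mul_nonneg (slyCoreZ_nonneg _ _ hlam s Ep Em) (mul_nonneg (hκ0 Ep).le (hκ0 Em).le)
  have hBr0 : ∀ s ω, 0 ≤ Br s ω := fun s ω => Finset.sum_nonneg fun Ep _ => Finset.sum_nonneg fun Em _ => by
    split_ifs <;> [exact mul_nonneg (slyCoreZ_nonneg _ _ hlam s Ep Em) (mul_nonneg (hκ0 Ep).le (hκ0 Em).le); exact le_rfl]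
  -- averages
  have hZsum : ∀ s, ∑ ω, Zr s ω = N * avgZ s := by
    intro s
    have h := sum_realisations_coreSum (n := n) lam s (k := q) (fun _ _ => True) (fun Ep Em => slyKap m D q lam Ep * slyKap m D q lam Em)
    rw [hNeq]
    simpa using h
  have hBsum : ∀ s, ∑ ω, Br s ω = N * avgB s := by
    intro s
    rw [hNeq]; exact sum_realisations_coreSum (n := n) lam s (k := q) (bad s) (fun Ep Em => slyKap m D q lam Ep * slyKap m D q lam Em)
  -- the six bad sets
  let B1 : Bool → Finset Ωt := fun s => univ.filter fun ω => N * ∑ η : Finset (Fin (m * q ^ D)) × Finset (Fin (m * q ^ D)),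
    slyCoreZ ω.1 ω.2 lam s η.1 η.2 * (slyKap m D q lam η.1 * slyKap m D q lam η.2) <
      (∑ η : Finset (Fin (m * q ^ D)) × Finset (Fin (m * q ^ D)), (∑ ω' : Ωt, slyCoreZ ω'.1 ω'.2 lam s η.1 η.2) *
        (slyKap m D q lam η.1 * slyKap m D q lam η.2)) / (2 * c)
  let B2 : Bool → Finset Ωt := fun s => univ.filter fun ω => 8 * ((∑ ω', Zr s ω') / Fintype.card Ωt) < Zr s ω
  let B3 : Bool → Finset Ωt := fun s => univ.filter fun ω => 8 * ((∑ ω', Br s ω') / Fintype.card Ωt) < Br s ω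
  have hB1 : ∀ s, 8 * ((B1 s).card : ℝ) ≤ N := fun s =>
    weighted_lowerTail_of_pointwise (fun (ω : Ωt) (η : Finset (Fin (m * q ^ D)) × Finset (Fin (m * q ^ D))) =>
      slyCoreZ ω.1 ω.2 lam s η.1 η.2) (fun ω η => slyCoreZ_nonneg _ _ hlam s η.1 η.2)
      (fun η => slyKap m D q lam η.1 * slyKap m D q lam η.2) (fun η => mul_nonneg (hκ0 η.1).le (hκ0 η.2).le) hc
      (fun η => hpt s η.1 η.2)
  have hB2 : ∀ s, 8 * ((B2 s).card : ℝ) ≤ N := fun s => card_filter_gt_eight_avg (Zr s) (hZr0 s)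
  have hB3 : ∀ s, 8 * ((B3 s).card : ℝ) ≤ N := fun s => card_filter_gt_eight_avg (Br s) (hBr0 s)
  -- union bound
  let Bs : Fin 6 → Finset Ωt := ![B1 true, B1 false, B2 true, B2 false, B3 true, B3 false]
  have hsum : ∑ i, (Bs i).card < Fintype.card Ωt := by
    have h : (∑ i, ((Bs i).card : ℝ)) ≤ 6 * N / 8 := by
      rw [Fin.sum_univ_six]
      have e0 : Bs 0 = B1 true := rfl
      have e1 : Bs 1 = B1 false := rfl
      have e2 : Bs 2 = B2 true := rfl
      have e3 : Bs 3 = B2 false := rfl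
      have e4 : Bs 4 = B3 true := rfl
      have e5 : Bs 5 = B3 false := rfl
      rw [e0, e1, e2, e3, e4, e5]
      have := hB1 true; have := hB1 false; have := hB2 true; have := hB2 false; have := hB3 true; have := hB3 false
      linarith
    have h' : (∑ i, ((Bs i).card : ℝ)) < N := by linarith
    rw [hN] at h'
    exact_mod_cast h'
  obtain ⟨ω, hω⟩ := exists_not_mem_of_card_lt Bs hsum
  refine ⟨ω, fun s => ⟨?_, ?_, ?_⟩⟩
  · -- lower tail
    have h := hω (if s then 0 else 1)
    have hmem : ω ∉ B1 s := by cases s <;> simpa [Bs] using h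
    simp only [B1, Finset.mem_filter, Finset.mem_univ, true_and, not_lt] at hmem
    -- rewrite the pointwise totals as `N * slyZphase`
    have htot : ∀ η : Finset (Fin (m * q ^ D)) × Finset (Fin (m * q ^ D)),
        (∑ ω' : Ωt, slyCoreZ ω'.1 ω'.2 lam s η.1 η.2) = N * slyZphase n (m * q ^ D) q lam s η.1.card η.2.card := by
      intro η; rw [hNeq]; exact sum_realisations_slyCoreZ lam s η.1 η.2
    simp only [htot] at hmem
    rw [Fintype.sum_prod_type, Fintype.sum_prod_type] at hmem
    have h2 : (∑ x : Finset (Fin (m * q ^ D)), ∑ y : Finset (Fin (m * q ^ D)),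
        N * slyZphase n (m * q ^ D) q lam s x.card y.card * (slyKap m D q lam x * slyKap m D q lam y)) = N * avgZ s := by
      simp only [avgZ, Finset.mul_sum]; refine Finset.sum_congr rfl fun x _ => Finset.sum_congr rfl fun y _ => by ring
    rw [h2] at hmem
    -- divide by `N`
    rw [div_le_iff₀ (by linarith)]
    rw [mul_div_assoc] at hmem
    have : N * (avgZ s / (2 * c)) ≤ N * Zr s ω := by simpa [Zr] using hmem
    have h3 := le_of_mul_le_mul_left this hNpos
    rw [div_le_iff₀ (by linarith)] at h3
    exact h3
  · have h := hω (if s then 2 else 3)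
    have hmem : ω ∉ B2 s := by cases s <;> simpa [Bs] using h
    simp only [B2, Finset.mem_filter, Finset.mem_univ, true_and, not_lt, hZsum] at hmem
    rw [← hN] at hmem
    have e : 8 * (N * avgZ s) / N = 8 * avgZ s := by field_simp
    rw [mul_div_assoc', e] at hmem
    exact hmem
  · have h := hω (if s then 4 else 5)
    have hmem : ω ∉ B3 s := by cases s <;> simpa [Bs] using h
    simp only [B3, Finset.mem_filter, Finset.mem_univ, true_and, not_lt, hBsum] at hmem
    rw [← hN] at hmem
    have e : 8 * (N * avgB s) / N = 8 * avgB s := by field_simp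
    rw [mul_div_assoc', e] at hmem
    exact hmem

end TypicalGadget

section Asymptotics

open Filter Topology

/-- `D ≥ ψ log_{Δ-1} n - 2`. [folklore] -/
theorem slyDepth_ge {Δ : ℕ} {ψ : ℝ} (hψ : 0 ≤ ψ) {n : ℕ} (hn : 1 ≤ n) (hΔ : 3 ≤ Δ) :
    ψ * Real.logb ((Δ : ℝ) - 1) n - 2 ≤ (slyDepth Δ ψ n : ℝ) := by
  have hq1 : (1 : ℝ) < (Δ : ℝ) - 1 := by
    have : (3 : ℝ) ≤ Δ := by exact_mod_cast hΔ
    linarith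
  have hL : 0 ≤ Real.logb ((Δ : ℝ) - 1) n := Real.logb_nonneg hq1 (by exact_mod_cast hn)
  rw [slyDepth_def]
  push_cast
  have hx : 0 ≤ ψ / 2 * Real.logb ((Δ : ℝ) - 1) n := mul_nonneg (by linarith) hL
  have h := Nat.lt_floor_add_one (ψ / 2 * Real.logb ((Δ : ℝ) - 1) n)
  linarith

/-- `exp(-ζ D) ≤ e^{2ζ} n^{-ζψ/log(Δ-1)}`. [folklore] -/
theorem exp_neg_mul_slyDepth_le {Δ : ℕ} (hΔ : 3 ≤ Δ) {ψ ζ : ℝ} (hψ : 0 ≤ ψ) (hζ : 0 ≤ ζ) {n : ℕ} (hn : 1 ≤ n) :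
    Real.exp (-(ζ * slyDepth Δ ψ n)) ≤
      Real.exp (2 * ζ) * (n : ℝ) ^ (-(ζ * ψ / Real.log ((Δ : ℝ) - 1))) := by
  have hn0 : (0 : ℝ) < n := by exact_mod_cast hn
  have hD := slyDepth_ge hψ hn hΔ
  rw [Real.rpow_def_of_pos hn0, ← Real.exp_add]
  apply Real.exp_le_exp.2
  have h1 : ζ * (ψ * Real.logb ((Δ : ℝ) - 1) n - 2) ≤ ζ * slyDepth Δ ψ n := mul_le_mul_of_nonneg_left hD hζ
  have h2 : Real.logb ((Δ : ℝ) - 1) n = Real.log n / Real.log ((Δ : ℝ) - 1) := rfl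
  rw [h2] at h1
  have : Real.log n * -(ζ * ψ / Real.log ((Δ : ℝ) - 1)) = -(ζ * (ψ * (Real.log n / Real.log ((Δ : ℝ) - 1)))) := by ring
  rw [this]
  linarith

/-- `exp(ζ D) ≥ e^{-2ζ} n^{ζψ/log(Δ-1)}`. [folklore] -/
theorem le_exp_mul_slyDepth {Δ : ℕ} (hΔ : 3 ≤ Δ) {ψ ζ : ℝ} (hψ : 0 ≤ ψ) (hζ : 0 ≤ ζ) {n : ℕ} (hn : 1 ≤ n) :
    Real.exp (-(2 * ζ)) * (n : ℝ) ^ (ζ * ψ / Real.log ((Δ : ℝ) - 1)) ≤ Real.exp (ζ * slyDepth Δ ψ n) := by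
  have hn0 : (0 : ℝ) < n := by exact_mod_cast hn
  have hD := slyDepth_ge hψ hn hΔ
  rw [Real.rpow_def_of_pos hn0, ← Real.exp_add]
  apply Real.exp_le_exp.2
  have h1 : ζ * (ψ * Real.logb ((Δ : ℝ) - 1) n - 2) ≤ ζ * slyDepth Δ ψ n := mul_le_mul_of_nonneg_left hD hζ
  have h2 : Real.logb ((Δ : ℝ) - 1) n = Real.log n / Real.log ((Δ : ℝ) - 1) := rfl
  rw [h2] at h1
  have : Real.log n * (ζ * ψ / Real.log ((Δ : ℝ) - 1)) = ζ * (ψ * (Real.log n / Real.log ((Δ : ℝ) - 1))) := by ring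
  rw [this]
  linarith

/-- The tree depth tends to infinity. [folklore] -/
theorem eventually_le_slyDepth {Δ : ℕ} (hΔ : 3 ≤ Δ) {ψ : ℝ} (hψ : 0 < ψ) (ℓ₀ : ℕ) :
    ∀ᶠ n : ℕ in atTop, ℓ₀ ≤ slyDepth Δ ψ n := by
  have hq1 : (1 : ℝ) < (Δ : ℝ) - 1 := by
    have : (3 : ℝ) ≤ Δ := by exact_mod_cast hΔ
    linarith
  -- `logb (Δ-1) n → ∞`
  have hlog : Tendsto (fun n : ℕ => Real.logb ((Δ : ℝ) - 1) n) atTop atTop :=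
    (Real.tendsto_logb_atTop hq1).comp tendsto_natCast_atTop_atTop
  have hev := hlog.eventually (eventually_ge_atTop (((ℓ₀ : ℝ) + 2) / ψ))
  filter_upwards [hev, eventually_ge_atTop 1] with n hn hn1
  have hD := slyDepth_ge hψ.le hn1 hΔ
  have : (ℓ₀ : ℝ) + 2 ≤ ψ * Real.logb ((Δ : ℝ) - 1) n := by
    rw [div_le_iff₀ hψ] at hn; linarith
  have : (ℓ₀ : ℝ) ≤ slyDepth Δ ψ n := by linarith
  exact_mod_cast this

/-- `(1+y)^k - 1 ≤ 2ky` for `0 ≤ ky ≤ 1`, `y ≥ 0`. [folklore] -/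
theorem one_add_pow_sub_one_le {y : ℝ} (hy : 0 ≤ y) (k : ℕ) (hky : k * y ≤ 1) :
    (1 + y) ^ k - 1 ≤ 2 * (k * y) := by
  have h1 : (1 + y) ^ k ≤ Real.exp (k * y) := by
    calc (1 + y) ^ k ≤ (Real.exp y) ^ k := by
          apply pow_le_pow_left₀ (by linarith)
          have := Real.add_one_le_exp y; linarith
      _ = Real.exp (k * y) := by rw [← Real.exp_nat_mul]
  have h2 : Real.exp (k * y) ≤ 1 + 2 * (k * y) := by
    have h := Real.exp_bound' (mul_nonneg (Nat.cast_nonneg k) hy) hky (n := 1) one_pos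
    simp at h
    linarith
  linarith

/-- **The reweighting error is small**: with `m = slyM Δ θ n ≤ n^θ`, `t ≤ C₁ n^{-c₁}` and `3θ < c₁`,
eventually `(1 + t/p)^{2m} - 1 ≤ n^{-2θ}/2`. [cite: Sly2010, §4.1 (eq. (e:thetaB): "`(1 - |V| n^{-(…)})` … `≤ n^{-3θ}`")] -/
theorem eventually_reweight_small {Δ : ℕ} (hΔ : 3 ≤ Δ) {θ c₁ C₁ p : ℝ} (hθ : 0 < θ) (hθc : 3 * θ < c₁)
    (hC₁ : 0 < C₁) (hp : 0 < p) :
    ∀ᶠ n : ℕ in atTop, ∀ t : ℝ, 0 ≤ t → t ≤ C₁ * (n : ℝ) ^ (-c₁) →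
      (1 + t / p) ^ (2 * slyM Δ θ n) - 1 ≤ (n : ℝ) ^ (-(2 * θ)) / 2 := by
  -- eventually `n^{3θ - c₁} ≤ p / (8 C₁)`
  have hneg : 3 * θ - c₁ < 0 := by linarith
  have hev : ∀ᶠ n : ℕ in atTop, (n : ℝ) ^ (3 * θ - c₁) ≤ p / (8 * C₁) := by
    have h := ((tendsto_rpow_neg_atTop (by linarith : 0 < -(3 * θ - c₁))).comp tendsto_natCast_atTop_atTop).eventually
      (eventually_le_nhds (show (0 : ℝ) < p / (8 * C₁) by positivity))
    filter_upwards [h] with n hn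
    simpa [neg_neg] using hn
  filter_upwards [hev, eventually_ge_atTop 1] with n hn hn1 t ht0 ht
  have hn0 : (0 : ℝ) < n := by exact_mod_cast hn1
  have hm : (slyM Δ θ n : ℝ) ≤ (n : ℝ) ^ θ := slyM_le_rpow hΔ hθ.le hn1
  -- `k y ≤ 2 n^θ C₁ n^{-c₁} / p = (2C₁/p) n^{θ - c₁} ≤ (2 C₁ / p) n^{3θ - c₁} n^{-2θ} ≤ n^{-2θ}/4 ≤ 1`
  have hy0 : 0 ≤ t / p := div_nonneg ht0 hp.le
  have hky : ((2 * slyM Δ θ n : ℕ) : ℝ) * (t / p) ≤ (n : ℝ) ^ (-(2 * θ)) / 4 := by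
    push_cast
    have h1 : (2 * (slyM Δ θ n : ℝ)) * (t / p) ≤ 2 * (n : ℝ) ^ θ * (C₁ * (n : ℝ) ^ (-c₁) / p) := by
      have : t / p ≤ C₁ * (n : ℝ) ^ (-c₁) / p := div_le_div_of_nonneg_right ht hp.le
      exact mul_le_mul (by linarith) this hy0 (by positivity)
    have h2 : 2 * (n : ℝ) ^ θ * (C₁ * (n : ℝ) ^ (-c₁) / p) = (2 * C₁ / p) * ((n : ℝ) ^ (3 * θ - c₁) * (n : ℝ) ^ (-(2 * θ))) := by
      rw [← Real.rpow_add hn0, show 3 * θ - c₁ + -(2 * θ) = θ + -c₁ by ring, Real.rpow_add hn0]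
      field_simp
    rw [h2] at h1
    have h3 : (2 * C₁ / p) * ((n : ℝ) ^ (3 * θ - c₁) * (n : ℝ) ^ (-(2 * θ))) ≤ (2 * C₁ / p) * (p / (8 * C₁) * (n : ℝ) ^ (-(2 * θ))) :=
      mul_le_mul_of_nonneg_left (mul_le_mul_of_nonneg_right hn (by positivity)) (by positivity)
    have h4 : (2 * C₁ / p) * (p / (8 * C₁) * (n : ℝ) ^ (-(2 * θ))) = (n : ℝ) ^ (-(2 * θ)) / 4 := by
      field_simp; ring
    linarith
  have hn2θ : (n : ℝ) ^ (-(2 * θ)) ≤ 1 := Real.rpow_le_one_of_one_le_of_nonpos (by exact_mod_cast hn1) (by linarith)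
  have hky1 : ((2 * slyM Δ θ n : ℕ) : ℝ) * (t / p) ≤ 1 := by linarith
  have h := one_add_pow_sub_one_le hy0 (2 * slyM Δ θ n) hky1
  linarith

/-- **The bad-mass term is small**: with `m = slyM Δ θ n ≤ n^θ`, `τ ≤ exp(-K n^{c₂})`, `θ < c₂`,
eventually `96 √n m τ / p^{2m} ≤ n^{-2θ}/2`. [cite: Sly2010, §4.1 (eq. (e:expectedBSmall): "`≤ exp(-n^{2θ})`")] -/
theorem eventually_badterm_small {Δ : ℕ} (hΔ : 3 ≤ Δ) {θ c₂ K p : ℝ} (hθ : 0 < θ) (hθc : θ < c₂) (hK : 0 < K)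
    (hp : 0 < p) (hp1 : p ≤ 1) :
    ∀ᶠ n : ℕ in atTop, ∀ τ : ℝ, 0 ≤ τ → τ ≤ Real.exp (-(K * (n : ℝ) ^ c₂)) →
      16 * Real.sqrt n * ((slyM Δ θ n : ℝ) * (2 * τ)) * 3 / p ^ (2 * slyM Δ θ n) ≤ (n : ℝ) ^ (-(2 * θ)) / 2 := by
  set L := -Real.log p with hL
  have hL0 : 0 ≤ L := by rw [hL]; linarith [Real.log_nonpos hp.le hp1]
  have hc₂ : 0 < c₂ := hθ.trans hθc
  -- (i) `(2L+1) n^θ ≤ (K/3) n^{c₂}` eventually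
  have ev1 : ∀ᶠ n : ℕ in atTop, (2 * L + 1) * (n : ℝ) ^ θ ≤ K / 3 * (n : ℝ) ^ c₂ := by
    have h := ((tendsto_rpow_neg_atTop (by linarith : 0 < c₂ - θ)).comp tendsto_natCast_atTop_atTop).eventually
      (eventually_le_nhds (show (0 : ℝ) < K / 3 / (2 * L + 1) by positivity))
    filter_upwards [h, eventually_ge_atTop 1] with n hn hn1
    have hn0 : (0 : ℝ) < n := by exact_mod_cast hn1
    simp only [Function.comp] at hn
    rw [le_div_iff₀ (by positivity)] at hn
    calc (2 * L + 1) * (n : ℝ) ^ θ = ((n : ℝ) ^ (-(c₂ - θ)) * (2 * L + 1)) * (n : ℝ) ^ c₂ := by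
          rw [mul_comm ((n : ℝ) ^ (-(c₂ - θ))), mul_assoc, ← Real.rpow_add hn0]; ring_nf
      _ ≤ K / 3 * (n : ℝ) ^ c₂ := mul_le_mul_of_nonneg_right hn (by positivity)
  -- (ii) `(1/2 + 3θ) log n + log 192 ≤ (K/3) n^{c₂}` eventually
  have ev2 : ∀ᶠ n : ℕ in atTop, (1 / 2 + 3 * θ) * Real.log n + Real.log 192 ≤ K / 3 * (n : ℝ) ^ c₂ := by
    have h := (isLittleO_log_rpow_atTop hc₂).def (show (0 : ℝ) < K / 6 / (1 / 2 + 3 * θ) by positivity)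
    have h' := tendsto_natCast_atTop_atTop (R := ℝ) |>.eventually h
    have h2 := ((tendsto_rpow_atTop hc₂).comp tendsto_natCast_atTop_atTop).eventually (eventually_ge_atTop (Real.log 192 / (K / 6)))
    filter_upwards [h', h2, eventually_ge_atTop 1] with n hn hn2 hn1
    have hlog0 : (0 : ℝ) ≤ Real.log n := Real.log_nonneg (by exact_mod_cast hn1)
    rw [Real.norm_of_nonneg hlog0, Real.norm_of_nonneg (by positivity)] at hn
    simp only [Function.comp] at hn2
    rw [div_le_iff₀ (by positivity)] at hn2
    have h3 : (1 / 2 + 3 * θ) * Real.log n ≤ K / 6 * (n : ℝ) ^ c₂ := by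
      have := mul_le_mul_of_nonneg_left hn (show (0 : ℝ) ≤ 1 / 2 + 3 * θ by positivity)
      calc (1 / 2 + 3 * θ) * Real.log n ≤ (1 / 2 + 3 * θ) * (K / 6 / (1 / 2 + 3 * θ) * (n : ℝ) ^ c₂) := this
        _ = K / 6 * (n : ℝ) ^ c₂ := by field_simp
    linarith
  filter_upwards [ev1, ev2, eventually_ge_atTop 1] with n h1 h2 hn1 τ hτ0 hτ
  have hn0 : (0 : ℝ) < n := by exact_mod_cast hn1
  have hm : (slyM Δ θ n : ℝ) ≤ (n : ℝ) ^ θ := slyM_le_rpow hΔ hθ.le hn1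
  have hm0 : (0 : ℝ) ≤ slyM Δ θ n := Nat.cast_nonneg _
  -- `1/p^{2m} ≤ exp(2 L n^θ)`
  have hpow : (1 : ℝ) / p ^ (2 * slyM Δ θ n) ≤ Real.exp (2 * L * (n : ℝ) ^ θ) := by
    have e : p ^ (2 * slyM Δ θ n) = Real.exp (((2 * slyM Δ θ n : ℕ) : ℝ) * Real.log p) := by
      rw [← Real.exp_log hp, ← Real.exp_nat_mul, Real.log_exp]
    rw [e, one_div, ← Real.exp_neg]
    apply Real.exp_le_exp.2
    push_cast
    rw [hL]
    nlinarith [mul_le_mul_of_nonneg_left hm hL0]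
  have hsqrt : Real.sqrt n = (n : ℝ) ^ (1 / 2 : ℝ) := Real.sqrt_eq_rpow _
  -- main estimate
  have hexp : (192 : ℝ) * (n : ℝ) ^ (1 / 2 + 3 * θ) * (Real.exp (-(K * (n : ℝ) ^ c₂)) * Real.exp (2 * L * (n : ℝ) ^ θ)) ≤ 1 := by
    have e1 : (192 : ℝ) = Real.exp (Real.log 192) := (Real.exp_log (by norm_num)).symm
    have e2 : (n : ℝ) ^ (1 / 2 + 3 * θ) = Real.exp ((1 / 2 + 3 * θ) * Real.log n) := by
      rw [Real.rpow_def_of_pos hn0]; ring_nf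
    rw [e1, e2, ← Real.exp_add, ← Real.exp_add, ← Real.exp_add]
    apply Real.exp_le_one_iff.2
    have : 2 * L * (n : ℝ) ^ θ ≤ K / 3 * (n : ℝ) ^ c₂ := by
      have : 2 * L * (n : ℝ) ^ θ ≤ (2 * L + 1) * (n : ℝ) ^ θ := by nlinarith [Real.rpow_nonneg hn0.le θ]
      linarith
    have hKn : 0 ≤ K * (n : ℝ) ^ c₂ := by positivity
    linarith
  -- put together
  have hτexp : τ ≤ Real.exp (-(K * (n : ℝ) ^ c₂)) := hτ
  calc 16 * Real.sqrt n * ((slyM Δ θ n : ℝ) * (2 * τ)) * 3 / p ^ (2 * slyM Δ θ n)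
      = 96 * Real.sqrt n * (slyM Δ θ n : ℝ) * τ * (1 / p ^ (2 * slyM Δ θ n)) := by ring
    _ ≤ 96 * (n : ℝ) ^ (1 / 2 : ℝ) * (n : ℝ) ^ θ * Real.exp (-(K * (n : ℝ) ^ c₂)) * Real.exp (2 * L * (n : ℝ) ^ θ) := by
        rw [hsqrt]
        have h96 : (0 : ℝ) ≤ 96 * (n : ℝ) ^ (1 / 2 : ℝ) := by positivity
        exact mul_le_mul (mul_le_mul (mul_le_mul_of_nonneg_left hm h96) hτexp hτ0 (by positivity)) hpow
          (by positivity) (by positivity)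
    _ = (192 * (n : ℝ) ^ (1 / 2 + 3 * θ) * (Real.exp (-(K * (n : ℝ) ^ c₂)) * Real.exp (2 * L * (n : ℝ) ^ θ))) *
          ((n : ℝ) ^ (-(2 * θ)) / 2) := by
        rw [show (1 / 2 + 3 * θ : ℝ) = 1 / 2 + θ + 2 * θ by ring, Real.rpow_add hn0, Real.rpow_add hn0,
          Real.rpow_neg hn0.le]
        have : (n : ℝ) ^ (2 * θ) ≠ 0 := (Real.rpow_pos_of_pos hn0 _).ne'
        field_simp
        ring
    _ ≤ 1 * ((n : ℝ) ^ (-(2 * θ)) / 2) := mul_le_mul_of_nonneg_right hexp (by positivity)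
    _ = (n : ℝ) ^ (-(2 * θ)) / 2 := one_mul _

/-- `1 + 96 √n ≤ n` eventually. [folklore] -/
theorem eventually_sqrt_bound : ∀ᶠ n : ℕ in atTop, 1 + 96 * Real.sqrt n ≤ (n : ℝ) := by
  filter_upwards [eventually_ge_atTop (100 ^ 2)] with n hn
  have hn' : (100 : ℝ) ≤ Real.sqrt n := by
    rw [show (100 : ℝ) = Real.sqrt (100 ^ 2) by rw [Real.sqrt_sq (by norm_num)]]
    exact Real.sqrt_le_sqrt (by exact_mod_cast hn)
  have hsq : Real.sqrt n * Real.sqrt n = n := Real.mul_self_sqrt (Nat.cast_nonneg n)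
  nlinarith

end Asymptotics
section AssemblyHelpers

variable {n m D q : ℕ}

/-- `E Z^{s}_{G̃} ≥ 0`. [folklore] -/
theorem slyTot_nonneg (n m' k : ℕ) {lam : ℝ} (hlam : 0 ≤ lam) (s : Bool) : 0 ≤ slyTot n m' k lam s :=
  Finset.sum_nonneg fun _ _ => Finset.sum_nonneg fun _ _ =>
    mul_nonneg (mul_nonneg (Nat.cast_nonneg _) (Nat.cast_nonneg _)) (slyZphase_nonneg n m' k hlam s _ _)

open scoped Classical in
/-- `(GpropA)` from the comparison of the two phases: if `Z_G(Y = ¬s) ≤ R Z_G(Y = s)` for both `s` and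
`1 + R ≤ n`, then both phases have probability at least `1/n`. [cite: Sly2010, Theorem 2.1 (GpropA)] -/
theorem slyPropA_of_ratio (σ : Fin q → Equiv.Perm (Fin (n + m * q ^ D))) (τ : Equiv.Perm (Fin n)) {lam R : ℝ}
    (hlam : 0 ≤ lam) {N : ℕ} (hN : 0 < N) (hR : 1 + R ≤ N)
    (h : ∀ s : Bool, hardcoreZOn (slyGadgetFin n m D q σ τ) lam (fun I => slyPhase (slyWPlus n m D q) (slyWMinus n m D q) I = !s) ≤
      R * hardcoreZOn (slyGadgetFin n m D q σ τ) lam (fun I => slyPhase (slyWPlus n m D q) (slyWMinus n m D q) I = s)) :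
    SlyPropA (slyGadgetFin n m D q σ τ) lam (slyWPlus n m D q) (slyWMinus n m D q) N := by
  have hN' : (0 : ℝ) < N := by exact_mod_cast hN
  have key : ∀ s : Bool, independencePolynomial (slyGadgetFin n m D q σ τ) lam / N ≤
      hardcoreZOn (slyGadgetFin n m D q σ τ) lam (fun I => slyPhase (slyWPlus n m D q) (slyWMinus n m D q) I = s) := by
    intro s
    have hZs := hardcoreZOn_nonneg (slyGadgetFin n m D q σ τ) hlam
      (fun I => slyPhase (slyWPlus n m D q) (slyWMinus n m D q) I = s)
    have htot : independencePolynomial (slyGadgetFin n m D q σ τ) lam =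
        hardcoreZOn (slyGadgetFin n m D q σ τ) lam (fun I => slyPhase (slyWPlus n m D q) (slyWMinus n m D q) I = s) +
        hardcoreZOn (slyGadgetFin n m D q σ τ) lam (fun I => slyPhase (slyWPlus n m D q) (slyWMinus n m D q) I = !s) := by
      rw [independencePolynomial_eq_phases]
      cases s
      · exact add_comm _ _
      · rfl
    rw [div_le_iff₀ hN', htot]
    have := h s
    nlinarith
  exact ⟨key true, key false⟩

/-- Monotonicity of tails in the threshold. [folklore] -/
theorem sum_ite_lt_le_sum_ite_le {ι : Type*} (s : Finset ι) (g f : ι → ℝ) (hf : ∀ i ∈ s, 0 ≤ f i) {t t' : ℝ} (htt : t' ≤ t) :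
    (∑ i ∈ s, if t < g i then f i else 0) ≤ ∑ i ∈ s, if t' ≤ g i then f i else 0 := by
  classical
  refine Finset.sum_le_sum fun i hi => ?_
  by_cases h : t < g i
  · rw [if_pos h, if_pos (by linarith)]
  · rw [if_neg h]; split_ifs <;> [exact hf i hi; exact le_rfl]

/-- `m q^D ≤ n^{θ+ψ}`. [folklore] -/
theorem slyM_mul_pow_le {Δ : ℕ} (hΔ : 3 ≤ Δ) {θ ψ : ℝ} (hθ : 0 ≤ θ) (hψ : 0 ≤ ψ) {n : ℕ} (hn : 1 ≤ n) :
    ((slyM Δ θ n * (Δ - 1) ^ slyDepth Δ ψ n : ℕ) : ℝ) ≤ (n : ℝ) ^ (θ + ψ) := by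
  have hn0 : (0 : ℝ) < n := by exact_mod_cast hn
  rw [Nat.cast_mul, Real.rpow_add hn0]
  exact mul_le_mul (slyM_le_rpow hΔ hθ hn) (pow_slyDepth_le_rpow hΔ hψ hn) (by positivity) (by positivity)

/-- `slyDepth` is even. [folklore] -/
theorem even_slyDepth (Δ : ℕ) (ψ : ℝ) (n : ℕ) : Even (slyDepth Δ ψ n) := by
  rw [slyDepth_def]; exact even_two_mul _

end AssemblyHelpers




section FinalAssembly

open Filter Topology

/-- Flipping a negated indicator inside a double sum. [folklore] -/
theorem sum_sum_ite_not {α β : Type*} [Fintype α] [Fintype β] (P : α → β → Prop) [∀ a b, Decidable (P a b)]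
    [∀ a b, Decidable (¬P a b)] (f : α → β → ℝ) :
    (∑ a, ∑ b, if ¬P a b then f a b else 0) = ∑ a, ∑ b, if P a b then 0 else f a b :=
  Finset.sum_congr rfl fun a _ => Finset.sum_congr rfl fun b _ => by
    by_cases h : P a b
    · rw [if_neg (not_not.2 h), if_pos h]
    · rw [if_pos h, if_neg h]

/-- `bad_mass_expect_le` in the `slyQw`/`slyKap` vocabulary. [cite: Sly2010, §4.1 (eq. (e:ProbBadB))] -/
theorem bad_mass_expect_le' {m D q : ℕ} {lam : ℝ} (hlam : 0 ≤ lam) {a b t τa τb : ℝ}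
    (ha0 : 0 < a) (ha1 : a < 1) (hb0 : 0 < b) (hb1 : b < 1)
    (htail_a : (∑ A : Fin (q ^ D) → Bool, if t < |hcTreeX q lam D A - a| then
        (a / (1 - a)) ^ hcLeafCount A * hcTreeZtot q lam D A else 0) ≤
      τa * ∑ A : Fin (q ^ D) → Bool, (a / (1 - a)) ^ hcLeafCount A * hcTreeZtot q lam D A)
    (htail_b : (∑ A : Fin (q ^ D) → Bool, if t < |hcTreeX q lam D A - b| then
        (b / (1 - b)) ^ hcLeafCount A * hcTreeZtot q lam D A else 0) ≤
      τb * ∑ A : Fin (q ^ D) → Bool, (b / (1 - b)) ^ hcLeafCount A * hcTreeZtot q lam D A) :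
    (∑ Ep : Finset (Fin (m * q ^ D)), ∑ Em : Finset (Fin (m * q ^ D)),
      if SlyGoodCfg m D q lam a b t Ep Em then (0 : ℝ)
      else slyQw (m * q ^ D) a b Ep.card Em.card * (slyKap m D q lam Ep * slyKap m D q lam Em)) ≤
    m * (τa + τb) * ∑ Ep : Finset (Fin (m * q ^ D)), ∑ Em : Finset (Fin (m * q ^ D)),
      slyQw (m * q ^ D) a b Ep.card Em.card * (slyKap m D q lam Ep * slyKap m D q lam Em) :=
  bad_mass_expect_le hlam ha0 ha1 hb0 hb1 htail_a htail_b

open scoped Classical in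
/-- **One gadget from the per-`n` facts** (the inner step of Sly's proof of Theorem 2.1): given the
Lemma 3.3 estimates at `(n, m')`, the single-tree tails at depth `D` (threshold `t ≤ p`, mass `τ`),
the pointwise lower tail of Theorem 3.10 at `(n, m')`, and the numerical facts
`(1+t/p)^{2m} - 1 ≤ n^{-2θ}/2`, `96 √n m τ / p^{2m} ≤ n^{-2θ}/2`, `1 + 96√n ≤ n`, `#V ≤ 3n`, some
realisation of the gadget has all the properties required in `slyGadgetReduction_of_gadgetsAt`.
[cite: Sly2010, Theorem 2.1 (proof, §4.1)] -/
theorem slyGadgetAt_of_facts {q : ℕ} (hq2 : 2 ≤ q) {lam qp qm : ℝ} (hlam0 : 0 < lam) (hqm : 0 < qm)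
    (hqlt : qm < qp) (hqp1 : qp < 1) {n : ℕ} (hn1 : 1 ≤ n) {θ : ℝ} (D : ℕ) {t τ : ℝ} (ht0 : 0 ≤ t)
    (htp : t ≤ min qm (1 - qp)) (hτ0 : 0 ≤ τ)
    (h33i : |slyTot n (slyM (q + 1) θ n * q ^ D) q lam true - slyTot n (slyM (q + 1) θ n * q ^ D) q lam false| ≤
      1 / 2 * slyTot n (slyM (q + 1) θ n * q ^ D) q lam false)
    (h33ii : ∀ (s : Bool) (ep em : ℕ), ep ≤ slyM (q + 1) θ n * q ^ D → em ≤ slyM (q + 1) θ n * q ^ D →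
      |slyZphase n (slyM (q + 1) θ n * q ^ D) q lam s ep em -
          slyQw (slyM (q + 1) θ n * q ^ D) (slyPa qp qm s) (slyPb qp qm s) ep em * slyTot n (slyM (q + 1) θ n * q ^ D) q lam s| ≤
        1 / 2 * (slyQw (slyM (q + 1) θ n * q ^ D) (slyPa qp qm s) (slyPb qp qm s) ep em * slyTot n (slyM (q + 1) θ n * q ^ D) q lam s))
    (htail_qp : (∑ A : Fin (q ^ D) → Bool, if t < |hcTreeX q lam D A - qp| then
        (qp / (1 - qp)) ^ hcLeafCount A * hcTreeZtot q lam D A else 0) ≤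
      τ * ∑ A : Fin (q ^ D) → Bool, (qp / (1 - qp)) ^ hcLeafCount A * hcTreeZtot q lam D A)
    (htail_qm : (∑ A : Fin (q ^ D) → Bool, if t < |hcTreeX q lam D A - qm| then
        (qm / (1 - qm)) ^ hcLeafCount A * hcTreeZtot q lam D A else 0) ≤
      τ * ∑ A : Fin (q ^ D) → Bool, (qm / (1 - qm)) ^ hcLeafCount A * hcTreeZtot q lam D A)
    (hpt : ∀ (s : Bool) (Ep Em : Finset (Fin (slyM (q + 1) θ n * q ^ D))),
      16 * ((univ.filter fun ω : (Fin q → Equiv.Perm (Fin (n + slyM (q + 1) θ n * q ^ D))) × Equiv.Perm (Fin n) =>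
        (Fintype.card ((Fin q → Equiv.Perm (Fin (n + slyM (q + 1) θ n * q ^ D))) × Equiv.Perm (Fin n)) : ℝ) *
            slyCoreZ ω.1 ω.2 lam s Ep Em <
          (∑ ω' : (Fin q → Equiv.Perm (Fin (n + slyM (q + 1) θ n * q ^ D))) × Equiv.Perm (Fin n),
            slyCoreZ ω'.1 ω'.2 lam s Ep Em) / Real.sqrt n).card : ℝ) ≤
        Fintype.card ((Fin q → Equiv.Perm (Fin (n + slyM (q + 1) θ n * q ^ D))) × Equiv.Perm (Fin n)))
    (e1 : (1 + t / min qm (1 - qp)) ^ (2 * slyM (q + 1) θ n) - 1 ≤ (n : ℝ) ^ (-(2 * θ)) / 2)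
    (e2 : 16 * Real.sqrt n * ((slyM (q + 1) θ n : ℝ) * (2 * τ)) * 3 / (min qm (1 - qp)) ^ (2 * slyM (q + 1) θ n) ≤
      (n : ℝ) ^ (-(2 * θ)) / 2)
    (e4 : 1 + 96 * Real.sqrt n ≤ (n : ℝ))
    (e5 : ((2 * n + 2 * ((D + 1) * (slyM (q + 1) θ n * q ^ D)) : ℕ) : ℝ) ≤ 3 * n) :
    ∃ (v : ℕ) (G : SimpleGraph (Fin v)) (Wp Wm : Finset (Fin v)) (Vp Vm : Fin (slyM (q + 1) θ n) ↪ Fin v),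
      (v : ℝ) ≤ 3 * n ∧ G.maxDegree ≤ q + 1 ∧ Disjoint Wp Wm ∧ Disjoint (Set.range Vp) (Set.range Vm) ∧
        (∀ i, G.degree (Vp i) ≤ q) ∧ (∀ i, G.degree (Vm i) ≤ q) ∧
        SlyPropA G lam Wp Wm n ∧ SlyPropB G lam Wp Wm Vp Vm qp qm ((n : ℝ) ^ (-(2 * θ))) := by
  have hq0 : 0 < q := by omega
  have hn0 : (0 : ℝ) < n := by exact_mod_cast hn1
  have hc : 0 < Real.sqrt n := Real.sqrt_pos.2 hn0
  -- D1 for both phases, `ρ = m (τ + τ)`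
  have hD1 : ∀ s : Bool, (∑ Ep : Finset (Fin (slyM (q + 1) θ n * q ^ D)), ∑ Em : Finset (Fin (slyM (q + 1) θ n * q ^ D)),
      if SlyGoodCfg (slyM (q + 1) θ n) D q lam (slyPa qp qm s) (slyPb qp qm s) t Ep Em then (0 : ℝ)
      else slyQw (slyM (q + 1) θ n * q ^ D) (slyPa qp qm s) (slyPb qp qm s) Ep.card Em.card *
        (slyKap (slyM (q + 1) θ n) D q lam Ep * slyKap (slyM (q + 1) θ n) D q lam Em)) ≤
      ((slyM (q + 1) θ n : ℕ) : ℝ) * (τ + τ) * ∑ Ep : Finset (Fin (slyM (q + 1) θ n * q ^ D)), ∑ Em : Finset (Fin (slyM (q + 1) θ n * q ^ D)),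
        slyQw (slyM (q + 1) θ n * q ^ D) (slyPa qp qm s) (slyPb qp qm s) Ep.card Em.card *
          (slyKap (slyM (q + 1) θ n) D q lam Ep * slyKap (slyM (q + 1) θ n) D q lam Em) := by
    intro s
    cases s
    · simp only [slyPa, slyPb, Bool.false_eq_true, if_false]
      exact bad_mass_expect_le' hlam0.le hqm (hqlt.trans hqp1) (hqm.trans hqlt) hqp1 htail_qm htail_qp
    · simp only [slyPa, slyPb, if_true]
      exact bad_mass_expect_le' hlam0.le (hqm.trans hqlt) hqp1 hqm (hqlt.trans hqp1) htail_qp htail_qm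
  -- a typical realisation
  obtain ⟨ω, hω⟩ := exists_typical_realisation (n := n) (m := slyM (q + 1) θ n) (D := D) (q := q) lam hlam0.le hc
    (fun s Ep Em => ¬SlyGoodCfg (slyM (q + 1) θ n) D q lam (slyPa qp qm s) (slyPb qp qm s) t Ep Em) hpt
  -- the per-realisation conclusions
  have hT : ∀ s, 0 ≤ slyTot n (slyM (q + 1) θ n * q ^ D) q lam s := fun s => slyTot_nonneg _ _ _ hlam0.le s
  have hTT : ∀ s : Bool, slyTot n (slyM (q + 1) θ n * q ^ D) q lam (!s) ≤ 2 * slyTot n (slyM (q + 1) θ n * q ^ D) q lam s := by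
    have h := abs_le.1 h33i
    have h1 := hT true
    have h2 := hT false
    intro s; cases s
    · simp only [Bool.not_false]; linarith
    · simp only [Bool.not_true]; linarith
  have hρ0 : (0 : ℝ) ≤ ((slyM (q + 1) θ n : ℕ) : ℝ) * (τ + τ) := mul_nonneg (Nat.cast_nonneg _) (by linarith)
  obtain ⟨hB, hA⟩ := sly_gadgetProps_of_typical ω.1 ω.2 hlam0.le hqm hqlt hqp1 ht0 htp (by norm_num : (0 : ℝ) ≤ 1 / 2)
    (by norm_num : (1 / 2 : ℝ) < 1) hρ0 hc (fun s => slyTot n (slyM (q + 1) θ n * q ^ D) q lam s) hT hTT h33ii hD1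
    (fun s => (hω s).1) (fun s => (hω s).2.1) (fun s => by
      have h3 := (hω s).2.2
      refine le_trans (le_of_eq ?_) (h3.trans (le_of_eq ?_))
      · refine Finset.sum_congr rfl fun Ep _ => Finset.sum_congr rfl fun Em _ => ?_
        by_cases h : SlyGoodCfg (slyM (q + 1) θ n) D q lam (slyPa qp qm s) (slyPb qp qm s) t Ep Em
        · rw [if_pos h, if_neg (not_not.2 h)]
        · rw [if_neg h, if_pos h]
      · congr 1
        refine Finset.sum_congr rfl fun Ep _ => Finset.sum_congr rfl fun Em _ => ?_
        by_cases h : SlyGoodCfg (slyM (q + 1) θ n) D q lam (slyPa qp qm s) (slyPb qp qm s) t Ep Em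
        · rw [if_pos h, if_neg (not_not.2 h)]
        · rw [if_neg h, if_pos h])
  -- (GpropB) with `δ = n^{-2θ}`
  have hδ : (1 + t / min qm (1 - qp)) ^ (2 * slyM (q + 1) θ n) - 1 +
      16 * Real.sqrt n * (((slyM (q + 1) θ n : ℕ) : ℝ) * (τ + τ)) * ((1 + 1 / 2) / (1 - 1 / 2)) /
        (min qm (1 - qp)) ^ (2 * slyM (q + 1) θ n) ≤ (n : ℝ) ^ (-(2 * θ)) := by
    have e : 16 * Real.sqrt n * (((slyM (q + 1) θ n : ℕ) : ℝ) * (τ + τ)) * ((1 + 1 / 2) / (1 - 1 / 2)) /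
        (min qm (1 - qp)) ^ (2 * slyM (q + 1) θ n) =
        16 * Real.sqrt n * ((slyM (q + 1) θ n : ℝ) * (2 * τ)) * 3 / (min qm (1 - qp)) ^ (2 * slyM (q + 1) θ n) := by
      ring
    rw [e]
    linarith
  have hPropB := SlyPropB.mono hlam0.le hqm.le (hqlt.le.trans hqp1.le) (hqm.le.trans hqlt.le) hqp1.le hδ hB
  -- (GpropA)
  have hR : 1 + 32 * Real.sqrt n * ((1 + 1 / 2) / (1 - 1 / 2)) ≤ ((n : ℕ) : ℝ) := by
    have : 32 * Real.sqrt n * ((1 + 1 / 2) / (1 - 1 / 2)) = 96 * Real.sqrt n := by ring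
    rw [this]; exact e4
  have hPropA := slyPropA_of_ratio ω.1 ω.2 hlam0.le (N := n) hn1 hR hA
  -- packaging
  refine ⟨Fintype.card (SlyV n (slyM (q + 1) θ n) D q), slyGadgetFin n (slyM (q + 1) θ n) D q ω.1 ω.2,
    slyWPlus n (slyM (q + 1) θ n) D q, slyWMinus n (slyM (q + 1) θ n) D q,
    slyPortPlus n (slyM (q + 1) θ n) D q, slyPortMinus n (slyM (q + 1) θ n) D q, ?_, ?_,
    disjoint_slyW n (slyM (q + 1) θ n) D q, disjoint_slyPort n (slyM (q + 1) θ n) D q,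
    fun i => ?_, fun i => ?_, hPropA, hPropB⟩
  · have h := card_slyV_le hq0 n (slyM (q + 1) θ n) D
    calc (Fintype.card (SlyV n (slyM (q + 1) θ n) D q) : ℝ)
        ≤ ((2 * n + 2 * ((D + 1) * (slyM (q + 1) θ n * q ^ D)) : ℕ) : ℝ) := by exact_mod_cast h
      _ ≤ 3 * n := e5
  · exact slyGadgetFin_maxDegree_le n (slyM (q + 1) θ n) D q ω.1 ω.2 hq0
  · exact slyGadgetFin_degree_portPlus n (slyM (q + 1) θ n) D q ω.1 ω.2 hq0 i
  · exact slyGadgetFin_degree_portMinus n (slyM (q + 1) θ n) D q ω.1 ω.2 hq0 i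

end FinalAssembly


section FinalAssembly2

open Filter Topology

open scoped Classical in
/-- **Sly's Theorem 2.1, derandomised, from its two probabilistic inputs.** For `d = q + 1 ≥ 3` and
`λ > λ_c(𝕋_d)`, assume
* `H42` — the reconstruction tail of Lemma 4.2 for the `q`-ary tree at the two fugacities
  `w = q^{±}/(1-q^{±})` of the two-cycle `(q⁺, q⁻)` of `φ`, at even depths (where the target root
  marginal is `w/(1+w)` itself): the content of `sly_lemma42` (`HardcoreInapproximabilityTreesConc`);
* `HT6` — the pointwise lower tail of Theorem 3.10 in counting form: for `m' ≤ n^{γ₆}` and every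
  boundary configuration `η`, at most a `1/16` fraction of the realisations `(σ, τ)` of the random
  bipartite core have `Z^{s}_{G̃(σ,τ)}(η) < E Z^{s}(η)/√n` (small subgraph conditioning + second moment,
  Sly §§3.2–3.3; an INPUT here).
Then there are `θ ∈ (0, 1/8)` and `0 < q⁻ < q⁺ < 1` such that for all large `n` some realisation of
Sly's gadget `G(n, θ, ψ)` (on `≤ 3n` vertices, max degree `d`, `2m` ports of degree `≤ d - 1`,
`m = slyM d θ n`) satisfies `(GpropA)` and `(GpropB)` with `δ = n^{-2θ}` — the hypothesis of
`slyGadgetReduction_of_gadgetsAt` at `(d, λ)`.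
[cite: Sly2010, Theorem 2.1 and its proof (§4.1), Lemma 3.3, Lemma 4.2, Theorem 3.10] -/
theorem slyGadgetsAt_of_inputs {q : ℕ} (hq2 : 2 ≤ q) {lam : ℝ} (hlam : hardCoreThreshold (q + 1) < lam)
    (H42 : ∀ (qp qm w : ℝ), 0 < qm → qm < qp → qp < 1 →
      qp = lam * (1 - qm) ^ q / (1 + lam * (1 - qm) ^ q) →
      qm = lam * (1 - qp) ^ q / (1 + lam * (1 - qp) ^ q) →
      0 ≤ w → (w / (1 + w) = qp ∨ w / (1 + w) = qm) →
      ∃ ζ₁ ζ₂ : ℝ, 0 < ζ₁ ∧ 0 < ζ₂ ∧ ∃ ℓ₀ : ℕ, ∀ ℓ : ℕ, ℓ₀ ≤ ℓ → Even ℓ →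
        (∑ A : Fin (q ^ ℓ) → Bool,
            if Real.exp (-(ζ₁ * ℓ)) ≤ |hcTreeX q lam ℓ A - w / (1 + w)| then
              w ^ hcLeafCount A * hcTreeZtot q lam ℓ A else 0) ≤
          Real.exp (-Real.exp (ζ₂ * ℓ)) * ∑ A : Fin (q ^ ℓ) → Bool, w ^ hcLeafCount A * hcTreeZtot q lam ℓ A)
    (HT6 : ∃ γ₆ : ℝ, 0 < γ₆ ∧ ∃ n₆ : ℕ, ∀ n : ℕ, n₆ ≤ n → ∀ m' : ℕ, (m' : ℝ) ≤ (n : ℝ) ^ γ₆ →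
      ∀ (s : Bool) (Ep Em : Finset (Fin m')),
        16 * ((univ.filter fun ω : (Fin q → Equiv.Perm (Fin (n + m'))) × Equiv.Perm (Fin n) =>
          (Fintype.card ((Fin q → Equiv.Perm (Fin (n + m'))) × Equiv.Perm (Fin n)) : ℝ) * slyCoreZ ω.1 ω.2 lam s Ep Em <
            (∑ ω' : (Fin q → Equiv.Perm (Fin (n + m'))) × Equiv.Perm (Fin n), slyCoreZ ω'.1 ω'.2 lam s Ep Em) /
              Real.sqrt n).card : ℝ) ≤
          Fintype.card ((Fin q → Equiv.Perm (Fin (n + m'))) × Equiv.Perm (Fin n))) :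
    ∃ θ qp qm : ℝ, 0 < θ ∧ θ < 1 / 8 ∧ 0 < qm ∧ qm < qp ∧ qp < 1 ∧
      ∃ n₁ : ℕ, ∀ n : ℕ, n₁ ≤ n →
        ∃ (v : ℕ) (G : SimpleGraph (Fin v)) (Wp Wm : Finset (Fin v))
          (Vp Vm : Fin (slyM (q + 1) θ n) ↪ Fin v),
          (v : ℝ) ≤ 3 * n ∧ G.maxDegree ≤ q + 1 ∧ Disjoint Wp Wm ∧
            Disjoint (Set.range Vp) (Set.range Vm) ∧
            (∀ i, G.degree (Vp i) ≤ q) ∧ (∀ i, G.degree (Vm i) ≤ q) ∧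
            SlyPropA G lam Wp Wm n ∧
            SlyPropB G lam Wp Wm Vp Vm qp qm ((n : ℝ) ^ (-(2 * θ))) := by
  have hd : 3 ≤ q + 1 := by omega
  have hlam0 : 0 < lam := (hardCoreThreshold_pos hd).trans hlam
  obtain ⟨pp, pm, qp, qm, hpm, hpplt, hsum, hEα, hEβ, hqm, hqlt, hqp1, hqp_eq, hqm_eq, hqp_rec, hqm_rec⟩ :=
    exists_slyCriticalDensities hd hlam
  simp only [Nat.add_sub_cancel] at hEα hEβ hqp_rec hqm_rec
  -- Lemma 3.3 (phase form, ε = 1/2)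
  obtain ⟨γ, hγ, h33⟩ := sly_lemma33_phaseForm hd hlam hpm hpplt hsum (by simpa only [Nat.add_sub_cancel] using hEα)
    (by simpa only [Nat.add_sub_cancel] using hEβ)
  obtain ⟨n₀, hn₀⟩ := h33 (1 / 2) (by norm_num)
  simp only [Nat.add_sub_cancel] at hn₀
  rw [← hqp_eq, ← hqm_eq] at hn₀
  -- Lemma 4.2 at the two fugacities
  have hwp0 : 0 ≤ qp / (1 - qp) := div_nonneg (by linarith) (by linarith)
  have hwm0 : 0 ≤ qm / (1 - qm) := div_nonneg hqm.le (by linarith)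
  have hwp : qp / (1 - qp) / (1 + qp / (1 - qp)) = qp := by
    have : (1 - qp) ≠ 0 := by linarith
    field_simp
    ring
  have hwm : qm / (1 - qm) / (1 + qm / (1 - qm)) = qm := by
    have : (1 - qm) ≠ 0 := by linarith
    field_simp
    ring
  obtain ⟨ζ₁p, ζ₂p, hζ₁p, hζ₂p, ℓp, hℓp⟩ := H42 qp qm (qp / (1 - qp)) hqm hqlt hqp1 hqp_rec hqm_rec hwp0 (Or.inl hwp)
  obtain ⟨ζ₁m, ζ₂m, hζ₁m, hζ₂m, ℓm, hℓm⟩ := H42 qp qm (qm / (1 - qm)) hqm hqlt hqp1 hqp_rec hqm_rec hwm0 (Or.inr hwm)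
  rw [hwp] at hℓp
  rw [hwm] at hℓm
  obtain ⟨γ₆, hγ₆, n₆, hn₆⟩ := HT6
  have hLq : 0 < Real.log (((q + 1 : ℕ) : ℝ) - 1) := by
    apply Real.log_pos
    have : (2 : ℝ) ≤ q := by exact_mod_cast hq2
    push_cast
    linarith
  -- constants
  obtain ⟨ζ₁, hζ₁⟩ : ∃ ζ₁ : ℝ, ζ₁ = min ζ₁p ζ₁m := ⟨_, rfl⟩
  obtain ⟨ζ₂, hζ₂⟩ : ∃ ζ₂ : ℝ, ζ₂ = min ζ₂p ζ₂m := ⟨_, rfl⟩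
  have hζ₁0 : 0 < ζ₁ := by rw [hζ₁]; exact lt_min hζ₁p hζ₁m
  have hζ₂0 : 0 < ζ₂ := by rw [hζ₂]; exact lt_min hζ₂p hζ₂m
  have hζ₁p' : ζ₁ ≤ ζ₁p := by rw [hζ₁]; exact min_le_left _ _
  have hζ₁m' : ζ₁ ≤ ζ₁m := by rw [hζ₁]; exact min_le_right _ _
  have hζ₂p' : ζ₂ ≤ ζ₂p := by rw [hζ₂]; exact min_le_left _ _
  have hζ₂m' : ζ₂ ≤ ζ₂m := by rw [hζ₂]; exact min_le_right _ _
  obtain ⟨γ', hγ'⟩ : ∃ γ' : ℝ, γ' = min γ γ₆ := ⟨_, rfl⟩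
  have hγ'0 : 0 < γ' := by rw [hγ']; exact lt_min hγ hγ₆
  have hγ'1 : γ' ≤ γ := by rw [hγ']; exact min_le_left _ _
  have hγ'2 : γ' ≤ γ₆ := by rw [hγ']; exact min_le_right _ _
  obtain ⟨ψ, hψ⟩ : ∃ ψ : ℝ, ψ = min (γ' / 2) (1 / 4) := ⟨_, rfl⟩
  have hψ0 : 0 < ψ := by rw [hψ]; exact lt_min (by linarith) (by norm_num)
  have hψγ : ψ ≤ γ' / 2 := by rw [hψ]; exact min_le_left _ _
  have hψ4 : ψ ≤ 1 / 4 := by rw [hψ]; exact min_le_right _ _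
  obtain ⟨c₁, hc₁⟩ : ∃ c₁ : ℝ, c₁ = ζ₁ * ψ / Real.log (((q + 1 : ℕ) : ℝ) - 1) := ⟨_, rfl⟩
  obtain ⟨c₂, hc₂⟩ : ∃ c₂ : ℝ, c₂ = ζ₂ * ψ / Real.log (((q + 1 : ℕ) : ℝ) - 1) := ⟨_, rfl⟩
  have hc₁0 : 0 < c₁ := by rw [hc₁]; exact div_pos (mul_pos hζ₁0 hψ0) hLq
  have hc₂0 : 0 < c₂ := by rw [hc₂]; exact div_pos (mul_pos hζ₂0 hψ0) hLq
  obtain ⟨θ, hθ⟩ : ∃ θ : ℝ, θ = min (c₁ / 4) (min (c₂ / 2) (min (γ' / 4) (1 / 16))) := ⟨_, rfl⟩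
  have hθ0 : 0 < θ := by rw [hθ]; exact lt_min (by linarith) (lt_min (by linarith) (lt_min (by linarith) (by norm_num)))
  have hθ1 : θ ≤ c₁ / 4 := by rw [hθ]; exact min_le_left _ _
  have hθ2 : θ ≤ c₂ / 2 := by rw [hθ]; exact (min_le_right _ _).trans (min_le_left _ _)
  have hθ3 : θ ≤ γ' / 4 := by rw [hθ]; exact (min_le_right _ _).trans ((min_le_right _ _).trans (min_le_left _ _))
  have hθ4 : θ ≤ 1 / 16 := by rw [hθ]; exact (min_le_right _ _).trans ((min_le_right _ _).trans (min_le_right _ _))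
  have hθc₁ : 3 * θ < c₁ := by linarith
  have hθc₂ : θ < c₂ := by linarith
  have hθψγ : θ + ψ ≤ γ := by linarith
  have hθψγ₆ : θ + ψ ≤ γ₆ := by linarith
  have hθψ1 : θ + ψ < 1 := by linarith
  have hp0 : 0 < min qm (1 - qp) := lt_min hqm (by linarith)
  have hp1 : min qm (1 - qp) ≤ 1 := (min_le_left _ _).trans (by linarith)
  have hC₁0 : 0 < Real.exp (2 * ζ₁) := Real.exp_pos _
  have hK0 : 0 < Real.exp (-(2 * ζ₂)) := Real.exp_pos _
  -- eventual facts
  have E1 := eventually_reweight_small hd hθ0 hθc₁ hC₁0 hp0 (c₁ := c₁)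
  have E2 := eventually_badterm_small hd hθ0 hθc₂ hK0 hp0 hp1 (c₂ := c₂)
  have E3 := eventually_le_slyDepth hd hψ0 (max ℓp ℓm)
  have E4 := eventually_sqrt_bound
  have E5 := sly_vertexBound_eventually hd hθ0 hψ0 hθψ1
  have E6 : ∀ᶠ n : ℕ in atTop, Real.exp (2 * ζ₁) * (n : ℝ) ^ (-c₁) ≤ min qm (1 - qp) := by
    have h := ((tendsto_rpow_neg_atTop hc₁0).comp tendsto_natCast_atTop_atTop).const_mul (Real.exp (2 * ζ₁))
    rw [mul_zero] at h
    exact (h.eventually (eventually_le_nhds hp0)).mono fun n hn => by simpa using hn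
  obtain ⟨n₁, hn₁⟩ := Filter.eventually_atTop.1 (E1.and (E2.and (E3.and (E4.and (E5.and (E6.and
    ((eventually_ge_atTop (max n₀ n₆)).and (eventually_ge_atTop 1))))))))
  refine ⟨θ, qp, qm, hθ0, by linarith, hqm, hqlt, hqp1, n₁, fun n hn => ?_⟩
  obtain ⟨e1, e2, e3, e4, e5, e6, hnmax, hn1⟩ := hn₁ n hn
  have hnn₀ : n₀ ≤ n := (le_max_left _ _).trans hnmax
  have hnn₆ : n₆ ≤ n := (le_max_right _ _).trans hnmax
  have hn0 : (0 : ℝ) < n := by exact_mod_cast hn1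
  simp only [Nat.add_sub_cancel] at e5
  -- sizes
  have hm' : ((slyM (q + 1) θ n * q ^ slyDepth (q + 1) ψ n : ℕ) : ℝ) ≤ (n : ℝ) ^ (θ + ψ) := by
    have := slyM_mul_pow_le hd hθ0.le hψ0.le hn1
    simpa only [Nat.add_sub_cancel] using this
  have hm'γ : ((slyM (q + 1) θ n * q ^ slyDepth (q + 1) ψ n : ℕ) : ℝ) ≤ (n : ℝ) ^ γ :=
    hm'.trans (Real.rpow_le_rpow_of_exponent_le (by exact_mod_cast hn1) hθψγ)
  have hm'γ₆ : ((slyM (q + 1) θ n * q ^ slyDepth (q + 1) ψ n : ℕ) : ℝ) ≤ (n : ℝ) ^ γ₆ :=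
    hm'.trans (Real.rpow_le_rpow_of_exponent_le (by exact_mod_cast hn1) hθψγ₆)
  -- Lemma 3.3 at `(n, m')`
  obtain ⟨h33i, h33ii⟩ := hn₀ n hnn₀ (slyM (q + 1) θ n * q ^ slyDepth (q + 1) ψ n) hm'γ
  -- thresholds
  have hDp : ℓp ≤ slyDepth (q + 1) ψ n := (le_max_left _ _).trans e3
  have hDm : ℓm ≤ slyDepth (q + 1) ψ n := (le_max_right _ _).trans e3
  have hDeven : Even (slyDepth (q + 1) ψ n) := even_slyDepth _ _ _
  have hDD0 : (0 : ℝ) ≤ slyDepth (q + 1) ψ n := Nat.cast_nonneg _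
  have ht0 : 0 ≤ Real.exp (-(ζ₁ * slyDepth (q + 1) ψ n)) := (Real.exp_pos _).le
  have hτ0 : 0 ≤ Real.exp (-Real.exp (ζ₂ * slyDepth (q + 1) ψ n)) := (Real.exp_pos _).le
  have htp_le : Real.exp (-(ζ₁p * slyDepth (q + 1) ψ n)) ≤ Real.exp (-(ζ₁ * slyDepth (q + 1) ψ n)) :=
    Real.exp_le_exp.2 (neg_le_neg (mul_le_mul_of_nonneg_right hζ₁p' hDD0))
  have htm_le : Real.exp (-(ζ₁m * slyDepth (q + 1) ψ n)) ≤ Real.exp (-(ζ₁ * slyDepth (q + 1) ψ n)) :=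
    Real.exp_le_exp.2 (neg_le_neg (mul_le_mul_of_nonneg_right hζ₁m' hDD0))
  have hτp_le : Real.exp (-Real.exp (ζ₂p * slyDepth (q + 1) ψ n)) ≤ Real.exp (-Real.exp (ζ₂ * slyDepth (q + 1) ψ n)) :=
    Real.exp_le_exp.2 (neg_le_neg (Real.exp_le_exp.2 (mul_le_mul_of_nonneg_right hζ₂p' hDD0)))
  have hτm_le : Real.exp (-Real.exp (ζ₂m * slyDepth (q + 1) ψ n)) ≤ Real.exp (-Real.exp (ζ₂ * slyDepth (q + 1) ψ n)) :=
    Real.exp_le_exp.2 (neg_le_neg (Real.exp_le_exp.2 (mul_le_mul_of_nonneg_right hζ₂m' hDD0)))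
  have htC : Real.exp (-(ζ₁ * slyDepth (q + 1) ψ n)) ≤ Real.exp (2 * ζ₁) * (n : ℝ) ^ (-c₁) := by
    rw [hc₁]; exact exp_neg_mul_slyDepth_le hd hψ0.le hζ₁0.le hn1
  have htp : Real.exp (-(ζ₁ * slyDepth (q + 1) ψ n)) ≤ min qm (1 - qp) := htC.trans e6
  have hτK : Real.exp (-Real.exp (ζ₂ * slyDepth (q + 1) ψ n)) ≤ Real.exp (-(Real.exp (-(2 * ζ₂)) * (n : ℝ) ^ c₂)) := by
    apply Real.exp_le_exp.2
    apply neg_le_neg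
    rw [hc₂]; exact le_exp_mul_slyDepth hd hψ0.le hζ₂0.le hn1
  -- single-tree tails at depth `D`
  have htail_qp : (∑ A : Fin (q ^ slyDepth (q + 1) ψ n) → Bool,
      if Real.exp (-(ζ₁ * slyDepth (q + 1) ψ n)) < |hcTreeX q lam (slyDepth (q + 1) ψ n) A - qp| then
        (qp / (1 - qp)) ^ hcLeafCount A * hcTreeZtot q lam (slyDepth (q + 1) ψ n) A else 0) ≤
      Real.exp (-Real.exp (ζ₂ * slyDepth (q + 1) ψ n)) *
        ∑ A : Fin (q ^ slyDepth (q + 1) ψ n) → Bool, (qp / (1 - qp)) ^ hcLeafCount A * hcTreeZtot q lam (slyDepth (q + 1) ψ n) A := by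
    have h1 := hℓp (slyDepth (q + 1) ψ n) hDp hDeven
    have hf : ∀ A ∈ (univ : Finset (Fin (q ^ slyDepth (q + 1) ψ n) → Bool)),
        0 ≤ (qp / (1 - qp)) ^ hcLeafCount A * hcTreeZtot q lam (slyDepth (q + 1) ψ n) A :=
      fun A _ => mul_nonneg (pow_nonneg hwp0 _) (hcTreeZtot_pos hlam0.le _ A).le
    refine (sum_ite_lt_le_sum_ite_le univ (fun A => |hcTreeX q lam (slyDepth (q + 1) ψ n) A - qp|) _ hf htp_le).trans
      (h1.trans ?_)
    exact mul_le_mul_of_nonneg_right hτp_le (Finset.sum_nonneg hf)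
  have htail_qm : (∑ A : Fin (q ^ slyDepth (q + 1) ψ n) → Bool,
      if Real.exp (-(ζ₁ * slyDepth (q + 1) ψ n)) < |hcTreeX q lam (slyDepth (q + 1) ψ n) A - qm| then
        (qm / (1 - qm)) ^ hcLeafCount A * hcTreeZtot q lam (slyDepth (q + 1) ψ n) A else 0) ≤
      Real.exp (-Real.exp (ζ₂ * slyDepth (q + 1) ψ n)) *
        ∑ A : Fin (q ^ slyDepth (q + 1) ψ n) → Bool, (qm / (1 - qm)) ^ hcLeafCount A * hcTreeZtot q lam (slyDepth (q + 1) ψ n) A := by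
    have h1 := hℓm (slyDepth (q + 1) ψ n) hDm hDeven
    have hf : ∀ A ∈ (univ : Finset (Fin (q ^ slyDepth (q + 1) ψ n) → Bool)),
        0 ≤ (qm / (1 - qm)) ^ hcLeafCount A * hcTreeZtot q lam (slyDepth (q + 1) ψ n) A :=
      fun A _ => mul_nonneg (pow_nonneg hwm0 _) (hcTreeZtot_pos hlam0.le _ A).le
    refine (sum_ite_lt_le_sum_ite_le univ (fun A => |hcTreeX q lam (slyDepth (q + 1) ψ n) A - qm|) _ hf htm_le).trans
      (h1.trans ?_)
    exact mul_le_mul_of_nonneg_right hτm_le (Finset.sum_nonneg hf)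
  -- conclude with the per-`n` lemma
  exact slyGadgetAt_of_facts hq2 hlam0 hqm hqlt hqp1 hn1 (slyDepth (q + 1) ψ n) ht0 htp hτ0 h33i h33ii htail_qp htail_qm
    (fun s Ep Em => hn₆ n hnn₆ _ hm'γ₆ s Ep Em)
    (e1 _ ht0 htC) (e2 _ hτ0 hτK) e4 e5

/-- **`slyGadgetReduction` from the two probabilistic inputs at every admissible degree.**
[cite: Sly2010, Theorem 2.1; Lemma 2.2] -/
theorem slyGadgetReduction_of_inputs
    (H42 : ∀ (q : ℕ), 2 ≤ q → ∀ (lam : ℝ), hardCoreThreshold (q + 1) < lam → ∀ (qp qm w : ℝ), 0 < qm → qm < qp → qp < 1 →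
      qp = lam * (1 - qm) ^ q / (1 + lam * (1 - qm) ^ q) →
      qm = lam * (1 - qp) ^ q / (1 + lam * (1 - qp) ^ q) →
      0 ≤ w → (w / (1 + w) = qp ∨ w / (1 + w) = qm) →
      ∃ ζ₁ ζ₂ : ℝ, 0 < ζ₁ ∧ 0 < ζ₂ ∧ ∃ ℓ₀ : ℕ, ∀ ℓ : ℕ, ℓ₀ ≤ ℓ → Even ℓ →
        (∑ A : Fin (q ^ ℓ) → Bool,
            if Real.exp (-(ζ₁ * ℓ)) ≤ |hcTreeX q lam ℓ A - w / (1 + w)| then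
              w ^ hcLeafCount A * hcTreeZtot q lam ℓ A else 0) ≤
          Real.exp (-Real.exp (ζ₂ * ℓ)) * ∑ A : Fin (q ^ ℓ) → Bool, w ^ hcLeafCount A * hcTreeZtot q lam ℓ A)
    (HT6 : ∀ (q : ℕ), 2 ≤ q → ∀ (lam : ℝ), hardCoreThreshold (q + 1) < lam →
      ∃ γ₆ : ℝ, 0 < γ₆ ∧ ∃ n₆ : ℕ, ∀ n : ℕ, n₆ ≤ n → ∀ m' : ℕ, (m' : ℝ) ≤ (n : ℝ) ^ γ₆ →
      ∀ (s : Bool) (Ep Em : Finset (Fin m')),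
        16 * ((univ.filter fun ω : (Fin q → Equiv.Perm (Fin (n + m'))) × Equiv.Perm (Fin n) =>
          (Fintype.card ((Fin q → Equiv.Perm (Fin (n + m'))) × Equiv.Perm (Fin n)) : ℝ) * slyCoreZ ω.1 ω.2 lam s Ep Em <
            (∑ ω' : (Fin q → Equiv.Perm (Fin (n + m'))) × Equiv.Perm (Fin n), slyCoreZ ω'.1 ω'.2 lam s Ep Em) /
              Real.sqrt n).card : ℝ) ≤
          Fintype.card ((Fin q → Equiv.Perm (Fin (n + m'))) × Equiv.Perm (Fin n))) :
    slyGadgetReduction := by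
  refine slyGadgetReduction_of_gadgetsAt fun d hd lam hlam _ => ?_
  obtain ⟨q, rfl⟩ : ∃ q, d = q + 1 := ⟨d - 1, by omega⟩
  have hq2 : 2 ≤ q := by omega
  simp only [Nat.add_sub_cancel]
  exact slyGadgetsAt_of_inputs hq2 hlam (H42 q hq2 lam hlam) (HT6 q hq2 lam hlam)

end FinalAssembly2

end Literature.Computability.Complexity
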